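import Literature.AlgebraicGeometry.HodgeTheory.RibetTypeEightyNinefoldPowersHodgeClasses
import Literature.AlgebraicGeometry.Motives.HodgeThetaSubalgebraUnitaryEightEightyOneCore
import Literature.AlgebraicGeometry.Motives.HodgeThetaSubalgebraUnitaryNineEightyCore
import Literature.AlgebraicGeometry.Motives.HodgeThetaSubalgebraUnitaryTwelveSeventySevenCore
import Literature.AlgebraicGeometry.Motives.HodgeThetaSubalgebraUnitaryFourteenSeventyFiveCore
import Literature.AlgebraicGeometry.Motives.HodgeThetaSubalgebraUnitaryFifteenSeventyFourCore
import Literature.AlgebraicGeometry.Motives.HodgeThetaSubalgebraUnitarySeventeenSeventyTwoCore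
import Literature.AlgebraicGeometry.Motives.HodgeThetaSubalgebraUnitaryNineteenSeventyCore
import Literature.AlgebraicGeometry.Motives.HodgeThetaSubalgebraUnitaryTwentySixtyNineCore
import Literature.AlgebraicGeometry.Motives.HodgeThetaSubalgebraUnitaryTwentyOneSixtyEightCore
import Literature.AlgebraicGeometry.Motives.HodgeThetaSubalgebraUnitaryTwentyThreeSixtySixCore
import Literature.AlgebraicGeometry.Motives.HodgeThetaSubalgebraUnitaryTwentyFourSixtyFiveCore
import Literature.AlgebraicGeometry.Motives.HodgeThetaSubalgebraUnitaryTwentyFiveSixtyFourCore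
import Literature.AlgebraicGeometry.Motives.HodgeThetaSubalgebraUnitaryTwentySixSixtyThreeCore
import Literature.AlgebraicGeometry.Motives.HodgeThetaSubalgebraUnitaryTwentySevenSixtyTwoCore
import Literature.AlgebraicGeometry.Motives.HodgeThetaSubalgebraUnitaryTwentyNineSixtyCore
import Literature.AlgebraicGeometry.Motives.HodgeThetaSubalgebraUnitaryThirtyOneFiftyEightCore
import Literature.AlgebraicGeometry.Motives.HodgeThetaSubalgebraUnitaryThirtyTwoFiftySevenCore
import Literature.AlgebraicGeometry.Motives.HodgeThetaSubalgebraUnitaryThirtyThreeFiftySixCore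
import Literature.AlgebraicGeometry.Motives.HodgeThetaSubalgebraUnitaryThirtyFourFiftyFiveCore
import Literature.AlgebraicGeometry.Motives.HodgeThetaSubalgebraUnitaryThirtyFiveFiftyFourCore
import Literature.AlgebraicGeometry.Motives.HodgeThetaSubalgebraUnitaryThirtySevenFiftyTwoCore
import Literature.AlgebraicGeometry.Motives.HodgeThetaSubalgebraUnitaryThirtyEightFiftyOneCore
import Literature.AlgebraicGeometry.Motives.HodgeThetaSubalgebraUnitaryThirtyNineFiftyCore
import Literature.AlgebraicGeometry.Motives.HodgeThetaSubalgebraUnitaryFortyFortyNineCore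
import Literature.AlgebraicGeometry.Motives.HodgeThetaSubalgebraUnitaryFortyOneFortyEightCore
import Literature.AlgebraicGeometry.Motives.HodgeThetaSubalgebraUnitaryFortyThreeFortySixCore
import Literature.AlgebraicGeometry.Motives.HodgeThetaSubalgebraUnitaryFortyFourFortyFiveCore
import HarnessLib

/-!
# Hodge classes on all powers of abelian varieties of Ribet type `(8, 81)`, `(9, 80)`, `(12, 77)`, `(14, 75)`, `(15, 74)`, `(17, 72)`, `(19, 70)`, `(20, 69)`, `(21, 68)`, `(23, 66)`, `(24, 65)`, `(25, 64)`, `(26, 63)`, `(27, 62)`, `(29, 60)`, `(31, 58)`, `(32, 57)`, `(33, 56)`, `(34, 55)`, `(35, 54)`, `(37, 52)`, `(38, 51)`, `(39, 50)`, `(40, 49)`, `(41, 48)`, `(43, 46)`, `(44, 45)`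
# are generated by divisor classes (Ribet 1983 Thm. 3 at these multiplicities, by the MINIMAL-RANK method —
# UNCONDITIONAL); EVERY SIMPLE COMPLEX ABELIAN 89-FOLD WITH `End⁰ ≠ ℚ`

Family `hodge`, layer `Literature/AlgebraicGeometry/HodgeTheory`. Research context: cell `pub-hodge-ring2` (HONEST
FRAMING: research route conditional on HC_CM; not a corollary; Q11.4-sentence-2 already refuted in dim ≥ 3),
Literature lane gen 90. UNCONDITIONAL for the class of abelian varieties it names; theorems only, no definition, no
named fact (D-0026), no `sorry`. The CELLS of the generic assembly `RibetTypeOfCoreSmulPowersHodgeClasses` at the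
minimal-rank cores `Unitary….eq_top_of_smul` of the eleven `p = 89` cells with bad raising ranks (settled rank by rank:
a full small Levi algebra and lifts killed in the large one, two pencils, exclusive Levi profiles, TOOL C, the
orthogonal-chain count `UnitaryOrthogonalChain.false_of_constProfile(_pos)`, constant-rank sub-Levi lemmas, the mirror
`−Θ` and raising-rank sub-families), and the conclusion of the census `isDivisorGenerated_powSucc_of_isSimple_eightyninefold`:
with all eleven residual `k`-signatures `{8, 81}`, `{9, 80}`, `{12, 77}`, `{14, 75}`, `{15, 74}`, `{17, 72}`, `{19, 70}`, `{20, 69}`, `{21, 68}`, `{23, 66}`, `{24, 65}`, `{25, 64}`, `{26, 63}`, `{27, 62}`, `{29, 60}`, `{31, 58}`, `{32, 57}`, `{33, 56}`, `{34, 55}`, `{35, 54}`, `{37, 52}`, `{38, 51}`, `{39, 50}`, `{40, 49}`, `{41, 48}`, `{43, 46}`, `{44, 45}` supplied, every simple complex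
abelian `89`-fold with `End⁰ ≠ ℚ` has `B• = D•` and the Hodge conjecture on all powers — `p = 89` COMPLETE, as
`p = 17, …, 43` before it (`RibetTypeTwentyOneTwentyTwoPowersHodgeClasses`).

THE PRINTED THEOREM. Ribet, Amer. J. Math. 105 (1983), Thm. 3 = Gordon's survey Thm. 6.3 (3) [held
`paper:arxiv-alg-geom_9709030` p. 18]: for an abelian variety `A` with `End⁰(A)` an imaginary quadratic field `K` acting
with relatively prime multiplicities `(n′, n″)`, `Hg(A) = Lf(A)` and the Hodge ring of every power of `A` is generated by
divisors (ibid. Thm. 6.2 = Ribet Thm. 0).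

* §1 the cells `(8, 81)`, `(9, 80)`, `(12, 77)`, `(14, 75)`, `(15, 74)`, `(17, 72)`, `(19, 70)`, `(20, 69)`, `(21, 68)`, `(23, 66)`, `(24, 65)`, `(25, 64)`, `(26, 63)`, `(27, 62)`, `(29, 60)`, `(31, 58)`, `(32, 57)`, `(33, 56)`, `(34, 55)`, `(35, 54)`, `(37, 52)`, `(38, 51)`, `(39, 50)`, `(40, 49)`, `(41, 48)`, `(43, 46)`, `(44, 45)` (and mirrors), the Hodge conjecture for these
  powers, 89-FOLDS of these signatures.
* §2 `isDivisorGenerated_powSucc_of_isSimple_eightyninefold'` (granted only `End⁰ = ℚ`),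
  `isDivisorGenerated_powSucc_of_isSimple_eightyninefold_of_finrank_endAlgebra_ne_one`,
  `hodgeConjectureFor_powSucc_of_isSimple_eightyninefold_of_finrank_endAlgebra_ne_one`.

## References
* [Ribet1983] K. A. Ribet, Amer. J. Math. 105 (1983), Thm. 0 and Thm. 3.
* [Gordon1997] B. B. Gordon, *A survey of the Hodge conjecture for abelian varieties*, Thm. 6.3 (3) and Corollary.
* [MoonenZarhin1999LowDim] B. Moonen, Yu. Zarhin, Math. Ann. 315 (1999), §2 (2.4), Thm. (2.7).
* [Deligne2000] P. Deligne, *The Hodge conjecture* (Clay, 2000), §1.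
-/

noncomputable section

open CategoryTheory Module

namespace Literature.AlgebraicGeometry.HodgeTheory

open Literature.AlgebraicGeometry.Motives
open Literature.AlgebraicGeometry.Motives.HodgeStructure

section Cells

/-- **Ribet 1983 Thm. 3 at `(n′, n″) = (8, 81)` — UNCONDITIONAL** (core `UnitaryEightEightyOne.eq_top_of_smul`).
[cite: Ribet1983, Thm. 0 and Thm. 3] [cite: Gordon1997, Thm. 6.3 (3) and Corollary] -/
theorem AbelianVariety.isDivisorGenerated_powSucc_of_ribetTypeEightEightyOne (A : AbelianVariety ℂ) (φ : A ⟶ A)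
    {d : ℕ} (hd : 0 < d) (hφ : φ ≫ φ = -(d • 𝟙 A)) (hE2 : Module.finrank ℚ A.endAlgebra = 2)
    (h8 : eigenMultiplicity A φ (Complex.I * (Real.sqrt d : ℂ)) = 8)
    (h81 : eigenMultiplicity A φ (-(Complex.I * (Real.sqrt d : ℂ))) = 81) (N : ℕ) :
    IsDivisorGenerated (A.powSucc N) := by
  refine AbelianVariety.isDivisorGenerated_powSucc_of_ribetType_ofCoreSmul A φ hd hφ hE2 (by omega) (by omega) ?_ N
  intro W' _ _ _ 𝔊 ι P' Q' s hbr hirr hι hιι hP' hQ' hfinP' hfinQ' hadd hsmul hsymm hPQ hdefP hdefQ hadj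
  exact UnitaryEightEightyOne.eq_top_of_smul hbr hirr hι hιι hP' hQ' (by rw [hfinP', h8]) (by rw [hfinQ', h81]) hadd
    hsmul hsymm hPQ hdefP hdefQ hadj

/-- The mirror: `n_{i√d}(φ) = 81`, `n_{−i√d}(φ) = 8` (core `UnitaryEightEightyOne.eq_top_of_smul'`).
[cite: Ribet1983, Thm. 0 and Thm. 3] [cite: Gordon1997, Thm. 6.3 (3) and Corollary] -/
theorem AbelianVariety.isDivisorGenerated_powSucc_of_ribetTypeEightEightyOne' (A : AbelianVariety ℂ) (φ : A ⟶ A)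
    {d : ℕ} (hd : 0 < d) (hφ : φ ≫ φ = -(d • 𝟙 A)) (hE2 : Module.finrank ℚ A.endAlgebra = 2)
    (h81 : eigenMultiplicity A φ (Complex.I * (Real.sqrt d : ℂ)) = 81)
    (h8 : eigenMultiplicity A φ (-(Complex.I * (Real.sqrt d : ℂ))) = 8) (N : ℕ) :
    IsDivisorGenerated (A.powSucc N) := by
  refine AbelianVariety.isDivisorGenerated_powSucc_of_ribetType_ofCoreSmul A φ hd hφ hE2 (by omega) (by omega) ?_ N
  intro W' _ _ _ 𝔊 ι P' Q' s hbr hirr hι hιι hP' hQ' hfinP' hfinQ' hadd hsmul hsymm hPQ hdefP hdefQ hadj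
  exact UnitaryEightEightyOne.eq_top_of_smul' hbr hirr hι hιι hP' hQ' (by rw [hfinP', h81]) (by rw [hfinQ', h8])
    hadd hsmul hsymm hPQ hdefP hdefQ hadj

/-- **The Hodge conjecture for all powers `A^{N+1}` of an abelian variety of Ribet type `(8, 81)` — UNCONDITIONAL.**
[cite: Ribet1983, Thm. 3] [cite: Deligne2000, §1] -/
theorem hodgeConjectureFor_powSucc_of_ribetTypeEightEightyOne (A : AbelianVariety ℂ) (φ : A ⟶ A)
    {d : ℕ} (hd : 0 < d) (hφ : φ ≫ φ = -(d • 𝟙 A)) (hE2 : Module.finrank ℚ A.endAlgebra = 2)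
    (h8 : eigenMultiplicity A φ (Complex.I * (Real.sqrt d : ℂ)) = 8)
    (h81 : eigenMultiplicity A φ (-(Complex.I * (Real.sqrt d : ℂ))) = 81) (N : ℕ) :
    HodgeConjectureFor (A.powSucc N).dim (A.powSucc N).X :=
  hodgeConjectureFor_of_isDivisorGenerated _
    (AbelianVariety.isDivisorGenerated_powSucc_of_ribetTypeEightEightyOne A φ hd hφ hE2 h8 h81 N)

/-- **89-FOLDS of signature `{8, 81}`: `B• = D•` on all powers — UNCONDITIONAL** (either eigenvalue may carry the `8`).
[cite: Ribet1983, Thm. 0 and Thm. 3] [cite: MoonenZarhin1999LowDim, §2 (2.4)] -/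
theorem AbelianVariety.isDivisorGenerated_powSucc_of_eightyninefold_eightEightyOne (A : AbelianVariety ℂ)
    (φ : A ⟶ A) {d : ℕ} (hd : 0 < d) (hφ : φ ≫ φ = -(d • 𝟙 A)) (hE2 : Module.finrank ℚ A.endAlgebra = 2)
    (hX : A.dim = 89)
    (h8 : eigenMultiplicity A φ (Complex.I * (Real.sqrt d : ℂ)) = 8 ∨
      eigenMultiplicity A φ (-(Complex.I * (Real.sqrt d : ℂ))) = 8)
    (N : ℕ) : IsDivisorGenerated (A.powSucc N) := by
  have hsum := eigenMultiplicity_add_eigenMultiplicity_neg_eq_dim A φ hd hφ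
  rw [hX] at hsum
  rcases h8 with h | h
  · exact AbelianVariety.isDivisorGenerated_powSucc_of_ribetTypeEightEightyOne A φ hd hφ hE2 h (by omega) N
  · exact AbelianVariety.isDivisorGenerated_powSucc_of_ribetTypeEightEightyOne' A φ hd hφ hE2 (by omega) h N

/-- **The Hodge conjecture for all powers of a 89-FOLD of signature `{8, 81}` — UNCONDITIONAL.**
[cite: Ribet1983, Thm. 3] [cite: Deligne2000, §1] -/
theorem hodgeConjectureFor_powSucc_of_eightyninefold_eightEightyOne (A : AbelianVariety ℂ)
    (φ : A ⟶ A) {d : ℕ} (hd : 0 < d) (hφ : φ ≫ φ = -(d • 𝟙 A)) (hE2 : Module.finrank ℚ A.endAlgebra = 2)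
    (hX : A.dim = 89)
    (h8 : eigenMultiplicity A φ (Complex.I * (Real.sqrt d : ℂ)) = 8 ∨
      eigenMultiplicity A φ (-(Complex.I * (Real.sqrt d : ℂ))) = 8)
    (N : ℕ) : HodgeConjectureFor (A.powSucc N).dim (A.powSucc N).X :=
  hodgeConjectureFor_of_isDivisorGenerated _
    (AbelianVariety.isDivisorGenerated_powSucc_of_eightyninefold_eightEightyOne A φ hd hφ hE2 hX h8 N)

/-- **Ribet 1983 Thm. 3 at `(n′, n″) = (9, 80)` — UNCONDITIONAL** (core `UnitaryNineEighty.eq_top_of_smul`).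
[cite: Ribet1983, Thm. 0 and Thm. 3] [cite: Gordon1997, Thm. 6.3 (3) and Corollary] -/
theorem AbelianVariety.isDivisorGenerated_powSucc_of_ribetTypeNineEighty (A : AbelianVariety ℂ) (φ : A ⟶ A)
    {d : ℕ} (hd : 0 < d) (hφ : φ ≫ φ = -(d • 𝟙 A)) (hE2 : Module.finrank ℚ A.endAlgebra = 2)
    (h9 : eigenMultiplicity A φ (Complex.I * (Real.sqrt d : ℂ)) = 9)
    (h80 : eigenMultiplicity A φ (-(Complex.I * (Real.sqrt d : ℂ))) = 80) (N : ℕ) :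
    IsDivisorGenerated (A.powSucc N) := by
  refine AbelianVariety.isDivisorGenerated_powSucc_of_ribetType_ofCoreSmul A φ hd hφ hE2 (by omega) (by omega) ?_ N
  intro W' _ _ _ 𝔊 ι P' Q' s hbr hirr hι hιι hP' hQ' hfinP' hfinQ' hadd hsmul hsymm hPQ hdefP hdefQ hadj
  exact UnitaryNineEighty.eq_top_of_smul hbr hirr hι hιι hP' hQ' (by rw [hfinP', h9]) (by rw [hfinQ', h80]) hadd
    hsmul hsymm hPQ hdefP hdefQ hadj

/-- The mirror: `n_{i√d}(φ) = 80`, `n_{−i√d}(φ) = 9` (core `UnitaryNineEighty.eq_top_of_smul'`).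
[cite: Ribet1983, Thm. 0 and Thm. 3] [cite: Gordon1997, Thm. 6.3 (3) and Corollary] -/
theorem AbelianVariety.isDivisorGenerated_powSucc_of_ribetTypeNineEighty' (A : AbelianVariety ℂ) (φ : A ⟶ A)
    {d : ℕ} (hd : 0 < d) (hφ : φ ≫ φ = -(d • 𝟙 A)) (hE2 : Module.finrank ℚ A.endAlgebra = 2)
    (h80 : eigenMultiplicity A φ (Complex.I * (Real.sqrt d : ℂ)) = 80)
    (h9 : eigenMultiplicity A φ (-(Complex.I * (Real.sqrt d : ℂ))) = 9) (N : ℕ) :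
    IsDivisorGenerated (A.powSucc N) := by
  refine AbelianVariety.isDivisorGenerated_powSucc_of_ribetType_ofCoreSmul A φ hd hφ hE2 (by omega) (by omega) ?_ N
  intro W' _ _ _ 𝔊 ι P' Q' s hbr hirr hι hιι hP' hQ' hfinP' hfinQ' hadd hsmul hsymm hPQ hdefP hdefQ hadj
  exact UnitaryNineEighty.eq_top_of_smul' hbr hirr hι hιι hP' hQ' (by rw [hfinP', h80]) (by rw [hfinQ', h9])
    hadd hsmul hsymm hPQ hdefP hdefQ hadj

/-- **The Hodge conjecture for all powers `A^{N+1}` of an abelian variety of Ribet type `(9, 80)` — UNCONDITIONAL.**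
[cite: Ribet1983, Thm. 3] [cite: Deligne2000, §1] -/
theorem hodgeConjectureFor_powSucc_of_ribetTypeNineEighty (A : AbelianVariety ℂ) (φ : A ⟶ A)
    {d : ℕ} (hd : 0 < d) (hφ : φ ≫ φ = -(d • 𝟙 A)) (hE2 : Module.finrank ℚ A.endAlgebra = 2)
    (h9 : eigenMultiplicity A φ (Complex.I * (Real.sqrt d : ℂ)) = 9)
    (h80 : eigenMultiplicity A φ (-(Complex.I * (Real.sqrt d : ℂ))) = 80) (N : ℕ) :
    HodgeConjectureFor (A.powSucc N).dim (A.powSucc N).X :=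
  hodgeConjectureFor_of_isDivisorGenerated _
    (AbelianVariety.isDivisorGenerated_powSucc_of_ribetTypeNineEighty A φ hd hφ hE2 h9 h80 N)

/-- **89-FOLDS of signature `{9, 80}`: `B• = D•` on all powers — UNCONDITIONAL** (either eigenvalue may carry the `9`).
[cite: Ribet1983, Thm. 0 and Thm. 3] [cite: MoonenZarhin1999LowDim, §2 (2.4)] -/
theorem AbelianVariety.isDivisorGenerated_powSucc_of_eightyninefold_nineEighty (A : AbelianVariety ℂ)
    (φ : A ⟶ A) {d : ℕ} (hd : 0 < d) (hφ : φ ≫ φ = -(d • 𝟙 A)) (hE2 : Module.finrank ℚ A.endAlgebra = 2)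
    (hX : A.dim = 89)
    (h9 : eigenMultiplicity A φ (Complex.I * (Real.sqrt d : ℂ)) = 9 ∨
      eigenMultiplicity A φ (-(Complex.I * (Real.sqrt d : ℂ))) = 9)
    (N : ℕ) : IsDivisorGenerated (A.powSucc N) := by
  have hsum := eigenMultiplicity_add_eigenMultiplicity_neg_eq_dim A φ hd hφ
  rw [hX] at hsum
  rcases h9 with h | h
  · exact AbelianVariety.isDivisorGenerated_powSucc_of_ribetTypeNineEighty A φ hd hφ hE2 h (by omega) N
  · exact AbelianVariety.isDivisorGenerated_powSucc_of_ribetTypeNineEighty' A φ hd hφ hE2 (by omega) h N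

/-- **The Hodge conjecture for all powers of a 89-FOLD of signature `{9, 80}` — UNCONDITIONAL.**
[cite: Ribet1983, Thm. 3] [cite: Deligne2000, §1] -/
theorem hodgeConjectureFor_powSucc_of_eightyninefold_nineEighty (A : AbelianVariety ℂ)
    (φ : A ⟶ A) {d : ℕ} (hd : 0 < d) (hφ : φ ≫ φ = -(d • 𝟙 A)) (hE2 : Module.finrank ℚ A.endAlgebra = 2)
    (hX : A.dim = 89)
    (h9 : eigenMultiplicity A φ (Complex.I * (Real.sqrt d : ℂ)) = 9 ∨
      eigenMultiplicity A φ (-(Complex.I * (Real.sqrt d : ℂ))) = 9)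
    (N : ℕ) : HodgeConjectureFor (A.powSucc N).dim (A.powSucc N).X :=
  hodgeConjectureFor_of_isDivisorGenerated _
    (AbelianVariety.isDivisorGenerated_powSucc_of_eightyninefold_nineEighty A φ hd hφ hE2 hX h9 N)

/-- **Ribet 1983 Thm. 3 at `(n′, n″) = (12, 77)` — UNCONDITIONAL** (core `UnitaryTwelveSeventySeven.eq_top_of_smul`).
[cite: Ribet1983, Thm. 0 and Thm. 3] [cite: Gordon1997, Thm. 6.3 (3) and Corollary] -/
theorem AbelianVariety.isDivisorGenerated_powSucc_of_ribetTypeTwelveSeventySeven (A : AbelianVariety ℂ) (φ : A ⟶ A)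
    {d : ℕ} (hd : 0 < d) (hφ : φ ≫ φ = -(d • 𝟙 A)) (hE2 : Module.finrank ℚ A.endAlgebra = 2)
    (h12 : eigenMultiplicity A φ (Complex.I * (Real.sqrt d : ℂ)) = 12)
    (h77 : eigenMultiplicity A φ (-(Complex.I * (Real.sqrt d : ℂ))) = 77) (N : ℕ) :
    IsDivisorGenerated (A.powSucc N) := by
  refine AbelianVariety.isDivisorGenerated_powSucc_of_ribetType_ofCoreSmul A φ hd hφ hE2 (by omega) (by omega) ?_ N
  intro W' _ _ _ 𝔊 ι P' Q' s hbr hirr hι hιι hP' hQ' hfinP' hfinQ' hadd hsmul hsymm hPQ hdefP hdefQ hadj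
  exact UnitaryTwelveSeventySeven.eq_top_of_smul hbr hirr hι hιι hP' hQ' (by rw [hfinP', h12]) (by rw [hfinQ', h77]) hadd
    hsmul hsymm hPQ hdefP hdefQ hadj

/-- The mirror: `n_{i√d}(φ) = 77`, `n_{−i√d}(φ) = 12` (core `UnitaryTwelveSeventySeven.eq_top_of_smul'`).
[cite: Ribet1983, Thm. 0 and Thm. 3] [cite: Gordon1997, Thm. 6.3 (3) and Corollary] -/
theorem AbelianVariety.isDivisorGenerated_powSucc_of_ribetTypeTwelveSeventySeven' (A : AbelianVariety ℂ) (φ : A ⟶ A)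
    {d : ℕ} (hd : 0 < d) (hφ : φ ≫ φ = -(d • 𝟙 A)) (hE2 : Module.finrank ℚ A.endAlgebra = 2)
    (h77 : eigenMultiplicity A φ (Complex.I * (Real.sqrt d : ℂ)) = 77)
    (h12 : eigenMultiplicity A φ (-(Complex.I * (Real.sqrt d : ℂ))) = 12) (N : ℕ) :
    IsDivisorGenerated (A.powSucc N) := by
  refine AbelianVariety.isDivisorGenerated_powSucc_of_ribetType_ofCoreSmul A φ hd hφ hE2 (by omega) (by omega) ?_ N
  intro W' _ _ _ 𝔊 ι P' Q' s hbr hirr hι hιι hP' hQ' hfinP' hfinQ' hadd hsmul hsymm hPQ hdefP hdefQ hadj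
  exact UnitaryTwelveSeventySeven.eq_top_of_smul' hbr hirr hι hιι hP' hQ' (by rw [hfinP', h77]) (by rw [hfinQ', h12])
    hadd hsmul hsymm hPQ hdefP hdefQ hadj

/-- **The Hodge conjecture for all powers `A^{N+1}` of an abelian variety of Ribet type `(12, 77)` — UNCONDITIONAL.**
[cite: Ribet1983, Thm. 3] [cite: Deligne2000, §1] -/
theorem hodgeConjectureFor_powSucc_of_ribetTypeTwelveSeventySeven (A : AbelianVariety ℂ) (φ : A ⟶ A)
    {d : ℕ} (hd : 0 < d) (hφ : φ ≫ φ = -(d • 𝟙 A)) (hE2 : Module.finrank ℚ A.endAlgebra = 2)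
    (h12 : eigenMultiplicity A φ (Complex.I * (Real.sqrt d : ℂ)) = 12)
    (h77 : eigenMultiplicity A φ (-(Complex.I * (Real.sqrt d : ℂ))) = 77) (N : ℕ) :
    HodgeConjectureFor (A.powSucc N).dim (A.powSucc N).X :=
  hodgeConjectureFor_of_isDivisorGenerated _
    (AbelianVariety.isDivisorGenerated_powSucc_of_ribetTypeTwelveSeventySeven A φ hd hφ hE2 h12 h77 N)

/-- **89-FOLDS of signature `{12, 77}`: `B• = D•` on all powers — UNCONDITIONAL** (either eigenvalue may carry the `12`).
[cite: Ribet1983, Thm. 0 and Thm. 3] [cite: MoonenZarhin1999LowDim, §2 (2.4)] -/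
theorem AbelianVariety.isDivisorGenerated_powSucc_of_eightyninefold_twelveSeventySeven (A : AbelianVariety ℂ)
    (φ : A ⟶ A) {d : ℕ} (hd : 0 < d) (hφ : φ ≫ φ = -(d • 𝟙 A)) (hE2 : Module.finrank ℚ A.endAlgebra = 2)
    (hX : A.dim = 89)
    (h12 : eigenMultiplicity A φ (Complex.I * (Real.sqrt d : ℂ)) = 12 ∨
      eigenMultiplicity A φ (-(Complex.I * (Real.sqrt d : ℂ))) = 12)
    (N : ℕ) : IsDivisorGenerated (A.powSucc N) := by
  have hsum := eigenMultiplicity_add_eigenMultiplicity_neg_eq_dim A φ hd hφ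
  rw [hX] at hsum
  rcases h12 with h | h
  · exact AbelianVariety.isDivisorGenerated_powSucc_of_ribetTypeTwelveSeventySeven A φ hd hφ hE2 h (by omega) N
  · exact AbelianVariety.isDivisorGenerated_powSucc_of_ribetTypeTwelveSeventySeven' A φ hd hφ hE2 (by omega) h N

/-- **The Hodge conjecture for all powers of a 89-FOLD of signature `{12, 77}` — UNCONDITIONAL.**
[cite: Ribet1983, Thm. 3] [cite: Deligne2000, §1] -/
theorem hodgeConjectureFor_powSucc_of_eightyninefold_twelveSeventySeven (A : AbelianVariety ℂ)
    (φ : A ⟶ A) {d : ℕ} (hd : 0 < d) (hφ : φ ≫ φ = -(d • 𝟙 A)) (hE2 : Module.finrank ℚ A.endAlgebra = 2)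
    (hX : A.dim = 89)
    (h12 : eigenMultiplicity A φ (Complex.I * (Real.sqrt d : ℂ)) = 12 ∨
      eigenMultiplicity A φ (-(Complex.I * (Real.sqrt d : ℂ))) = 12)
    (N : ℕ) : HodgeConjectureFor (A.powSucc N).dim (A.powSucc N).X :=
  hodgeConjectureFor_of_isDivisorGenerated _
    (AbelianVariety.isDivisorGenerated_powSucc_of_eightyninefold_twelveSeventySeven A φ hd hφ hE2 hX h12 N)

/-- **Ribet 1983 Thm. 3 at `(n′, n″) = (14, 75)` — UNCONDITIONAL** (core `UnitaryFourteenSeventyFive.eq_top_of_smul`).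
[cite: Ribet1983, Thm. 0 and Thm. 3] [cite: Gordon1997, Thm. 6.3 (3) and Corollary] -/
theorem AbelianVariety.isDivisorGenerated_powSucc_of_ribetTypeFourteenSeventyFive (A : AbelianVariety ℂ) (φ : A ⟶ A)
    {d : ℕ} (hd : 0 < d) (hφ : φ ≫ φ = -(d • 𝟙 A)) (hE2 : Module.finrank ℚ A.endAlgebra = 2)
    (h14 : eigenMultiplicity A φ (Complex.I * (Real.sqrt d : ℂ)) = 14)
    (h75 : eigenMultiplicity A φ (-(Complex.I * (Real.sqrt d : ℂ))) = 75) (N : ℕ) :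
    IsDivisorGenerated (A.powSucc N) := by
  refine AbelianVariety.isDivisorGenerated_powSucc_of_ribetType_ofCoreSmul A φ hd hφ hE2 (by omega) (by omega) ?_ N
  intro W' _ _ _ 𝔊 ι P' Q' s hbr hirr hι hιι hP' hQ' hfinP' hfinQ' hadd hsmul hsymm hPQ hdefP hdefQ hadj
  exact UnitaryFourteenSeventyFive.eq_top_of_smul hbr hirr hι hιι hP' hQ' (by rw [hfinP', h14]) (by rw [hfinQ', h75]) hadd
    hsmul hsymm hPQ hdefP hdefQ hadj

/-- The mirror: `n_{i√d}(φ) = 75`, `n_{−i√d}(φ) = 14` (core `UnitaryFourteenSeventyFive.eq_top_of_smul'`).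
[cite: Ribet1983, Thm. 0 and Thm. 3] [cite: Gordon1997, Thm. 6.3 (3) and Corollary] -/
theorem AbelianVariety.isDivisorGenerated_powSucc_of_ribetTypeFourteenSeventyFive' (A : AbelianVariety ℂ) (φ : A ⟶ A)
    {d : ℕ} (hd : 0 < d) (hφ : φ ≫ φ = -(d • 𝟙 A)) (hE2 : Module.finrank ℚ A.endAlgebra = 2)
    (h75 : eigenMultiplicity A φ (Complex.I * (Real.sqrt d : ℂ)) = 75)
    (h14 : eigenMultiplicity A φ (-(Complex.I * (Real.sqrt d : ℂ))) = 14) (N : ℕ) :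
    IsDivisorGenerated (A.powSucc N) := by
  refine AbelianVariety.isDivisorGenerated_powSucc_of_ribetType_ofCoreSmul A φ hd hφ hE2 (by omega) (by omega) ?_ N
  intro W' _ _ _ 𝔊 ι P' Q' s hbr hirr hι hιι hP' hQ' hfinP' hfinQ' hadd hsmul hsymm hPQ hdefP hdefQ hadj
  exact UnitaryFourteenSeventyFive.eq_top_of_smul' hbr hirr hι hιι hP' hQ' (by rw [hfinP', h75]) (by rw [hfinQ', h14])
    hadd hsmul hsymm hPQ hdefP hdefQ hadj

/-- **The Hodge conjecture for all powers `A^{N+1}` of an abelian variety of Ribet type `(14, 75)` — UNCONDITIONAL.**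
[cite: Ribet1983, Thm. 3] [cite: Deligne2000, §1] -/
theorem hodgeConjectureFor_powSucc_of_ribetTypeFourteenSeventyFive (A : AbelianVariety ℂ) (φ : A ⟶ A)
    {d : ℕ} (hd : 0 < d) (hφ : φ ≫ φ = -(d • 𝟙 A)) (hE2 : Module.finrank ℚ A.endAlgebra = 2)
    (h14 : eigenMultiplicity A φ (Complex.I * (Real.sqrt d : ℂ)) = 14)
    (h75 : eigenMultiplicity A φ (-(Complex.I * (Real.sqrt d : ℂ))) = 75) (N : ℕ) :
    HodgeConjectureFor (A.powSucc N).dim (A.powSucc N).X :=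
  hodgeConjectureFor_of_isDivisorGenerated _
    (AbelianVariety.isDivisorGenerated_powSucc_of_ribetTypeFourteenSeventyFive A φ hd hφ hE2 h14 h75 N)

/-- **89-FOLDS of signature `{14, 75}`: `B• = D•` on all powers — UNCONDITIONAL** (either eigenvalue may carry the `14`).
[cite: Ribet1983, Thm. 0 and Thm. 3] [cite: MoonenZarhin1999LowDim, §2 (2.4)] -/
theorem AbelianVariety.isDivisorGenerated_powSucc_of_eightyninefold_fourteenSeventyFive (A : AbelianVariety ℂ)
    (φ : A ⟶ A) {d : ℕ} (hd : 0 < d) (hφ : φ ≫ φ = -(d • 𝟙 A)) (hE2 : Module.finrank ℚ A.endAlgebra = 2)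
    (hX : A.dim = 89)
    (h14 : eigenMultiplicity A φ (Complex.I * (Real.sqrt d : ℂ)) = 14 ∨
      eigenMultiplicity A φ (-(Complex.I * (Real.sqrt d : ℂ))) = 14)
    (N : ℕ) : IsDivisorGenerated (A.powSucc N) := by
  have hsum := eigenMultiplicity_add_eigenMultiplicity_neg_eq_dim A φ hd hφ
  rw [hX] at hsum
  rcases h14 with h | h
  · exact AbelianVariety.isDivisorGenerated_powSucc_of_ribetTypeFourteenSeventyFive A φ hd hφ hE2 h (by omega) N
  · exact AbelianVariety.isDivisorGenerated_powSucc_of_ribetTypeFourteenSeventyFive' A φ hd hφ hE2 (by omega) h N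

/-- **The Hodge conjecture for all powers of a 89-FOLD of signature `{14, 75}` — UNCONDITIONAL.**
[cite: Ribet1983, Thm. 3] [cite: Deligne2000, §1] -/
theorem hodgeConjectureFor_powSucc_of_eightyninefold_fourteenSeventyFive (A : AbelianVariety ℂ)
    (φ : A ⟶ A) {d : ℕ} (hd : 0 < d) (hφ : φ ≫ φ = -(d • 𝟙 A)) (hE2 : Module.finrank ℚ A.endAlgebra = 2)
    (hX : A.dim = 89)
    (h14 : eigenMultiplicity A φ (Complex.I * (Real.sqrt d : ℂ)) = 14 ∨
      eigenMultiplicity A φ (-(Complex.I * (Real.sqrt d : ℂ))) = 14)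
    (N : ℕ) : HodgeConjectureFor (A.powSucc N).dim (A.powSucc N).X :=
  hodgeConjectureFor_of_isDivisorGenerated _
    (AbelianVariety.isDivisorGenerated_powSucc_of_eightyninefold_fourteenSeventyFive A φ hd hφ hE2 hX h14 N)

/-- **Ribet 1983 Thm. 3 at `(n′, n″) = (15, 74)` — UNCONDITIONAL** (core `UnitaryFifteenSeventyFour.eq_top_of_smul`).
[cite: Ribet1983, Thm. 0 and Thm. 3] [cite: Gordon1997, Thm. 6.3 (3) and Corollary] -/
theorem AbelianVariety.isDivisorGenerated_powSucc_of_ribetTypeFifteenSeventyFour (A : AbelianVariety ℂ) (φ : A ⟶ A)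
    {d : ℕ} (hd : 0 < d) (hφ : φ ≫ φ = -(d • 𝟙 A)) (hE2 : Module.finrank ℚ A.endAlgebra = 2)
    (h15 : eigenMultiplicity A φ (Complex.I * (Real.sqrt d : ℂ)) = 15)
    (h74 : eigenMultiplicity A φ (-(Complex.I * (Real.sqrt d : ℂ))) = 74) (N : ℕ) :
    IsDivisorGenerated (A.powSucc N) := by
  refine AbelianVariety.isDivisorGenerated_powSucc_of_ribetType_ofCoreSmul A φ hd hφ hE2 (by omega) (by omega) ?_ N
  intro W' _ _ _ 𝔊 ι P' Q' s hbr hirr hι hιι hP' hQ' hfinP' hfinQ' hadd hsmul hsymm hPQ hdefP hdefQ hadj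
  exact UnitaryFifteenSeventyFour.eq_top_of_smul hbr hirr hι hιι hP' hQ' (by rw [hfinP', h15]) (by rw [hfinQ', h74]) hadd
    hsmul hsymm hPQ hdefP hdefQ hadj

/-- The mirror: `n_{i√d}(φ) = 74`, `n_{−i√d}(φ) = 15` (core `UnitaryFifteenSeventyFour.eq_top_of_smul'`).
[cite: Ribet1983, Thm. 0 and Thm. 3] [cite: Gordon1997, Thm. 6.3 (3) and Corollary] -/
theorem AbelianVariety.isDivisorGenerated_powSucc_of_ribetTypeFifteenSeventyFour' (A : AbelianVariety ℂ) (φ : A ⟶ A)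
    {d : ℕ} (hd : 0 < d) (hφ : φ ≫ φ = -(d • 𝟙 A)) (hE2 : Module.finrank ℚ A.endAlgebra = 2)
    (h74 : eigenMultiplicity A φ (Complex.I * (Real.sqrt d : ℂ)) = 74)
    (h15 : eigenMultiplicity A φ (-(Complex.I * (Real.sqrt d : ℂ))) = 15) (N : ℕ) :
    IsDivisorGenerated (A.powSucc N) := by
  refine AbelianVariety.isDivisorGenerated_powSucc_of_ribetType_ofCoreSmul A φ hd hφ hE2 (by omega) (by omega) ?_ N
  intro W' _ _ _ 𝔊 ι P' Q' s hbr hirr hι hιι hP' hQ' hfinP' hfinQ' hadd hsmul hsymm hPQ hdefP hdefQ hadj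
  exact UnitaryFifteenSeventyFour.eq_top_of_smul' hbr hirr hι hιι hP' hQ' (by rw [hfinP', h74]) (by rw [hfinQ', h15])
    hadd hsmul hsymm hPQ hdefP hdefQ hadj

/-- **The Hodge conjecture for all powers `A^{N+1}` of an abelian variety of Ribet type `(15, 74)` — UNCONDITIONAL.**
[cite: Ribet1983, Thm. 3] [cite: Deligne2000, §1] -/
theorem hodgeConjectureFor_powSucc_of_ribetTypeFifteenSeventyFour (A : AbelianVariety ℂ) (φ : A ⟶ A)
    {d : ℕ} (hd : 0 < d) (hφ : φ ≫ φ = -(d • 𝟙 A)) (hE2 : Module.finrank ℚ A.endAlgebra = 2)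
    (h15 : eigenMultiplicity A φ (Complex.I * (Real.sqrt d : ℂ)) = 15)
    (h74 : eigenMultiplicity A φ (-(Complex.I * (Real.sqrt d : ℂ))) = 74) (N : ℕ) :
    HodgeConjectureFor (A.powSucc N).dim (A.powSucc N).X :=
  hodgeConjectureFor_of_isDivisorGenerated _
    (AbelianVariety.isDivisorGenerated_powSucc_of_ribetTypeFifteenSeventyFour A φ hd hφ hE2 h15 h74 N)

/-- **89-FOLDS of signature `{15, 74}`: `B• = D•` on all powers — UNCONDITIONAL** (either eigenvalue may carry the `15`).
[cite: Ribet1983, Thm. 0 and Thm. 3] [cite: MoonenZarhin1999LowDim, §2 (2.4)] -/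
theorem AbelianVariety.isDivisorGenerated_powSucc_of_eightyninefold_fifteenSeventyFour (A : AbelianVariety ℂ)
    (φ : A ⟶ A) {d : ℕ} (hd : 0 < d) (hφ : φ ≫ φ = -(d • 𝟙 A)) (hE2 : Module.finrank ℚ A.endAlgebra = 2)
    (hX : A.dim = 89)
    (h15 : eigenMultiplicity A φ (Complex.I * (Real.sqrt d : ℂ)) = 15 ∨
      eigenMultiplicity A φ (-(Complex.I * (Real.sqrt d : ℂ))) = 15)
    (N : ℕ) : IsDivisorGenerated (A.powSucc N) := by
  have hsum := eigenMultiplicity_add_eigenMultiplicity_neg_eq_dim A φ hd hφ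
  rw [hX] at hsum
  rcases h15 with h | h
  · exact AbelianVariety.isDivisorGenerated_powSucc_of_ribetTypeFifteenSeventyFour A φ hd hφ hE2 h (by omega) N
  · exact AbelianVariety.isDivisorGenerated_powSucc_of_ribetTypeFifteenSeventyFour' A φ hd hφ hE2 (by omega) h N

/-- **The Hodge conjecture for all powers of a 89-FOLD of signature `{15, 74}` — UNCONDITIONAL.**
[cite: Ribet1983, Thm. 3] [cite: Deligne2000, §1] -/
theorem hodgeConjectureFor_powSucc_of_eightyninefold_fifteenSeventyFour (A : AbelianVariety ℂ)
    (φ : A ⟶ A) {d : ℕ} (hd : 0 < d) (hφ : φ ≫ φ = -(d • 𝟙 A)) (hE2 : Module.finrank ℚ A.endAlgebra = 2)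
    (hX : A.dim = 89)
    (h15 : eigenMultiplicity A φ (Complex.I * (Real.sqrt d : ℂ)) = 15 ∨
      eigenMultiplicity A φ (-(Complex.I * (Real.sqrt d : ℂ))) = 15)
    (N : ℕ) : HodgeConjectureFor (A.powSucc N).dim (A.powSucc N).X :=
  hodgeConjectureFor_of_isDivisorGenerated _
    (AbelianVariety.isDivisorGenerated_powSucc_of_eightyninefold_fifteenSeventyFour A φ hd hφ hE2 hX h15 N)

/-- **Ribet 1983 Thm. 3 at `(n′, n″) = (17, 72)` — UNCONDITIONAL** (core `UnitarySeventeenSeventyTwo.eq_top_of_smul`).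
[cite: Ribet1983, Thm. 0 and Thm. 3] [cite: Gordon1997, Thm. 6.3 (3) and Corollary] -/
theorem AbelianVariety.isDivisorGenerated_powSucc_of_ribetTypeSeventeenSeventyTwo (A : AbelianVariety ℂ) (φ : A ⟶ A)
    {d : ℕ} (hd : 0 < d) (hφ : φ ≫ φ = -(d • 𝟙 A)) (hE2 : Module.finrank ℚ A.endAlgebra = 2)
    (h17 : eigenMultiplicity A φ (Complex.I * (Real.sqrt d : ℂ)) = 17)
    (h72 : eigenMultiplicity A φ (-(Complex.I * (Real.sqrt d : ℂ))) = 72) (N : ℕ) :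
    IsDivisorGenerated (A.powSucc N) := by
  refine AbelianVariety.isDivisorGenerated_powSucc_of_ribetType_ofCoreSmul A φ hd hφ hE2 (by omega) (by omega) ?_ N
  intro W' _ _ _ 𝔊 ι P' Q' s hbr hirr hι hιι hP' hQ' hfinP' hfinQ' hadd hsmul hsymm hPQ hdefP hdefQ hadj
  exact UnitarySeventeenSeventyTwo.eq_top_of_smul hbr hirr hι hιι hP' hQ' (by rw [hfinP', h17]) (by rw [hfinQ', h72]) hadd
    hsmul hsymm hPQ hdefP hdefQ hadj

/-- The mirror: `n_{i√d}(φ) = 72`, `n_{−i√d}(φ) = 17` (core `UnitarySeventeenSeventyTwo.eq_top_of_smul'`).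
[cite: Ribet1983, Thm. 0 and Thm. 3] [cite: Gordon1997, Thm. 6.3 (3) and Corollary] -/
theorem AbelianVariety.isDivisorGenerated_powSucc_of_ribetTypeSeventeenSeventyTwo' (A : AbelianVariety ℂ) (φ : A ⟶ A)
    {d : ℕ} (hd : 0 < d) (hφ : φ ≫ φ = -(d • 𝟙 A)) (hE2 : Module.finrank ℚ A.endAlgebra = 2)
    (h72 : eigenMultiplicity A φ (Complex.I * (Real.sqrt d : ℂ)) = 72)
    (h17 : eigenMultiplicity A φ (-(Complex.I * (Real.sqrt d : ℂ))) = 17) (N : ℕ) :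
    IsDivisorGenerated (A.powSucc N) := by
  refine AbelianVariety.isDivisorGenerated_powSucc_of_ribetType_ofCoreSmul A φ hd hφ hE2 (by omega) (by omega) ?_ N
  intro W' _ _ _ 𝔊 ι P' Q' s hbr hirr hι hιι hP' hQ' hfinP' hfinQ' hadd hsmul hsymm hPQ hdefP hdefQ hadj
  exact UnitarySeventeenSeventyTwo.eq_top_of_smul' hbr hirr hι hιι hP' hQ' (by rw [hfinP', h72]) (by rw [hfinQ', h17])
    hadd hsmul hsymm hPQ hdefP hdefQ hadj

/-- **The Hodge conjecture for all powers `A^{N+1}` of an abelian variety of Ribet type `(17, 72)` — UNCONDITIONAL.**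
[cite: Ribet1983, Thm. 3] [cite: Deligne2000, §1] -/
theorem hodgeConjectureFor_powSucc_of_ribetTypeSeventeenSeventyTwo (A : AbelianVariety ℂ) (φ : A ⟶ A)
    {d : ℕ} (hd : 0 < d) (hφ : φ ≫ φ = -(d • 𝟙 A)) (hE2 : Module.finrank ℚ A.endAlgebra = 2)
    (h17 : eigenMultiplicity A φ (Complex.I * (Real.sqrt d : ℂ)) = 17)
    (h72 : eigenMultiplicity A φ (-(Complex.I * (Real.sqrt d : ℂ))) = 72) (N : ℕ) :
    HodgeConjectureFor (A.powSucc N).dim (A.powSucc N).X :=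
  hodgeConjectureFor_of_isDivisorGenerated _
    (AbelianVariety.isDivisorGenerated_powSucc_of_ribetTypeSeventeenSeventyTwo A φ hd hφ hE2 h17 h72 N)

/-- **89-FOLDS of signature `{17, 72}`: `B• = D•` on all powers — UNCONDITIONAL** (either eigenvalue may carry the `17`).
[cite: Ribet1983, Thm. 0 and Thm. 3] [cite: MoonenZarhin1999LowDim, §2 (2.4)] -/
theorem AbelianVariety.isDivisorGenerated_powSucc_of_eightyninefold_seventeenSeventyTwo (A : AbelianVariety ℂ)
    (φ : A ⟶ A) {d : ℕ} (hd : 0 < d) (hφ : φ ≫ φ = -(d • 𝟙 A)) (hE2 : Module.finrank ℚ A.endAlgebra = 2)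
    (hX : A.dim = 89)
    (h17 : eigenMultiplicity A φ (Complex.I * (Real.sqrt d : ℂ)) = 17 ∨
      eigenMultiplicity A φ (-(Complex.I * (Real.sqrt d : ℂ))) = 17)
    (N : ℕ) : IsDivisorGenerated (A.powSucc N) := by
  have hsum := eigenMultiplicity_add_eigenMultiplicity_neg_eq_dim A φ hd hφ
  rw [hX] at hsum
  rcases h17 with h | h
  · exact AbelianVariety.isDivisorGenerated_powSucc_of_ribetTypeSeventeenSeventyTwo A φ hd hφ hE2 h (by omega) N
  · exact AbelianVariety.isDivisorGenerated_powSucc_of_ribetTypeSeventeenSeventyTwo' A φ hd hφ hE2 (by omega) h N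

/-- **The Hodge conjecture for all powers of a 89-FOLD of signature `{17, 72}` — UNCONDITIONAL.**
[cite: Ribet1983, Thm. 3] [cite: Deligne2000, §1] -/
theorem hodgeConjectureFor_powSucc_of_eightyninefold_seventeenSeventyTwo (A : AbelianVariety ℂ)
    (φ : A ⟶ A) {d : ℕ} (hd : 0 < d) (hφ : φ ≫ φ = -(d • 𝟙 A)) (hE2 : Module.finrank ℚ A.endAlgebra = 2)
    (hX : A.dim = 89)
    (h17 : eigenMultiplicity A φ (Complex.I * (Real.sqrt d : ℂ)) = 17 ∨
      eigenMultiplicity A φ (-(Complex.I * (Real.sqrt d : ℂ))) = 17)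
    (N : ℕ) : HodgeConjectureFor (A.powSucc N).dim (A.powSucc N).X :=
  hodgeConjectureFor_of_isDivisorGenerated _
    (AbelianVariety.isDivisorGenerated_powSucc_of_eightyninefold_seventeenSeventyTwo A φ hd hφ hE2 hX h17 N)

/-- **Ribet 1983 Thm. 3 at `(n′, n″) = (19, 70)` — UNCONDITIONAL** (core `UnitaryNineteenSeventy.eq_top_of_smul`).
[cite: Ribet1983, Thm. 0 and Thm. 3] [cite: Gordon1997, Thm. 6.3 (3) and Corollary] -/
theorem AbelianVariety.isDivisorGenerated_powSucc_of_ribetTypeNineteenSeventy (A : AbelianVariety ℂ) (φ : A ⟶ A)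
    {d : ℕ} (hd : 0 < d) (hφ : φ ≫ φ = -(d • 𝟙 A)) (hE2 : Module.finrank ℚ A.endAlgebra = 2)
    (h19 : eigenMultiplicity A φ (Complex.I * (Real.sqrt d : ℂ)) = 19)
    (h70 : eigenMultiplicity A φ (-(Complex.I * (Real.sqrt d : ℂ))) = 70) (N : ℕ) :
    IsDivisorGenerated (A.powSucc N) := by
  refine AbelianVariety.isDivisorGenerated_powSucc_of_ribetType_ofCoreSmul A φ hd hφ hE2 (by omega) (by omega) ?_ N
  intro W' _ _ _ 𝔊 ι P' Q' s hbr hirr hι hιι hP' hQ' hfinP' hfinQ' hadd hsmul hsymm hPQ hdefP hdefQ hadj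
  exact UnitaryNineteenSeventy.eq_top_of_smul hbr hirr hι hιι hP' hQ' (by rw [hfinP', h19]) (by rw [hfinQ', h70]) hadd
    hsmul hsymm hPQ hdefP hdefQ hadj

/-- The mirror: `n_{i√d}(φ) = 70`, `n_{−i√d}(φ) = 19` (core `UnitaryNineteenSeventy.eq_top_of_smul'`).
[cite: Ribet1983, Thm. 0 and Thm. 3] [cite: Gordon1997, Thm. 6.3 (3) and Corollary] -/
theorem AbelianVariety.isDivisorGenerated_powSucc_of_ribetTypeNineteenSeventy' (A : AbelianVariety ℂ) (φ : A ⟶ A)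
    {d : ℕ} (hd : 0 < d) (hφ : φ ≫ φ = -(d • 𝟙 A)) (hE2 : Module.finrank ℚ A.endAlgebra = 2)
    (h70 : eigenMultiplicity A φ (Complex.I * (Real.sqrt d : ℂ)) = 70)
    (h19 : eigenMultiplicity A φ (-(Complex.I * (Real.sqrt d : ℂ))) = 19) (N : ℕ) :
    IsDivisorGenerated (A.powSucc N) := by
  refine AbelianVariety.isDivisorGenerated_powSucc_of_ribetType_ofCoreSmul A φ hd hφ hE2 (by omega) (by omega) ?_ N
  intro W' _ _ _ 𝔊 ι P' Q' s hbr hirr hι hιι hP' hQ' hfinP' hfinQ' hadd hsmul hsymm hPQ hdefP hdefQ hadj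
  exact UnitaryNineteenSeventy.eq_top_of_smul' hbr hirr hι hιι hP' hQ' (by rw [hfinP', h70]) (by rw [hfinQ', h19])
    hadd hsmul hsymm hPQ hdefP hdefQ hadj

/-- **The Hodge conjecture for all powers `A^{N+1}` of an abelian variety of Ribet type `(19, 70)` — UNCONDITIONAL.**
[cite: Ribet1983, Thm. 3] [cite: Deligne2000, §1] -/
theorem hodgeConjectureFor_powSucc_of_ribetTypeNineteenSeventy (A : AbelianVariety ℂ) (φ : A ⟶ A)
    {d : ℕ} (hd : 0 < d) (hφ : φ ≫ φ = -(d • 𝟙 A)) (hE2 : Module.finrank ℚ A.endAlgebra = 2)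
    (h19 : eigenMultiplicity A φ (Complex.I * (Real.sqrt d : ℂ)) = 19)
    (h70 : eigenMultiplicity A φ (-(Complex.I * (Real.sqrt d : ℂ))) = 70) (N : ℕ) :
    HodgeConjectureFor (A.powSucc N).dim (A.powSucc N).X :=
  hodgeConjectureFor_of_isDivisorGenerated _
    (AbelianVariety.isDivisorGenerated_powSucc_of_ribetTypeNineteenSeventy A φ hd hφ hE2 h19 h70 N)

/-- **89-FOLDS of signature `{19, 70}`: `B• = D•` on all powers — UNCONDITIONAL** (either eigenvalue may carry the `19`).
[cite: Ribet1983, Thm. 0 and Thm. 3] [cite: MoonenZarhin1999LowDim, §2 (2.4)] -/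
theorem AbelianVariety.isDivisorGenerated_powSucc_of_eightyninefold_nineteenSeventy (A : AbelianVariety ℂ)
    (φ : A ⟶ A) {d : ℕ} (hd : 0 < d) (hφ : φ ≫ φ = -(d • 𝟙 A)) (hE2 : Module.finrank ℚ A.endAlgebra = 2)
    (hX : A.dim = 89)
    (h19 : eigenMultiplicity A φ (Complex.I * (Real.sqrt d : ℂ)) = 19 ∨
      eigenMultiplicity A φ (-(Complex.I * (Real.sqrt d : ℂ))) = 19)
    (N : ℕ) : IsDivisorGenerated (A.powSucc N) := by
  have hsum := eigenMultiplicity_add_eigenMultiplicity_neg_eq_dim A φ hd hφ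
  rw [hX] at hsum
  rcases h19 with h | h
  · exact AbelianVariety.isDivisorGenerated_powSucc_of_ribetTypeNineteenSeventy A φ hd hφ hE2 h (by omega) N
  · exact AbelianVariety.isDivisorGenerated_powSucc_of_ribetTypeNineteenSeventy' A φ hd hφ hE2 (by omega) h N

/-- **The Hodge conjecture for all powers of a 89-FOLD of signature `{19, 70}` — UNCONDITIONAL.**
[cite: Ribet1983, Thm. 3] [cite: Deligne2000, §1] -/
theorem hodgeConjectureFor_powSucc_of_eightyninefold_nineteenSeventy (A : AbelianVariety ℂ)
    (φ : A ⟶ A) {d : ℕ} (hd : 0 < d) (hφ : φ ≫ φ = -(d • 𝟙 A)) (hE2 : Module.finrank ℚ A.endAlgebra = 2)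
    (hX : A.dim = 89)
    (h19 : eigenMultiplicity A φ (Complex.I * (Real.sqrt d : ℂ)) = 19 ∨
      eigenMultiplicity A φ (-(Complex.I * (Real.sqrt d : ℂ))) = 19)
    (N : ℕ) : HodgeConjectureFor (A.powSucc N).dim (A.powSucc N).X :=
  hodgeConjectureFor_of_isDivisorGenerated _
    (AbelianVariety.isDivisorGenerated_powSucc_of_eightyninefold_nineteenSeventy A φ hd hφ hE2 hX h19 N)

/-- **Ribet 1983 Thm. 3 at `(n′, n″) = (20, 69)` — UNCONDITIONAL** (core `UnitaryTwentySixtyNine.eq_top_of_smul`).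
[cite: Ribet1983, Thm. 0 and Thm. 3] [cite: Gordon1997, Thm. 6.3 (3) and Corollary] -/
theorem AbelianVariety.isDivisorGenerated_powSucc_of_ribetTypeTwentySixtyNine (A : AbelianVariety ℂ) (φ : A ⟶ A)
    {d : ℕ} (hd : 0 < d) (hφ : φ ≫ φ = -(d • 𝟙 A)) (hE2 : Module.finrank ℚ A.endAlgebra = 2)
    (h20 : eigenMultiplicity A φ (Complex.I * (Real.sqrt d : ℂ)) = 20)
    (h69 : eigenMultiplicity A φ (-(Complex.I * (Real.sqrt d : ℂ))) = 69) (N : ℕ) :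
    IsDivisorGenerated (A.powSucc N) := by
  refine AbelianVariety.isDivisorGenerated_powSucc_of_ribetType_ofCoreSmul A φ hd hφ hE2 (by omega) (by omega) ?_ N
  intro W' _ _ _ 𝔊 ι P' Q' s hbr hirr hι hιι hP' hQ' hfinP' hfinQ' hadd hsmul hsymm hPQ hdefP hdefQ hadj
  exact UnitaryTwentySixtyNine.eq_top_of_smul hbr hirr hι hιι hP' hQ' (by rw [hfinP', h20]) (by rw [hfinQ', h69]) hadd
    hsmul hsymm hPQ hdefP hdefQ hadj

/-- The mirror: `n_{i√d}(φ) = 69`, `n_{−i√d}(φ) = 20` (core `UnitaryTwentySixtyNine.eq_top_of_smul'`).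
[cite: Ribet1983, Thm. 0 and Thm. 3] [cite: Gordon1997, Thm. 6.3 (3) and Corollary] -/
theorem AbelianVariety.isDivisorGenerated_powSucc_of_ribetTypeTwentySixtyNine' (A : AbelianVariety ℂ) (φ : A ⟶ A)
    {d : ℕ} (hd : 0 < d) (hφ : φ ≫ φ = -(d • 𝟙 A)) (hE2 : Module.finrank ℚ A.endAlgebra = 2)
    (h69 : eigenMultiplicity A φ (Complex.I * (Real.sqrt d : ℂ)) = 69)
    (h20 : eigenMultiplicity A φ (-(Complex.I * (Real.sqrt d : ℂ))) = 20) (N : ℕ) :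
    IsDivisorGenerated (A.powSucc N) := by
  refine AbelianVariety.isDivisorGenerated_powSucc_of_ribetType_ofCoreSmul A φ hd hφ hE2 (by omega) (by omega) ?_ N
  intro W' _ _ _ 𝔊 ι P' Q' s hbr hirr hι hιι hP' hQ' hfinP' hfinQ' hadd hsmul hsymm hPQ hdefP hdefQ hadj
  exact UnitaryTwentySixtyNine.eq_top_of_smul' hbr hirr hι hιι hP' hQ' (by rw [hfinP', h69]) (by rw [hfinQ', h20])
    hadd hsmul hsymm hPQ hdefP hdefQ hadj

/-- **The Hodge conjecture for all powers `A^{N+1}` of an abelian variety of Ribet type `(20, 69)` — UNCONDITIONAL.**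
[cite: Ribet1983, Thm. 3] [cite: Deligne2000, §1] -/
theorem hodgeConjectureFor_powSucc_of_ribetTypeTwentySixtyNine (A : AbelianVariety ℂ) (φ : A ⟶ A)
    {d : ℕ} (hd : 0 < d) (hφ : φ ≫ φ = -(d • 𝟙 A)) (hE2 : Module.finrank ℚ A.endAlgebra = 2)
    (h20 : eigenMultiplicity A φ (Complex.I * (Real.sqrt d : ℂ)) = 20)
    (h69 : eigenMultiplicity A φ (-(Complex.I * (Real.sqrt d : ℂ))) = 69) (N : ℕ) :
    HodgeConjectureFor (A.powSucc N).dim (A.powSucc N).X :=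
  hodgeConjectureFor_of_isDivisorGenerated _
    (AbelianVariety.isDivisorGenerated_powSucc_of_ribetTypeTwentySixtyNine A φ hd hφ hE2 h20 h69 N)

/-- **89-FOLDS of signature `{20, 69}`: `B• = D•` on all powers — UNCONDITIONAL** (either eigenvalue may carry the `20`).
[cite: Ribet1983, Thm. 0 and Thm. 3] [cite: MoonenZarhin1999LowDim, §2 (2.4)] -/
theorem AbelianVariety.isDivisorGenerated_powSucc_of_eightyninefold_twentySixtyNine (A : AbelianVariety ℂ)
    (φ : A ⟶ A) {d : ℕ} (hd : 0 < d) (hφ : φ ≫ φ = -(d • 𝟙 A)) (hE2 : Module.finrank ℚ A.endAlgebra = 2)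
    (hX : A.dim = 89)
    (h20 : eigenMultiplicity A φ (Complex.I * (Real.sqrt d : ℂ)) = 20 ∨
      eigenMultiplicity A φ (-(Complex.I * (Real.sqrt d : ℂ))) = 20)
    (N : ℕ) : IsDivisorGenerated (A.powSucc N) := by
  have hsum := eigenMultiplicity_add_eigenMultiplicity_neg_eq_dim A φ hd hφ
  rw [hX] at hsum
  rcases h20 with h | h
  · exact AbelianVariety.isDivisorGenerated_powSucc_of_ribetTypeTwentySixtyNine A φ hd hφ hE2 h (by omega) N
  · exact AbelianVariety.isDivisorGenerated_powSucc_of_ribetTypeTwentySixtyNine' A φ hd hφ hE2 (by omega) h N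

/-- **The Hodge conjecture for all powers of a 89-FOLD of signature `{20, 69}` — UNCONDITIONAL.**
[cite: Ribet1983, Thm. 3] [cite: Deligne2000, §1] -/
theorem hodgeConjectureFor_powSucc_of_eightyninefold_twentySixtyNine (A : AbelianVariety ℂ)
    (φ : A ⟶ A) {d : ℕ} (hd : 0 < d) (hφ : φ ≫ φ = -(d • 𝟙 A)) (hE2 : Module.finrank ℚ A.endAlgebra = 2)
    (hX : A.dim = 89)
    (h20 : eigenMultiplicity A φ (Complex.I * (Real.sqrt d : ℂ)) = 20 ∨
      eigenMultiplicity A φ (-(Complex.I * (Real.sqrt d : ℂ))) = 20)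
    (N : ℕ) : HodgeConjectureFor (A.powSucc N).dim (A.powSucc N).X :=
  hodgeConjectureFor_of_isDivisorGenerated _
    (AbelianVariety.isDivisorGenerated_powSucc_of_eightyninefold_twentySixtyNine A φ hd hφ hE2 hX h20 N)

/-- **Ribet 1983 Thm. 3 at `(n′, n″) = (21, 68)` — UNCONDITIONAL** (core `UnitaryTwentyOneSixtyEight.eq_top_of_smul`).
[cite: Ribet1983, Thm. 0 and Thm. 3] [cite: Gordon1997, Thm. 6.3 (3) and Corollary] -/
theorem AbelianVariety.isDivisorGenerated_powSucc_of_ribetTypeTwentyOneSixtyEight (A : AbelianVariety ℂ) (φ : A ⟶ A)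
    {d : ℕ} (hd : 0 < d) (hφ : φ ≫ φ = -(d • 𝟙 A)) (hE2 : Module.finrank ℚ A.endAlgebra = 2)
    (h21 : eigenMultiplicity A φ (Complex.I * (Real.sqrt d : ℂ)) = 21)
    (h68 : eigenMultiplicity A φ (-(Complex.I * (Real.sqrt d : ℂ))) = 68) (N : ℕ) :
    IsDivisorGenerated (A.powSucc N) := by
  refine AbelianVariety.isDivisorGenerated_powSucc_of_ribetType_ofCoreSmul A φ hd hφ hE2 (by omega) (by omega) ?_ N
  intro W' _ _ _ 𝔊 ι P' Q' s hbr hirr hι hιι hP' hQ' hfinP' hfinQ' hadd hsmul hsymm hPQ hdefP hdefQ hadj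
  exact UnitaryTwentyOneSixtyEight.eq_top_of_smul hbr hirr hι hιι hP' hQ' (by rw [hfinP', h21]) (by rw [hfinQ', h68]) hadd
    hsmul hsymm hPQ hdefP hdefQ hadj

/-- The mirror: `n_{i√d}(φ) = 68`, `n_{−i√d}(φ) = 21` (core `UnitaryTwentyOneSixtyEight.eq_top_of_smul'`).
[cite: Ribet1983, Thm. 0 and Thm. 3] [cite: Gordon1997, Thm. 6.3 (3) and Corollary] -/
theorem AbelianVariety.isDivisorGenerated_powSucc_of_ribetTypeTwentyOneSixtyEight' (A : AbelianVariety ℂ) (φ : A ⟶ A)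
    {d : ℕ} (hd : 0 < d) (hφ : φ ≫ φ = -(d • 𝟙 A)) (hE2 : Module.finrank ℚ A.endAlgebra = 2)
    (h68 : eigenMultiplicity A φ (Complex.I * (Real.sqrt d : ℂ)) = 68)
    (h21 : eigenMultiplicity A φ (-(Complex.I * (Real.sqrt d : ℂ))) = 21) (N : ℕ) :
    IsDivisorGenerated (A.powSucc N) := by
  refine AbelianVariety.isDivisorGenerated_powSucc_of_ribetType_ofCoreSmul A φ hd hφ hE2 (by omega) (by omega) ?_ N
  intro W' _ _ _ 𝔊 ι P' Q' s hbr hirr hι hιι hP' hQ' hfinP' hfinQ' hadd hsmul hsymm hPQ hdefP hdefQ hadj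
  exact UnitaryTwentyOneSixtyEight.eq_top_of_smul' hbr hirr hι hιι hP' hQ' (by rw [hfinP', h68]) (by rw [hfinQ', h21])
    hadd hsmul hsymm hPQ hdefP hdefQ hadj

/-- **The Hodge conjecture for all powers `A^{N+1}` of an abelian variety of Ribet type `(21, 68)` — UNCONDITIONAL.**
[cite: Ribet1983, Thm. 3] [cite: Deligne2000, §1] -/
theorem hodgeConjectureFor_powSucc_of_ribetTypeTwentyOneSixtyEight (A : AbelianVariety ℂ) (φ : A ⟶ A)
    {d : ℕ} (hd : 0 < d) (hφ : φ ≫ φ = -(d • 𝟙 A)) (hE2 : Module.finrank ℚ A.endAlgebra = 2)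
    (h21 : eigenMultiplicity A φ (Complex.I * (Real.sqrt d : ℂ)) = 21)
    (h68 : eigenMultiplicity A φ (-(Complex.I * (Real.sqrt d : ℂ))) = 68) (N : ℕ) :
    HodgeConjectureFor (A.powSucc N).dim (A.powSucc N).X :=
  hodgeConjectureFor_of_isDivisorGenerated _
    (AbelianVariety.isDivisorGenerated_powSucc_of_ribetTypeTwentyOneSixtyEight A φ hd hφ hE2 h21 h68 N)

/-- **89-FOLDS of signature `{21, 68}`: `B• = D•` on all powers — UNCONDITIONAL** (either eigenvalue may carry the `21`).
[cite: Ribet1983, Thm. 0 and Thm. 3] [cite: MoonenZarhin1999LowDim, §2 (2.4)] -/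
theorem AbelianVariety.isDivisorGenerated_powSucc_of_eightyninefold_twentyOneSixtyEight (A : AbelianVariety ℂ)
    (φ : A ⟶ A) {d : ℕ} (hd : 0 < d) (hφ : φ ≫ φ = -(d • 𝟙 A)) (hE2 : Module.finrank ℚ A.endAlgebra = 2)
    (hX : A.dim = 89)
    (h21 : eigenMultiplicity A φ (Complex.I * (Real.sqrt d : ℂ)) = 21 ∨
      eigenMultiplicity A φ (-(Complex.I * (Real.sqrt d : ℂ))) = 21)
    (N : ℕ) : IsDivisorGenerated (A.powSucc N) := by
  have hsum := eigenMultiplicity_add_eigenMultiplicity_neg_eq_dim A φ hd hφ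
  rw [hX] at hsum
  rcases h21 with h | h
  · exact AbelianVariety.isDivisorGenerated_powSucc_of_ribetTypeTwentyOneSixtyEight A φ hd hφ hE2 h (by omega) N
  · exact AbelianVariety.isDivisorGenerated_powSucc_of_ribetTypeTwentyOneSixtyEight' A φ hd hφ hE2 (by omega) h N

/-- **The Hodge conjecture for all powers of a 89-FOLD of signature `{21, 68}` — UNCONDITIONAL.**
[cite: Ribet1983, Thm. 3] [cite: Deligne2000, §1] -/
theorem hodgeConjectureFor_powSucc_of_eightyninefold_twentyOneSixtyEight (A : AbelianVariety ℂ)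
    (φ : A ⟶ A) {d : ℕ} (hd : 0 < d) (hφ : φ ≫ φ = -(d • 𝟙 A)) (hE2 : Module.finrank ℚ A.endAlgebra = 2)
    (hX : A.dim = 89)
    (h21 : eigenMultiplicity A φ (Complex.I * (Real.sqrt d : ℂ)) = 21 ∨
      eigenMultiplicity A φ (-(Complex.I * (Real.sqrt d : ℂ))) = 21)
    (N : ℕ) : HodgeConjectureFor (A.powSucc N).dim (A.powSucc N).X :=
  hodgeConjectureFor_of_isDivisorGenerated _
    (AbelianVariety.isDivisorGenerated_powSucc_of_eightyninefold_twentyOneSixtyEight A φ hd hφ hE2 hX h21 N)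

/-- **Ribet 1983 Thm. 3 at `(n′, n″) = (23, 66)` — UNCONDITIONAL** (core `UnitaryTwentyThreeSixtySix.eq_top_of_smul`).
[cite: Ribet1983, Thm. 0 and Thm. 3] [cite: Gordon1997, Thm. 6.3 (3) and Corollary] -/
theorem AbelianVariety.isDivisorGenerated_powSucc_of_ribetTypeTwentyThreeSixtySix (A : AbelianVariety ℂ) (φ : A ⟶ A)
    {d : ℕ} (hd : 0 < d) (hφ : φ ≫ φ = -(d • 𝟙 A)) (hE2 : Module.finrank ℚ A.endAlgebra = 2)
    (h23 : eigenMultiplicity A φ (Complex.I * (Real.sqrt d : ℂ)) = 23)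
    (h66 : eigenMultiplicity A φ (-(Complex.I * (Real.sqrt d : ℂ))) = 66) (N : ℕ) :
    IsDivisorGenerated (A.powSucc N) := by
  refine AbelianVariety.isDivisorGenerated_powSucc_of_ribetType_ofCoreSmul A φ hd hφ hE2 (by omega) (by omega) ?_ N
  intro W' _ _ _ 𝔊 ι P' Q' s hbr hirr hι hιι hP' hQ' hfinP' hfinQ' hadd hsmul hsymm hPQ hdefP hdefQ hadj
  exact UnitaryTwentyThreeSixtySix.eq_top_of_smul hbr hirr hι hιι hP' hQ' (by rw [hfinP', h23]) (by rw [hfinQ', h66]) hadd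
    hsmul hsymm hPQ hdefP hdefQ hadj

/-- The mirror: `n_{i√d}(φ) = 66`, `n_{−i√d}(φ) = 23` (core `UnitaryTwentyThreeSixtySix.eq_top_of_smul'`).
[cite: Ribet1983, Thm. 0 and Thm. 3] [cite: Gordon1997, Thm. 6.3 (3) and Corollary] -/
theorem AbelianVariety.isDivisorGenerated_powSucc_of_ribetTypeTwentyThreeSixtySix' (A : AbelianVariety ℂ) (φ : A ⟶ A)
    {d : ℕ} (hd : 0 < d) (hφ : φ ≫ φ = -(d • 𝟙 A)) (hE2 : Module.finrank ℚ A.endAlgebra = 2)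
    (h66 : eigenMultiplicity A φ (Complex.I * (Real.sqrt d : ℂ)) = 66)
    (h23 : eigenMultiplicity A φ (-(Complex.I * (Real.sqrt d : ℂ))) = 23) (N : ℕ) :
    IsDivisorGenerated (A.powSucc N) := by
  refine AbelianVariety.isDivisorGenerated_powSucc_of_ribetType_ofCoreSmul A φ hd hφ hE2 (by omega) (by omega) ?_ N
  intro W' _ _ _ 𝔊 ι P' Q' s hbr hirr hι hιι hP' hQ' hfinP' hfinQ' hadd hsmul hsymm hPQ hdefP hdefQ hadj
  exact UnitaryTwentyThreeSixtySix.eq_top_of_smul' hbr hirr hι hιι hP' hQ' (by rw [hfinP', h66]) (by rw [hfinQ', h23])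
    hadd hsmul hsymm hPQ hdefP hdefQ hadj

/-- **The Hodge conjecture for all powers `A^{N+1}` of an abelian variety of Ribet type `(23, 66)` — UNCONDITIONAL.**
[cite: Ribet1983, Thm. 3] [cite: Deligne2000, §1] -/
theorem hodgeConjectureFor_powSucc_of_ribetTypeTwentyThreeSixtySix (A : AbelianVariety ℂ) (φ : A ⟶ A)
    {d : ℕ} (hd : 0 < d) (hφ : φ ≫ φ = -(d • 𝟙 A)) (hE2 : Module.finrank ℚ A.endAlgebra = 2)
    (h23 : eigenMultiplicity A φ (Complex.I * (Real.sqrt d : ℂ)) = 23)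
    (h66 : eigenMultiplicity A φ (-(Complex.I * (Real.sqrt d : ℂ))) = 66) (N : ℕ) :
    HodgeConjectureFor (A.powSucc N).dim (A.powSucc N).X :=
  hodgeConjectureFor_of_isDivisorGenerated _
    (AbelianVariety.isDivisorGenerated_powSucc_of_ribetTypeTwentyThreeSixtySix A φ hd hφ hE2 h23 h66 N)

/-- **89-FOLDS of signature `{23, 66}`: `B• = D•` on all powers — UNCONDITIONAL** (either eigenvalue may carry the `23`).
[cite: Ribet1983, Thm. 0 and Thm. 3] [cite: MoonenZarhin1999LowDim, §2 (2.4)] -/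
theorem AbelianVariety.isDivisorGenerated_powSucc_of_eightyninefold_twentyThreeSixtySix (A : AbelianVariety ℂ)
    (φ : A ⟶ A) {d : ℕ} (hd : 0 < d) (hφ : φ ≫ φ = -(d • 𝟙 A)) (hE2 : Module.finrank ℚ A.endAlgebra = 2)
    (hX : A.dim = 89)
    (h23 : eigenMultiplicity A φ (Complex.I * (Real.sqrt d : ℂ)) = 23 ∨
      eigenMultiplicity A φ (-(Complex.I * (Real.sqrt d : ℂ))) = 23)
    (N : ℕ) : IsDivisorGenerated (A.powSucc N) := by
  have hsum := eigenMultiplicity_add_eigenMultiplicity_neg_eq_dim A φ hd hφ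
  rw [hX] at hsum
  rcases h23 with h | h
  · exact AbelianVariety.isDivisorGenerated_powSucc_of_ribetTypeTwentyThreeSixtySix A φ hd hφ hE2 h (by omega) N
  · exact AbelianVariety.isDivisorGenerated_powSucc_of_ribetTypeTwentyThreeSixtySix' A φ hd hφ hE2 (by omega) h N

/-- **The Hodge conjecture for all powers of a 89-FOLD of signature `{23, 66}` — UNCONDITIONAL.**
[cite: Ribet1983, Thm. 3] [cite: Deligne2000, §1] -/
theorem hodgeConjectureFor_powSucc_of_eightyninefold_twentyThreeSixtySix (A : AbelianVariety ℂ)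
    (φ : A ⟶ A) {d : ℕ} (hd : 0 < d) (hφ : φ ≫ φ = -(d • 𝟙 A)) (hE2 : Module.finrank ℚ A.endAlgebra = 2)
    (hX : A.dim = 89)
    (h23 : eigenMultiplicity A φ (Complex.I * (Real.sqrt d : ℂ)) = 23 ∨
      eigenMultiplicity A φ (-(Complex.I * (Real.sqrt d : ℂ))) = 23)
    (N : ℕ) : HodgeConjectureFor (A.powSucc N).dim (A.powSucc N).X :=
  hodgeConjectureFor_of_isDivisorGenerated _
    (AbelianVariety.isDivisorGenerated_powSucc_of_eightyninefold_twentyThreeSixtySix A φ hd hφ hE2 hX h23 N)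

/-- **Ribet 1983 Thm. 3 at `(n′, n″) = (24, 65)` — UNCONDITIONAL** (core `UnitaryTwentyFourSixtyFive.eq_top_of_smul`).
[cite: Ribet1983, Thm. 0 and Thm. 3] [cite: Gordon1997, Thm. 6.3 (3) and Corollary] -/
theorem AbelianVariety.isDivisorGenerated_powSucc_of_ribetTypeTwentyFourSixtyFive (A : AbelianVariety ℂ) (φ : A ⟶ A)
    {d : ℕ} (hd : 0 < d) (hφ : φ ≫ φ = -(d • 𝟙 A)) (hE2 : Module.finrank ℚ A.endAlgebra = 2)
    (h24 : eigenMultiplicity A φ (Complex.I * (Real.sqrt d : ℂ)) = 24)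
    (h65 : eigenMultiplicity A φ (-(Complex.I * (Real.sqrt d : ℂ))) = 65) (N : ℕ) :
    IsDivisorGenerated (A.powSucc N) := by
  refine AbelianVariety.isDivisorGenerated_powSucc_of_ribetType_ofCoreSmul A φ hd hφ hE2 (by omega) (by omega) ?_ N
  intro W' _ _ _ 𝔊 ι P' Q' s hbr hirr hι hιι hP' hQ' hfinP' hfinQ' hadd hsmul hsymm hPQ hdefP hdefQ hadj
  exact UnitaryTwentyFourSixtyFive.eq_top_of_smul hbr hirr hι hιι hP' hQ' (by rw [hfinP', h24]) (by rw [hfinQ', h65]) hadd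
    hsmul hsymm hPQ hdefP hdefQ hadj

/-- The mirror: `n_{i√d}(φ) = 65`, `n_{−i√d}(φ) = 24` (core `UnitaryTwentyFourSixtyFive.eq_top_of_smul'`).
[cite: Ribet1983, Thm. 0 and Thm. 3] [cite: Gordon1997, Thm. 6.3 (3) and Corollary] -/
theorem AbelianVariety.isDivisorGenerated_powSucc_of_ribetTypeTwentyFourSixtyFive' (A : AbelianVariety ℂ) (φ : A ⟶ A)
    {d : ℕ} (hd : 0 < d) (hφ : φ ≫ φ = -(d • 𝟙 A)) (hE2 : Module.finrank ℚ A.endAlgebra = 2)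
    (h65 : eigenMultiplicity A φ (Complex.I * (Real.sqrt d : ℂ)) = 65)
    (h24 : eigenMultiplicity A φ (-(Complex.I * (Real.sqrt d : ℂ))) = 24) (N : ℕ) :
    IsDivisorGenerated (A.powSucc N) := by
  refine AbelianVariety.isDivisorGenerated_powSucc_of_ribetType_ofCoreSmul A φ hd hφ hE2 (by omega) (by omega) ?_ N
  intro W' _ _ _ 𝔊 ι P' Q' s hbr hirr hι hιι hP' hQ' hfinP' hfinQ' hadd hsmul hsymm hPQ hdefP hdefQ hadj
  exact UnitaryTwentyFourSixtyFive.eq_top_of_smul' hbr hirr hι hιι hP' hQ' (by rw [hfinP', h65]) (by rw [hfinQ', h24])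
    hadd hsmul hsymm hPQ hdefP hdefQ hadj

/-- **The Hodge conjecture for all powers `A^{N+1}` of an abelian variety of Ribet type `(24, 65)` — UNCONDITIONAL.**
[cite: Ribet1983, Thm. 3] [cite: Deligne2000, §1] -/
theorem hodgeConjectureFor_powSucc_of_ribetTypeTwentyFourSixtyFive (A : AbelianVariety ℂ) (φ : A ⟶ A)
    {d : ℕ} (hd : 0 < d) (hφ : φ ≫ φ = -(d • 𝟙 A)) (hE2 : Module.finrank ℚ A.endAlgebra = 2)
    (h24 : eigenMultiplicity A φ (Complex.I * (Real.sqrt d : ℂ)) = 24)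
    (h65 : eigenMultiplicity A φ (-(Complex.I * (Real.sqrt d : ℂ))) = 65) (N : ℕ) :
    HodgeConjectureFor (A.powSucc N).dim (A.powSucc N).X :=
  hodgeConjectureFor_of_isDivisorGenerated _
    (AbelianVariety.isDivisorGenerated_powSucc_of_ribetTypeTwentyFourSixtyFive A φ hd hφ hE2 h24 h65 N)

/-- **89-FOLDS of signature `{24, 65}`: `B• = D•` on all powers — UNCONDITIONAL** (either eigenvalue may carry the `24`).
[cite: Ribet1983, Thm. 0 and Thm. 3] [cite: MoonenZarhin1999LowDim, §2 (2.4)] -/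
theorem AbelianVariety.isDivisorGenerated_powSucc_of_eightyninefold_twentyFourSixtyFive (A : AbelianVariety ℂ)
    (φ : A ⟶ A) {d : ℕ} (hd : 0 < d) (hφ : φ ≫ φ = -(d • 𝟙 A)) (hE2 : Module.finrank ℚ A.endAlgebra = 2)
    (hX : A.dim = 89)
    (h24 : eigenMultiplicity A φ (Complex.I * (Real.sqrt d : ℂ)) = 24 ∨
      eigenMultiplicity A φ (-(Complex.I * (Real.sqrt d : ℂ))) = 24)
    (N : ℕ) : IsDivisorGenerated (A.powSucc N) := by
  have hsum := eigenMultiplicity_add_eigenMultiplicity_neg_eq_dim A φ hd hφ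
  rw [hX] at hsum
  rcases h24 with h | h
  · exact AbelianVariety.isDivisorGenerated_powSucc_of_ribetTypeTwentyFourSixtyFive A φ hd hφ hE2 h (by omega) N
  · exact AbelianVariety.isDivisorGenerated_powSucc_of_ribetTypeTwentyFourSixtyFive' A φ hd hφ hE2 (by omega) h N

/-- **The Hodge conjecture for all powers of a 89-FOLD of signature `{24, 65}` — UNCONDITIONAL.**
[cite: Ribet1983, Thm. 3] [cite: Deligne2000, §1] -/
theorem hodgeConjectureFor_powSucc_of_eightyninefold_twentyFourSixtyFive (A : AbelianVariety ℂ)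
    (φ : A ⟶ A) {d : ℕ} (hd : 0 < d) (hφ : φ ≫ φ = -(d • 𝟙 A)) (hE2 : Module.finrank ℚ A.endAlgebra = 2)
    (hX : A.dim = 89)
    (h24 : eigenMultiplicity A φ (Complex.I * (Real.sqrt d : ℂ)) = 24 ∨
      eigenMultiplicity A φ (-(Complex.I * (Real.sqrt d : ℂ))) = 24)
    (N : ℕ) : HodgeConjectureFor (A.powSucc N).dim (A.powSucc N).X :=
  hodgeConjectureFor_of_isDivisorGenerated _
    (AbelianVariety.isDivisorGenerated_powSucc_of_eightyninefold_twentyFourSixtyFive A φ hd hφ hE2 hX h24 N)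

/-- **Ribet 1983 Thm. 3 at `(n′, n″) = (25, 64)` — UNCONDITIONAL** (core `UnitaryTwentyFiveSixtyFour.eq_top_of_smul`).
[cite: Ribet1983, Thm. 0 and Thm. 3] [cite: Gordon1997, Thm. 6.3 (3) and Corollary] -/
theorem AbelianVariety.isDivisorGenerated_powSucc_of_ribetTypeTwentyFiveSixtyFour (A : AbelianVariety ℂ) (φ : A ⟶ A)
    {d : ℕ} (hd : 0 < d) (hφ : φ ≫ φ = -(d • 𝟙 A)) (hE2 : Module.finrank ℚ A.endAlgebra = 2)
    (h25 : eigenMultiplicity A φ (Complex.I * (Real.sqrt d : ℂ)) = 25)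
    (h64 : eigenMultiplicity A φ (-(Complex.I * (Real.sqrt d : ℂ))) = 64) (N : ℕ) :
    IsDivisorGenerated (A.powSucc N) := by
  refine AbelianVariety.isDivisorGenerated_powSucc_of_ribetType_ofCoreSmul A φ hd hφ hE2 (by omega) (by omega) ?_ N
  intro W' _ _ _ 𝔊 ι P' Q' s hbr hirr hι hιι hP' hQ' hfinP' hfinQ' hadd hsmul hsymm hPQ hdefP hdefQ hadj
  exact UnitaryTwentyFiveSixtyFour.eq_top_of_smul hbr hirr hι hιι hP' hQ' (by rw [hfinP', h25]) (by rw [hfinQ', h64]) hadd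
    hsmul hsymm hPQ hdefP hdefQ hadj

/-- The mirror: `n_{i√d}(φ) = 64`, `n_{−i√d}(φ) = 25` (core `UnitaryTwentyFiveSixtyFour.eq_top_of_smul'`).
[cite: Ribet1983, Thm. 0 and Thm. 3] [cite: Gordon1997, Thm. 6.3 (3) and Corollary] -/
theorem AbelianVariety.isDivisorGenerated_powSucc_of_ribetTypeTwentyFiveSixtyFour' (A : AbelianVariety ℂ) (φ : A ⟶ A)
    {d : ℕ} (hd : 0 < d) (hφ : φ ≫ φ = -(d • 𝟙 A)) (hE2 : Module.finrank ℚ A.endAlgebra = 2)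
    (h64 : eigenMultiplicity A φ (Complex.I * (Real.sqrt d : ℂ)) = 64)
    (h25 : eigenMultiplicity A φ (-(Complex.I * (Real.sqrt d : ℂ))) = 25) (N : ℕ) :
    IsDivisorGenerated (A.powSucc N) := by
  refine AbelianVariety.isDivisorGenerated_powSucc_of_ribetType_ofCoreSmul A φ hd hφ hE2 (by omega) (by omega) ?_ N
  intro W' _ _ _ 𝔊 ι P' Q' s hbr hirr hι hιι hP' hQ' hfinP' hfinQ' hadd hsmul hsymm hPQ hdefP hdefQ hadj
  exact UnitaryTwentyFiveSixtyFour.eq_top_of_smul' hbr hirr hι hιι hP' hQ' (by rw [hfinP', h64]) (by rw [hfinQ', h25])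
    hadd hsmul hsymm hPQ hdefP hdefQ hadj

/-- **The Hodge conjecture for all powers `A^{N+1}` of an abelian variety of Ribet type `(25, 64)` — UNCONDITIONAL.**
[cite: Ribet1983, Thm. 3] [cite: Deligne2000, §1] -/
theorem hodgeConjectureFor_powSucc_of_ribetTypeTwentyFiveSixtyFour (A : AbelianVariety ℂ) (φ : A ⟶ A)
    {d : ℕ} (hd : 0 < d) (hφ : φ ≫ φ = -(d • 𝟙 A)) (hE2 : Module.finrank ℚ A.endAlgebra = 2)
    (h25 : eigenMultiplicity A φ (Complex.I * (Real.sqrt d : ℂ)) = 25)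
    (h64 : eigenMultiplicity A φ (-(Complex.I * (Real.sqrt d : ℂ))) = 64) (N : ℕ) :
    HodgeConjectureFor (A.powSucc N).dim (A.powSucc N).X :=
  hodgeConjectureFor_of_isDivisorGenerated _
    (AbelianVariety.isDivisorGenerated_powSucc_of_ribetTypeTwentyFiveSixtyFour A φ hd hφ hE2 h25 h64 N)

/-- **89-FOLDS of signature `{25, 64}`: `B• = D•` on all powers — UNCONDITIONAL** (either eigenvalue may carry the `25`).
[cite: Ribet1983, Thm. 0 and Thm. 3] [cite: MoonenZarhin1999LowDim, §2 (2.4)] -/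
theorem AbelianVariety.isDivisorGenerated_powSucc_of_eightyninefold_twentyFiveSixtyFour (A : AbelianVariety ℂ)
    (φ : A ⟶ A) {d : ℕ} (hd : 0 < d) (hφ : φ ≫ φ = -(d • 𝟙 A)) (hE2 : Module.finrank ℚ A.endAlgebra = 2)
    (hX : A.dim = 89)
    (h25 : eigenMultiplicity A φ (Complex.I * (Real.sqrt d : ℂ)) = 25 ∨
      eigenMultiplicity A φ (-(Complex.I * (Real.sqrt d : ℂ))) = 25)
    (N : ℕ) : IsDivisorGenerated (A.powSucc N) := by
  have hsum := eigenMultiplicity_add_eigenMultiplicity_neg_eq_dim A φ hd hφ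
  rw [hX] at hsum
  rcases h25 with h | h
  · exact AbelianVariety.isDivisorGenerated_powSucc_of_ribetTypeTwentyFiveSixtyFour A φ hd hφ hE2 h (by omega) N
  · exact AbelianVariety.isDivisorGenerated_powSucc_of_ribetTypeTwentyFiveSixtyFour' A φ hd hφ hE2 (by omega) h N

/-- **The Hodge conjecture for all powers of a 89-FOLD of signature `{25, 64}` — UNCONDITIONAL.**
[cite: Ribet1983, Thm. 3] [cite: Deligne2000, §1] -/
theorem hodgeConjectureFor_powSucc_of_eightyninefold_twentyFiveSixtyFour (A : AbelianVariety ℂ)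
    (φ : A ⟶ A) {d : ℕ} (hd : 0 < d) (hφ : φ ≫ φ = -(d • 𝟙 A)) (hE2 : Module.finrank ℚ A.endAlgebra = 2)
    (hX : A.dim = 89)
    (h25 : eigenMultiplicity A φ (Complex.I * (Real.sqrt d : ℂ)) = 25 ∨
      eigenMultiplicity A φ (-(Complex.I * (Real.sqrt d : ℂ))) = 25)
    (N : ℕ) : HodgeConjectureFor (A.powSucc N).dim (A.powSucc N).X :=
  hodgeConjectureFor_of_isDivisorGenerated _
    (AbelianVariety.isDivisorGenerated_powSucc_of_eightyninefold_twentyFiveSixtyFour A φ hd hφ hE2 hX h25 N)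

/-- **Ribet 1983 Thm. 3 at `(n′, n″) = (26, 63)` — UNCONDITIONAL** (core `UnitaryTwentySixSixtyThree.eq_top_of_smul`).
[cite: Ribet1983, Thm. 0 and Thm. 3] [cite: Gordon1997, Thm. 6.3 (3) and Corollary] -/
theorem AbelianVariety.isDivisorGenerated_powSucc_of_ribetTypeTwentySixSixtyThree (A : AbelianVariety ℂ) (φ : A ⟶ A)
    {d : ℕ} (hd : 0 < d) (hφ : φ ≫ φ = -(d • 𝟙 A)) (hE2 : Module.finrank ℚ A.endAlgebra = 2)
    (h26 : eigenMultiplicity A φ (Complex.I * (Real.sqrt d : ℂ)) = 26)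
    (h63 : eigenMultiplicity A φ (-(Complex.I * (Real.sqrt d : ℂ))) = 63) (N : ℕ) :
    IsDivisorGenerated (A.powSucc N) := by
  refine AbelianVariety.isDivisorGenerated_powSucc_of_ribetType_ofCoreSmul A φ hd hφ hE2 (by omega) (by omega) ?_ N
  intro W' _ _ _ 𝔊 ι P' Q' s hbr hirr hι hιι hP' hQ' hfinP' hfinQ' hadd hsmul hsymm hPQ hdefP hdefQ hadj
  exact UnitaryTwentySixSixtyThree.eq_top_of_smul hbr hirr hι hιι hP' hQ' (by rw [hfinP', h26]) (by rw [hfinQ', h63]) hadd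
    hsmul hsymm hPQ hdefP hdefQ hadj

/-- The mirror: `n_{i√d}(φ) = 63`, `n_{−i√d}(φ) = 26` (core `UnitaryTwentySixSixtyThree.eq_top_of_smul'`).
[cite: Ribet1983, Thm. 0 and Thm. 3] [cite: Gordon1997, Thm. 6.3 (3) and Corollary] -/
theorem AbelianVariety.isDivisorGenerated_powSucc_of_ribetTypeTwentySixSixtyThree' (A : AbelianVariety ℂ) (φ : A ⟶ A)
    {d : ℕ} (hd : 0 < d) (hφ : φ ≫ φ = -(d • 𝟙 A)) (hE2 : Module.finrank ℚ A.endAlgebra = 2)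
    (h63 : eigenMultiplicity A φ (Complex.I * (Real.sqrt d : ℂ)) = 63)
    (h26 : eigenMultiplicity A φ (-(Complex.I * (Real.sqrt d : ℂ))) = 26) (N : ℕ) :
    IsDivisorGenerated (A.powSucc N) := by
  refine AbelianVariety.isDivisorGenerated_powSucc_of_ribetType_ofCoreSmul A φ hd hφ hE2 (by omega) (by omega) ?_ N
  intro W' _ _ _ 𝔊 ι P' Q' s hbr hirr hι hιι hP' hQ' hfinP' hfinQ' hadd hsmul hsymm hPQ hdefP hdefQ hadj
  exact UnitaryTwentySixSixtyThree.eq_top_of_smul' hbr hirr hι hιι hP' hQ' (by rw [hfinP', h63]) (by rw [hfinQ', h26])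
    hadd hsmul hsymm hPQ hdefP hdefQ hadj

/-- **The Hodge conjecture for all powers `A^{N+1}` of an abelian variety of Ribet type `(26, 63)` — UNCONDITIONAL.**
[cite: Ribet1983, Thm. 3] [cite: Deligne2000, §1] -/
theorem hodgeConjectureFor_powSucc_of_ribetTypeTwentySixSixtyThree (A : AbelianVariety ℂ) (φ : A ⟶ A)
    {d : ℕ} (hd : 0 < d) (hφ : φ ≫ φ = -(d • 𝟙 A)) (hE2 : Module.finrank ℚ A.endAlgebra = 2)
    (h26 : eigenMultiplicity A φ (Complex.I * (Real.sqrt d : ℂ)) = 26)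
    (h63 : eigenMultiplicity A φ (-(Complex.I * (Real.sqrt d : ℂ))) = 63) (N : ℕ) :
    HodgeConjectureFor (A.powSucc N).dim (A.powSucc N).X :=
  hodgeConjectureFor_of_isDivisorGenerated _
    (AbelianVariety.isDivisorGenerated_powSucc_of_ribetTypeTwentySixSixtyThree A φ hd hφ hE2 h26 h63 N)

/-- **89-FOLDS of signature `{26, 63}`: `B• = D•` on all powers — UNCONDITIONAL** (either eigenvalue may carry the `26`).
[cite: Ribet1983, Thm. 0 and Thm. 3] [cite: MoonenZarhin1999LowDim, §2 (2.4)] -/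
theorem AbelianVariety.isDivisorGenerated_powSucc_of_eightyninefold_twentySixSixtyThree (A : AbelianVariety ℂ)
    (φ : A ⟶ A) {d : ℕ} (hd : 0 < d) (hφ : φ ≫ φ = -(d • 𝟙 A)) (hE2 : Module.finrank ℚ A.endAlgebra = 2)
    (hX : A.dim = 89)
    (h26 : eigenMultiplicity A φ (Complex.I * (Real.sqrt d : ℂ)) = 26 ∨
      eigenMultiplicity A φ (-(Complex.I * (Real.sqrt d : ℂ))) = 26)
    (N : ℕ) : IsDivisorGenerated (A.powSucc N) := by
  have hsum := eigenMultiplicity_add_eigenMultiplicity_neg_eq_dim A φ hd hφ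
  rw [hX] at hsum
  rcases h26 with h | h
  · exact AbelianVariety.isDivisorGenerated_powSucc_of_ribetTypeTwentySixSixtyThree A φ hd hφ hE2 h (by omega) N
  · exact AbelianVariety.isDivisorGenerated_powSucc_of_ribetTypeTwentySixSixtyThree' A φ hd hφ hE2 (by omega) h N

/-- **The Hodge conjecture for all powers of a 89-FOLD of signature `{26, 63}` — UNCONDITIONAL.**
[cite: Ribet1983, Thm. 3] [cite: Deligne2000, §1] -/
theorem hodgeConjectureFor_powSucc_of_eightyninefold_twentySixSixtyThree (A : AbelianVariety ℂ)
    (φ : A ⟶ A) {d : ℕ} (hd : 0 < d) (hφ : φ ≫ φ = -(d • 𝟙 A)) (hE2 : Module.finrank ℚ A.endAlgebra = 2)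
    (hX : A.dim = 89)
    (h26 : eigenMultiplicity A φ (Complex.I * (Real.sqrt d : ℂ)) = 26 ∨
      eigenMultiplicity A φ (-(Complex.I * (Real.sqrt d : ℂ))) = 26)
    (N : ℕ) : HodgeConjectureFor (A.powSucc N).dim (A.powSucc N).X :=
  hodgeConjectureFor_of_isDivisorGenerated _
    (AbelianVariety.isDivisorGenerated_powSucc_of_eightyninefold_twentySixSixtyThree A φ hd hφ hE2 hX h26 N)

/-- **Ribet 1983 Thm. 3 at `(n′, n″) = (27, 62)` — UNCONDITIONAL** (core `UnitaryTwentySevenSixtyTwo.eq_top_of_smul`).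
[cite: Ribet1983, Thm. 0 and Thm. 3] [cite: Gordon1997, Thm. 6.3 (3) and Corollary] -/
theorem AbelianVariety.isDivisorGenerated_powSucc_of_ribetTypeTwentySevenSixtyTwo (A : AbelianVariety ℂ) (φ : A ⟶ A)
    {d : ℕ} (hd : 0 < d) (hφ : φ ≫ φ = -(d • 𝟙 A)) (hE2 : Module.finrank ℚ A.endAlgebra = 2)
    (h27 : eigenMultiplicity A φ (Complex.I * (Real.sqrt d : ℂ)) = 27)
    (h62 : eigenMultiplicity A φ (-(Complex.I * (Real.sqrt d : ℂ))) = 62) (N : ℕ) :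
    IsDivisorGenerated (A.powSucc N) := by
  refine AbelianVariety.isDivisorGenerated_powSucc_of_ribetType_ofCoreSmul A φ hd hφ hE2 (by omega) (by omega) ?_ N
  intro W' _ _ _ 𝔊 ι P' Q' s hbr hirr hι hιι hP' hQ' hfinP' hfinQ' hadd hsmul hsymm hPQ hdefP hdefQ hadj
  exact UnitaryTwentySevenSixtyTwo.eq_top_of_smul hbr hirr hι hιι hP' hQ' (by rw [hfinP', h27]) (by rw [hfinQ', h62]) hadd
    hsmul hsymm hPQ hdefP hdefQ hadj

/-- The mirror: `n_{i√d}(φ) = 62`, `n_{−i√d}(φ) = 27` (core `UnitaryTwentySevenSixtyTwo.eq_top_of_smul'`).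
[cite: Ribet1983, Thm. 0 and Thm. 3] [cite: Gordon1997, Thm. 6.3 (3) and Corollary] -/
theorem AbelianVariety.isDivisorGenerated_powSucc_of_ribetTypeTwentySevenSixtyTwo' (A : AbelianVariety ℂ) (φ : A ⟶ A)
    {d : ℕ} (hd : 0 < d) (hφ : φ ≫ φ = -(d • 𝟙 A)) (hE2 : Module.finrank ℚ A.endAlgebra = 2)
    (h62 : eigenMultiplicity A φ (Complex.I * (Real.sqrt d : ℂ)) = 62)
    (h27 : eigenMultiplicity A φ (-(Complex.I * (Real.sqrt d : ℂ))) = 27) (N : ℕ) :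
    IsDivisorGenerated (A.powSucc N) := by
  refine AbelianVariety.isDivisorGenerated_powSucc_of_ribetType_ofCoreSmul A φ hd hφ hE2 (by omega) (by omega) ?_ N
  intro W' _ _ _ 𝔊 ι P' Q' s hbr hirr hι hιι hP' hQ' hfinP' hfinQ' hadd hsmul hsymm hPQ hdefP hdefQ hadj
  exact UnitaryTwentySevenSixtyTwo.eq_top_of_smul' hbr hirr hι hιι hP' hQ' (by rw [hfinP', h62]) (by rw [hfinQ', h27])
    hadd hsmul hsymm hPQ hdefP hdefQ hadj

/-- **The Hodge conjecture for all powers `A^{N+1}` of an abelian variety of Ribet type `(27, 62)` — UNCONDITIONAL.**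
[cite: Ribet1983, Thm. 3] [cite: Deligne2000, §1] -/
theorem hodgeConjectureFor_powSucc_of_ribetTypeTwentySevenSixtyTwo (A : AbelianVariety ℂ) (φ : A ⟶ A)
    {d : ℕ} (hd : 0 < d) (hφ : φ ≫ φ = -(d • 𝟙 A)) (hE2 : Module.finrank ℚ A.endAlgebra = 2)
    (h27 : eigenMultiplicity A φ (Complex.I * (Real.sqrt d : ℂ)) = 27)
    (h62 : eigenMultiplicity A φ (-(Complex.I * (Real.sqrt d : ℂ))) = 62) (N : ℕ) :
    HodgeConjectureFor (A.powSucc N).dim (A.powSucc N).X :=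
  hodgeConjectureFor_of_isDivisorGenerated _
    (AbelianVariety.isDivisorGenerated_powSucc_of_ribetTypeTwentySevenSixtyTwo A φ hd hφ hE2 h27 h62 N)

/-- **89-FOLDS of signature `{27, 62}`: `B• = D•` on all powers — UNCONDITIONAL** (either eigenvalue may carry the `27`).
[cite: Ribet1983, Thm. 0 and Thm. 3] [cite: MoonenZarhin1999LowDim, §2 (2.4)] -/
theorem AbelianVariety.isDivisorGenerated_powSucc_of_eightyninefold_twentySevenSixtyTwo (A : AbelianVariety ℂ)
    (φ : A ⟶ A) {d : ℕ} (hd : 0 < d) (hφ : φ ≫ φ = -(d • 𝟙 A)) (hE2 : Module.finrank ℚ A.endAlgebra = 2)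
    (hX : A.dim = 89)
    (h27 : eigenMultiplicity A φ (Complex.I * (Real.sqrt d : ℂ)) = 27 ∨
      eigenMultiplicity A φ (-(Complex.I * (Real.sqrt d : ℂ))) = 27)
    (N : ℕ) : IsDivisorGenerated (A.powSucc N) := by
  have hsum := eigenMultiplicity_add_eigenMultiplicity_neg_eq_dim A φ hd hφ
  rw [hX] at hsum
  rcases h27 with h | h
  · exact AbelianVariety.isDivisorGenerated_powSucc_of_ribetTypeTwentySevenSixtyTwo A φ hd hφ hE2 h (by omega) N
  · exact AbelianVariety.isDivisorGenerated_powSucc_of_ribetTypeTwentySevenSixtyTwo' A φ hd hφ hE2 (by omega) h N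

/-- **The Hodge conjecture for all powers of a 89-FOLD of signature `{27, 62}` — UNCONDITIONAL.**
[cite: Ribet1983, Thm. 3] [cite: Deligne2000, §1] -/
theorem hodgeConjectureFor_powSucc_of_eightyninefold_twentySevenSixtyTwo (A : AbelianVariety ℂ)
    (φ : A ⟶ A) {d : ℕ} (hd : 0 < d) (hφ : φ ≫ φ = -(d • 𝟙 A)) (hE2 : Module.finrank ℚ A.endAlgebra = 2)
    (hX : A.dim = 89)
    (h27 : eigenMultiplicity A φ (Complex.I * (Real.sqrt d : ℂ)) = 27 ∨
      eigenMultiplicity A φ (-(Complex.I * (Real.sqrt d : ℂ))) = 27)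
    (N : ℕ) : HodgeConjectureFor (A.powSucc N).dim (A.powSucc N).X :=
  hodgeConjectureFor_of_isDivisorGenerated _
    (AbelianVariety.isDivisorGenerated_powSucc_of_eightyninefold_twentySevenSixtyTwo A φ hd hφ hE2 hX h27 N)

/-- **Ribet 1983 Thm. 3 at `(n′, n″) = (29, 60)` — UNCONDITIONAL** (core `UnitaryTwentyNineSixty.eq_top_of_smul`).
[cite: Ribet1983, Thm. 0 and Thm. 3] [cite: Gordon1997, Thm. 6.3 (3) and Corollary] -/
theorem AbelianVariety.isDivisorGenerated_powSucc_of_ribetTypeTwentyNineSixty (A : AbelianVariety ℂ) (φ : A ⟶ A)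
    {d : ℕ} (hd : 0 < d) (hφ : φ ≫ φ = -(d • 𝟙 A)) (hE2 : Module.finrank ℚ A.endAlgebra = 2)
    (h29 : eigenMultiplicity A φ (Complex.I * (Real.sqrt d : ℂ)) = 29)
    (h60 : eigenMultiplicity A φ (-(Complex.I * (Real.sqrt d : ℂ))) = 60) (N : ℕ) :
    IsDivisorGenerated (A.powSucc N) := by
  refine AbelianVariety.isDivisorGenerated_powSucc_of_ribetType_ofCoreSmul A φ hd hφ hE2 (by omega) (by omega) ?_ N
  intro W' _ _ _ 𝔊 ι P' Q' s hbr hirr hι hιι hP' hQ' hfinP' hfinQ' hadd hsmul hsymm hPQ hdefP hdefQ hadj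
  exact UnitaryTwentyNineSixty.eq_top_of_smul hbr hirr hι hιι hP' hQ' (by rw [hfinP', h29]) (by rw [hfinQ', h60]) hadd
    hsmul hsymm hPQ hdefP hdefQ hadj

/-- The mirror: `n_{i√d}(φ) = 60`, `n_{−i√d}(φ) = 29` (core `UnitaryTwentyNineSixty.eq_top_of_smul'`).
[cite: Ribet1983, Thm. 0 and Thm. 3] [cite: Gordon1997, Thm. 6.3 (3) and Corollary] -/
theorem AbelianVariety.isDivisorGenerated_powSucc_of_ribetTypeTwentyNineSixty' (A : AbelianVariety ℂ) (φ : A ⟶ A)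
    {d : ℕ} (hd : 0 < d) (hφ : φ ≫ φ = -(d • 𝟙 A)) (hE2 : Module.finrank ℚ A.endAlgebra = 2)
    (h60 : eigenMultiplicity A φ (Complex.I * (Real.sqrt d : ℂ)) = 60)
    (h29 : eigenMultiplicity A φ (-(Complex.I * (Real.sqrt d : ℂ))) = 29) (N : ℕ) :
    IsDivisorGenerated (A.powSucc N) := by
  refine AbelianVariety.isDivisorGenerated_powSucc_of_ribetType_ofCoreSmul A φ hd hφ hE2 (by omega) (by omega) ?_ N
  intro W' _ _ _ 𝔊 ι P' Q' s hbr hirr hι hιι hP' hQ' hfinP' hfinQ' hadd hsmul hsymm hPQ hdefP hdefQ hadj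
  exact UnitaryTwentyNineSixty.eq_top_of_smul' hbr hirr hι hιι hP' hQ' (by rw [hfinP', h60]) (by rw [hfinQ', h29])
    hadd hsmul hsymm hPQ hdefP hdefQ hadj

/-- **The Hodge conjecture for all powers `A^{N+1}` of an abelian variety of Ribet type `(29, 60)` — UNCONDITIONAL.**
[cite: Ribet1983, Thm. 3] [cite: Deligne2000, §1] -/
theorem hodgeConjectureFor_powSucc_of_ribetTypeTwentyNineSixty (A : AbelianVariety ℂ) (φ : A ⟶ A)
    {d : ℕ} (hd : 0 < d) (hφ : φ ≫ φ = -(d • 𝟙 A)) (hE2 : Module.finrank ℚ A.endAlgebra = 2)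
    (h29 : eigenMultiplicity A φ (Complex.I * (Real.sqrt d : ℂ)) = 29)
    (h60 : eigenMultiplicity A φ (-(Complex.I * (Real.sqrt d : ℂ))) = 60) (N : ℕ) :
    HodgeConjectureFor (A.powSucc N).dim (A.powSucc N).X :=
  hodgeConjectureFor_of_isDivisorGenerated _
    (AbelianVariety.isDivisorGenerated_powSucc_of_ribetTypeTwentyNineSixty A φ hd hφ hE2 h29 h60 N)

/-- **89-FOLDS of signature `{29, 60}`: `B• = D•` on all powers — UNCONDITIONAL** (either eigenvalue may carry the `29`).
[cite: Ribet1983, Thm. 0 and Thm. 3] [cite: MoonenZarhin1999LowDim, §2 (2.4)] -/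
theorem AbelianVariety.isDivisorGenerated_powSucc_of_eightyninefold_twentyNineSixty (A : AbelianVariety ℂ)
    (φ : A ⟶ A) {d : ℕ} (hd : 0 < d) (hφ : φ ≫ φ = -(d • 𝟙 A)) (hE2 : Module.finrank ℚ A.endAlgebra = 2)
    (hX : A.dim = 89)
    (h29 : eigenMultiplicity A φ (Complex.I * (Real.sqrt d : ℂ)) = 29 ∨
      eigenMultiplicity A φ (-(Complex.I * (Real.sqrt d : ℂ))) = 29)
    (N : ℕ) : IsDivisorGenerated (A.powSucc N) := by
  have hsum := eigenMultiplicity_add_eigenMultiplicity_neg_eq_dim A φ hd hφ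
  rw [hX] at hsum
  rcases h29 with h | h
  · exact AbelianVariety.isDivisorGenerated_powSucc_of_ribetTypeTwentyNineSixty A φ hd hφ hE2 h (by omega) N
  · exact AbelianVariety.isDivisorGenerated_powSucc_of_ribetTypeTwentyNineSixty' A φ hd hφ hE2 (by omega) h N

/-- **The Hodge conjecture for all powers of a 89-FOLD of signature `{29, 60}` — UNCONDITIONAL.**
[cite: Ribet1983, Thm. 3] [cite: Deligne2000, §1] -/
theorem hodgeConjectureFor_powSucc_of_eightyninefold_twentyNineSixty (A : AbelianVariety ℂ)
    (φ : A ⟶ A) {d : ℕ} (hd : 0 < d) (hφ : φ ≫ φ = -(d • 𝟙 A)) (hE2 : Module.finrank ℚ A.endAlgebra = 2)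
    (hX : A.dim = 89)
    (h29 : eigenMultiplicity A φ (Complex.I * (Real.sqrt d : ℂ)) = 29 ∨
      eigenMultiplicity A φ (-(Complex.I * (Real.sqrt d : ℂ))) = 29)
    (N : ℕ) : HodgeConjectureFor (A.powSucc N).dim (A.powSucc N).X :=
  hodgeConjectureFor_of_isDivisorGenerated _
    (AbelianVariety.isDivisorGenerated_powSucc_of_eightyninefold_twentyNineSixty A φ hd hφ hE2 hX h29 N)

/-- **Ribet 1983 Thm. 3 at `(n′, n″) = (31, 58)` — UNCONDITIONAL** (core `UnitaryThirtyOneFiftyEight.eq_top_of_smul`).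
[cite: Ribet1983, Thm. 0 and Thm. 3] [cite: Gordon1997, Thm. 6.3 (3) and Corollary] -/
theorem AbelianVariety.isDivisorGenerated_powSucc_of_ribetTypeThirtyOneFiftyEight (A : AbelianVariety ℂ) (φ : A ⟶ A)
    {d : ℕ} (hd : 0 < d) (hφ : φ ≫ φ = -(d • 𝟙 A)) (hE2 : Module.finrank ℚ A.endAlgebra = 2)
    (h31 : eigenMultiplicity A φ (Complex.I * (Real.sqrt d : ℂ)) = 31)
    (h58 : eigenMultiplicity A φ (-(Complex.I * (Real.sqrt d : ℂ))) = 58) (N : ℕ) :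
    IsDivisorGenerated (A.powSucc N) := by
  refine AbelianVariety.isDivisorGenerated_powSucc_of_ribetType_ofCoreSmul A φ hd hφ hE2 (by omega) (by omega) ?_ N
  intro W' _ _ _ 𝔊 ι P' Q' s hbr hirr hι hιι hP' hQ' hfinP' hfinQ' hadd hsmul hsymm hPQ hdefP hdefQ hadj
  exact UnitaryThirtyOneFiftyEight.eq_top_of_smul hbr hirr hι hιι hP' hQ' (by rw [hfinP', h31]) (by rw [hfinQ', h58]) hadd
    hsmul hsymm hPQ hdefP hdefQ hadj

/-- The mirror: `n_{i√d}(φ) = 58`, `n_{−i√d}(φ) = 31` (core `UnitaryThirtyOneFiftyEight.eq_top_of_smul'`).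
[cite: Ribet1983, Thm. 0 and Thm. 3] [cite: Gordon1997, Thm. 6.3 (3) and Corollary] -/
theorem AbelianVariety.isDivisorGenerated_powSucc_of_ribetTypeThirtyOneFiftyEight' (A : AbelianVariety ℂ) (φ : A ⟶ A)
    {d : ℕ} (hd : 0 < d) (hφ : φ ≫ φ = -(d • 𝟙 A)) (hE2 : Module.finrank ℚ A.endAlgebra = 2)
    (h58 : eigenMultiplicity A φ (Complex.I * (Real.sqrt d : ℂ)) = 58)
    (h31 : eigenMultiplicity A φ (-(Complex.I * (Real.sqrt d : ℂ))) = 31) (N : ℕ) :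
    IsDivisorGenerated (A.powSucc N) := by
  refine AbelianVariety.isDivisorGenerated_powSucc_of_ribetType_ofCoreSmul A φ hd hφ hE2 (by omega) (by omega) ?_ N
  intro W' _ _ _ 𝔊 ι P' Q' s hbr hirr hι hιι hP' hQ' hfinP' hfinQ' hadd hsmul hsymm hPQ hdefP hdefQ hadj
  exact UnitaryThirtyOneFiftyEight.eq_top_of_smul' hbr hirr hι hιι hP' hQ' (by rw [hfinP', h58]) (by rw [hfinQ', h31])
    hadd hsmul hsymm hPQ hdefP hdefQ hadj

/-- **The Hodge conjecture for all powers `A^{N+1}` of an abelian variety of Ribet type `(31, 58)` — UNCONDITIONAL.**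
[cite: Ribet1983, Thm. 3] [cite: Deligne2000, §1] -/
theorem hodgeConjectureFor_powSucc_of_ribetTypeThirtyOneFiftyEight (A : AbelianVariety ℂ) (φ : A ⟶ A)
    {d : ℕ} (hd : 0 < d) (hφ : φ ≫ φ = -(d • 𝟙 A)) (hE2 : Module.finrank ℚ A.endAlgebra = 2)
    (h31 : eigenMultiplicity A φ (Complex.I * (Real.sqrt d : ℂ)) = 31)
    (h58 : eigenMultiplicity A φ (-(Complex.I * (Real.sqrt d : ℂ))) = 58) (N : ℕ) :
    HodgeConjectureFor (A.powSucc N).dim (A.powSucc N).X :=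
  hodgeConjectureFor_of_isDivisorGenerated _
    (AbelianVariety.isDivisorGenerated_powSucc_of_ribetTypeThirtyOneFiftyEight A φ hd hφ hE2 h31 h58 N)

/-- **89-FOLDS of signature `{31, 58}`: `B• = D•` on all powers — UNCONDITIONAL** (either eigenvalue may carry the `31`).
[cite: Ribet1983, Thm. 0 and Thm. 3] [cite: MoonenZarhin1999LowDim, §2 (2.4)] -/
theorem AbelianVariety.isDivisorGenerated_powSucc_of_eightyninefold_thirtyOneFiftyEight (A : AbelianVariety ℂ)
    (φ : A ⟶ A) {d : ℕ} (hd : 0 < d) (hφ : φ ≫ φ = -(d • 𝟙 A)) (hE2 : Module.finrank ℚ A.endAlgebra = 2)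
    (hX : A.dim = 89)
    (h31 : eigenMultiplicity A φ (Complex.I * (Real.sqrt d : ℂ)) = 31 ∨
      eigenMultiplicity A φ (-(Complex.I * (Real.sqrt d : ℂ))) = 31)
    (N : ℕ) : IsDivisorGenerated (A.powSucc N) := by
  have hsum := eigenMultiplicity_add_eigenMultiplicity_neg_eq_dim A φ hd hφ
  rw [hX] at hsum
  rcases h31 with h | h
  · exact AbelianVariety.isDivisorGenerated_powSucc_of_ribetTypeThirtyOneFiftyEight A φ hd hφ hE2 h (by omega) N
  · exact AbelianVariety.isDivisorGenerated_powSucc_of_ribetTypeThirtyOneFiftyEight' A φ hd hφ hE2 (by omega) h N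

/-- **The Hodge conjecture for all powers of a 89-FOLD of signature `{31, 58}` — UNCONDITIONAL.**
[cite: Ribet1983, Thm. 3] [cite: Deligne2000, §1] -/
theorem hodgeConjectureFor_powSucc_of_eightyninefold_thirtyOneFiftyEight (A : AbelianVariety ℂ)
    (φ : A ⟶ A) {d : ℕ} (hd : 0 < d) (hφ : φ ≫ φ = -(d • 𝟙 A)) (hE2 : Module.finrank ℚ A.endAlgebra = 2)
    (hX : A.dim = 89)
    (h31 : eigenMultiplicity A φ (Complex.I * (Real.sqrt d : ℂ)) = 31 ∨
      eigenMultiplicity A φ (-(Complex.I * (Real.sqrt d : ℂ))) = 31)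
    (N : ℕ) : HodgeConjectureFor (A.powSucc N).dim (A.powSucc N).X :=
  hodgeConjectureFor_of_isDivisorGenerated _
    (AbelianVariety.isDivisorGenerated_powSucc_of_eightyninefold_thirtyOneFiftyEight A φ hd hφ hE2 hX h31 N)

/-- **Ribet 1983 Thm. 3 at `(n′, n″) = (32, 57)` — UNCONDITIONAL** (core `UnitaryThirtyTwoFiftySeven.eq_top_of_smul`).
[cite: Ribet1983, Thm. 0 and Thm. 3] [cite: Gordon1997, Thm. 6.3 (3) and Corollary] -/
theorem AbelianVariety.isDivisorGenerated_powSucc_of_ribetTypeThirtyTwoFiftySeven (A : AbelianVariety ℂ) (φ : A ⟶ A)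
    {d : ℕ} (hd : 0 < d) (hφ : φ ≫ φ = -(d • 𝟙 A)) (hE2 : Module.finrank ℚ A.endAlgebra = 2)
    (h32 : eigenMultiplicity A φ (Complex.I * (Real.sqrt d : ℂ)) = 32)
    (h57 : eigenMultiplicity A φ (-(Complex.I * (Real.sqrt d : ℂ))) = 57) (N : ℕ) :
    IsDivisorGenerated (A.powSucc N) := by
  refine AbelianVariety.isDivisorGenerated_powSucc_of_ribetType_ofCoreSmul A φ hd hφ hE2 (by omega) (by omega) ?_ N
  intro W' _ _ _ 𝔊 ι P' Q' s hbr hirr hι hιι hP' hQ' hfinP' hfinQ' hadd hsmul hsymm hPQ hdefP hdefQ hadj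
  exact UnitaryThirtyTwoFiftySeven.eq_top_of_smul hbr hirr hι hιι hP' hQ' (by rw [hfinP', h32]) (by rw [hfinQ', h57]) hadd
    hsmul hsymm hPQ hdefP hdefQ hadj

/-- The mirror: `n_{i√d}(φ) = 57`, `n_{−i√d}(φ) = 32` (core `UnitaryThirtyTwoFiftySeven.eq_top_of_smul'`).
[cite: Ribet1983, Thm. 0 and Thm. 3] [cite: Gordon1997, Thm. 6.3 (3) and Corollary] -/
theorem AbelianVariety.isDivisorGenerated_powSucc_of_ribetTypeThirtyTwoFiftySeven' (A : AbelianVariety ℂ) (φ : A ⟶ A)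
    {d : ℕ} (hd : 0 < d) (hφ : φ ≫ φ = -(d • 𝟙 A)) (hE2 : Module.finrank ℚ A.endAlgebra = 2)
    (h57 : eigenMultiplicity A φ (Complex.I * (Real.sqrt d : ℂ)) = 57)
    (h32 : eigenMultiplicity A φ (-(Complex.I * (Real.sqrt d : ℂ))) = 32) (N : ℕ) :
    IsDivisorGenerated (A.powSucc N) := by
  refine AbelianVariety.isDivisorGenerated_powSucc_of_ribetType_ofCoreSmul A φ hd hφ hE2 (by omega) (by omega) ?_ N
  intro W' _ _ _ 𝔊 ι P' Q' s hbr hirr hι hιι hP' hQ' hfinP' hfinQ' hadd hsmul hsymm hPQ hdefP hdefQ hadj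
  exact UnitaryThirtyTwoFiftySeven.eq_top_of_smul' hbr hirr hι hιι hP' hQ' (by rw [hfinP', h57]) (by rw [hfinQ', h32])
    hadd hsmul hsymm hPQ hdefP hdefQ hadj

/-- **The Hodge conjecture for all powers `A^{N+1}` of an abelian variety of Ribet type `(32, 57)` — UNCONDITIONAL.**
[cite: Ribet1983, Thm. 3] [cite: Deligne2000, §1] -/
theorem hodgeConjectureFor_powSucc_of_ribetTypeThirtyTwoFiftySeven (A : AbelianVariety ℂ) (φ : A ⟶ A)
    {d : ℕ} (hd : 0 < d) (hφ : φ ≫ φ = -(d • 𝟙 A)) (hE2 : Module.finrank ℚ A.endAlgebra = 2)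
    (h32 : eigenMultiplicity A φ (Complex.I * (Real.sqrt d : ℂ)) = 32)
    (h57 : eigenMultiplicity A φ (-(Complex.I * (Real.sqrt d : ℂ))) = 57) (N : ℕ) :
    HodgeConjectureFor (A.powSucc N).dim (A.powSucc N).X :=
  hodgeConjectureFor_of_isDivisorGenerated _
    (AbelianVariety.isDivisorGenerated_powSucc_of_ribetTypeThirtyTwoFiftySeven A φ hd hφ hE2 h32 h57 N)

/-- **89-FOLDS of signature `{32, 57}`: `B• = D•` on all powers — UNCONDITIONAL** (either eigenvalue may carry the `32`).
[cite: Ribet1983, Thm. 0 and Thm. 3] [cite: MoonenZarhin1999LowDim, §2 (2.4)] -/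
theorem AbelianVariety.isDivisorGenerated_powSucc_of_eightyninefold_thirtyTwoFiftySeven (A : AbelianVariety ℂ)
    (φ : A ⟶ A) {d : ℕ} (hd : 0 < d) (hφ : φ ≫ φ = -(d • 𝟙 A)) (hE2 : Module.finrank ℚ A.endAlgebra = 2)
    (hX : A.dim = 89)
    (h32 : eigenMultiplicity A φ (Complex.I * (Real.sqrt d : ℂ)) = 32 ∨
      eigenMultiplicity A φ (-(Complex.I * (Real.sqrt d : ℂ))) = 32)
    (N : ℕ) : IsDivisorGenerated (A.powSucc N) := by
  have hsum := eigenMultiplicity_add_eigenMultiplicity_neg_eq_dim A φ hd hφ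
  rw [hX] at hsum
  rcases h32 with h | h
  · exact AbelianVariety.isDivisorGenerated_powSucc_of_ribetTypeThirtyTwoFiftySeven A φ hd hφ hE2 h (by omega) N
  · exact AbelianVariety.isDivisorGenerated_powSucc_of_ribetTypeThirtyTwoFiftySeven' A φ hd hφ hE2 (by omega) h N

/-- **The Hodge conjecture for all powers of a 89-FOLD of signature `{32, 57}` — UNCONDITIONAL.**
[cite: Ribet1983, Thm. 3] [cite: Deligne2000, §1] -/
theorem hodgeConjectureFor_powSucc_of_eightyninefold_thirtyTwoFiftySeven (A : AbelianVariety ℂ)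
    (φ : A ⟶ A) {d : ℕ} (hd : 0 < d) (hφ : φ ≫ φ = -(d • 𝟙 A)) (hE2 : Module.finrank ℚ A.endAlgebra = 2)
    (hX : A.dim = 89)
    (h32 : eigenMultiplicity A φ (Complex.I * (Real.sqrt d : ℂ)) = 32 ∨
      eigenMultiplicity A φ (-(Complex.I * (Real.sqrt d : ℂ))) = 32)
    (N : ℕ) : HodgeConjectureFor (A.powSucc N).dim (A.powSucc N).X :=
  hodgeConjectureFor_of_isDivisorGenerated _
    (AbelianVariety.isDivisorGenerated_powSucc_of_eightyninefold_thirtyTwoFiftySeven A φ hd hφ hE2 hX h32 N)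

/-- **Ribet 1983 Thm. 3 at `(n′, n″) = (33, 56)` — UNCONDITIONAL** (core `UnitaryThirtyThreeFiftySix.eq_top_of_smul`).
[cite: Ribet1983, Thm. 0 and Thm. 3] [cite: Gordon1997, Thm. 6.3 (3) and Corollary] -/
theorem AbelianVariety.isDivisorGenerated_powSucc_of_ribetTypeThirtyThreeFiftySix (A : AbelianVariety ℂ) (φ : A ⟶ A)
    {d : ℕ} (hd : 0 < d) (hφ : φ ≫ φ = -(d • 𝟙 A)) (hE2 : Module.finrank ℚ A.endAlgebra = 2)
    (h33 : eigenMultiplicity A φ (Complex.I * (Real.sqrt d : ℂ)) = 33)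
    (h56 : eigenMultiplicity A φ (-(Complex.I * (Real.sqrt d : ℂ))) = 56) (N : ℕ) :
    IsDivisorGenerated (A.powSucc N) := by
  refine AbelianVariety.isDivisorGenerated_powSucc_of_ribetType_ofCoreSmul A φ hd hφ hE2 (by omega) (by omega) ?_ N
  intro W' _ _ _ 𝔊 ι P' Q' s hbr hirr hι hιι hP' hQ' hfinP' hfinQ' hadd hsmul hsymm hPQ hdefP hdefQ hadj
  exact UnitaryThirtyThreeFiftySix.eq_top_of_smul hbr hirr hι hιι hP' hQ' (by rw [hfinP', h33]) (by rw [hfinQ', h56]) hadd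
    hsmul hsymm hPQ hdefP hdefQ hadj

/-- The mirror: `n_{i√d}(φ) = 56`, `n_{−i√d}(φ) = 33` (core `UnitaryThirtyThreeFiftySix.eq_top_of_smul'`).
[cite: Ribet1983, Thm. 0 and Thm. 3] [cite: Gordon1997, Thm. 6.3 (3) and Corollary] -/
theorem AbelianVariety.isDivisorGenerated_powSucc_of_ribetTypeThirtyThreeFiftySix' (A : AbelianVariety ℂ) (φ : A ⟶ A)
    {d : ℕ} (hd : 0 < d) (hφ : φ ≫ φ = -(d • 𝟙 A)) (hE2 : Module.finrank ℚ A.endAlgebra = 2)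
    (h56 : eigenMultiplicity A φ (Complex.I * (Real.sqrt d : ℂ)) = 56)
    (h33 : eigenMultiplicity A φ (-(Complex.I * (Real.sqrt d : ℂ))) = 33) (N : ℕ) :
    IsDivisorGenerated (A.powSucc N) := by
  refine AbelianVariety.isDivisorGenerated_powSucc_of_ribetType_ofCoreSmul A φ hd hφ hE2 (by omega) (by omega) ?_ N
  intro W' _ _ _ 𝔊 ι P' Q' s hbr hirr hι hιι hP' hQ' hfinP' hfinQ' hadd hsmul hsymm hPQ hdefP hdefQ hadj
  exact UnitaryThirtyThreeFiftySix.eq_top_of_smul' hbr hirr hι hιι hP' hQ' (by rw [hfinP', h56]) (by rw [hfinQ', h33])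
    hadd hsmul hsymm hPQ hdefP hdefQ hadj

/-- **The Hodge conjecture for all powers `A^{N+1}` of an abelian variety of Ribet type `(33, 56)` — UNCONDITIONAL.**
[cite: Ribet1983, Thm. 3] [cite: Deligne2000, §1] -/
theorem hodgeConjectureFor_powSucc_of_ribetTypeThirtyThreeFiftySix (A : AbelianVariety ℂ) (φ : A ⟶ A)
    {d : ℕ} (hd : 0 < d) (hφ : φ ≫ φ = -(d • 𝟙 A)) (hE2 : Module.finrank ℚ A.endAlgebra = 2)
    (h33 : eigenMultiplicity A φ (Complex.I * (Real.sqrt d : ℂ)) = 33)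
    (h56 : eigenMultiplicity A φ (-(Complex.I * (Real.sqrt d : ℂ))) = 56) (N : ℕ) :
    HodgeConjectureFor (A.powSucc N).dim (A.powSucc N).X :=
  hodgeConjectureFor_of_isDivisorGenerated _
    (AbelianVariety.isDivisorGenerated_powSucc_of_ribetTypeThirtyThreeFiftySix A φ hd hφ hE2 h33 h56 N)

/-- **89-FOLDS of signature `{33, 56}`: `B• = D•` on all powers — UNCONDITIONAL** (either eigenvalue may carry the `33`).
[cite: Ribet1983, Thm. 0 and Thm. 3] [cite: MoonenZarhin1999LowDim, §2 (2.4)] -/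
theorem AbelianVariety.isDivisorGenerated_powSucc_of_eightyninefold_thirtyThreeFiftySix (A : AbelianVariety ℂ)
    (φ : A ⟶ A) {d : ℕ} (hd : 0 < d) (hφ : φ ≫ φ = -(d • 𝟙 A)) (hE2 : Module.finrank ℚ A.endAlgebra = 2)
    (hX : A.dim = 89)
    (h33 : eigenMultiplicity A φ (Complex.I * (Real.sqrt d : ℂ)) = 33 ∨
      eigenMultiplicity A φ (-(Complex.I * (Real.sqrt d : ℂ))) = 33)
    (N : ℕ) : IsDivisorGenerated (A.powSucc N) := by
  have hsum := eigenMultiplicity_add_eigenMultiplicity_neg_eq_dim A φ hd hφ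
  rw [hX] at hsum
  rcases h33 with h | h
  · exact AbelianVariety.isDivisorGenerated_powSucc_of_ribetTypeThirtyThreeFiftySix A φ hd hφ hE2 h (by omega) N
  · exact AbelianVariety.isDivisorGenerated_powSucc_of_ribetTypeThirtyThreeFiftySix' A φ hd hφ hE2 (by omega) h N

/-- **The Hodge conjecture for all powers of a 89-FOLD of signature `{33, 56}` — UNCONDITIONAL.**
[cite: Ribet1983, Thm. 3] [cite: Deligne2000, §1] -/
theorem hodgeConjectureFor_powSucc_of_eightyninefold_thirtyThreeFiftySix (A : AbelianVariety ℂ)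
    (φ : A ⟶ A) {d : ℕ} (hd : 0 < d) (hφ : φ ≫ φ = -(d • 𝟙 A)) (hE2 : Module.finrank ℚ A.endAlgebra = 2)
    (hX : A.dim = 89)
    (h33 : eigenMultiplicity A φ (Complex.I * (Real.sqrt d : ℂ)) = 33 ∨
      eigenMultiplicity A φ (-(Complex.I * (Real.sqrt d : ℂ))) = 33)
    (N : ℕ) : HodgeConjectureFor (A.powSucc N).dim (A.powSucc N).X :=
  hodgeConjectureFor_of_isDivisorGenerated _
    (AbelianVariety.isDivisorGenerated_powSucc_of_eightyninefold_thirtyThreeFiftySix A φ hd hφ hE2 hX h33 N)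

/-- **Ribet 1983 Thm. 3 at `(n′, n″) = (34, 55)` — UNCONDITIONAL** (core `UnitaryThirtyFourFiftyFive.eq_top_of_smul`).
[cite: Ribet1983, Thm. 0 and Thm. 3] [cite: Gordon1997, Thm. 6.3 (3) and Corollary] -/
theorem AbelianVariety.isDivisorGenerated_powSucc_of_ribetTypeThirtyFourFiftyFive (A : AbelianVariety ℂ) (φ : A ⟶ A)
    {d : ℕ} (hd : 0 < d) (hφ : φ ≫ φ = -(d • 𝟙 A)) (hE2 : Module.finrank ℚ A.endAlgebra = 2)
    (h34 : eigenMultiplicity A φ (Complex.I * (Real.sqrt d : ℂ)) = 34)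
    (h55 : eigenMultiplicity A φ (-(Complex.I * (Real.sqrt d : ℂ))) = 55) (N : ℕ) :
    IsDivisorGenerated (A.powSucc N) := by
  refine AbelianVariety.isDivisorGenerated_powSucc_of_ribetType_ofCoreSmul A φ hd hφ hE2 (by omega) (by omega) ?_ N
  intro W' _ _ _ 𝔊 ι P' Q' s hbr hirr hι hιι hP' hQ' hfinP' hfinQ' hadd hsmul hsymm hPQ hdefP hdefQ hadj
  exact UnitaryThirtyFourFiftyFive.eq_top_of_smul hbr hirr hι hιι hP' hQ' (by rw [hfinP', h34]) (by rw [hfinQ', h55]) hadd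
    hsmul hsymm hPQ hdefP hdefQ hadj

/-- The mirror: `n_{i√d}(φ) = 55`, `n_{−i√d}(φ) = 34` (core `UnitaryThirtyFourFiftyFive.eq_top_of_smul'`).
[cite: Ribet1983, Thm. 0 and Thm. 3] [cite: Gordon1997, Thm. 6.3 (3) and Corollary] -/
theorem AbelianVariety.isDivisorGenerated_powSucc_of_ribetTypeThirtyFourFiftyFive' (A : AbelianVariety ℂ) (φ : A ⟶ A)
    {d : ℕ} (hd : 0 < d) (hφ : φ ≫ φ = -(d • 𝟙 A)) (hE2 : Module.finrank ℚ A.endAlgebra = 2)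
    (h55 : eigenMultiplicity A φ (Complex.I * (Real.sqrt d : ℂ)) = 55)
    (h34 : eigenMultiplicity A φ (-(Complex.I * (Real.sqrt d : ℂ))) = 34) (N : ℕ) :
    IsDivisorGenerated (A.powSucc N) := by
  refine AbelianVariety.isDivisorGenerated_powSucc_of_ribetType_ofCoreSmul A φ hd hφ hE2 (by omega) (by omega) ?_ N
  intro W' _ _ _ 𝔊 ι P' Q' s hbr hirr hι hιι hP' hQ' hfinP' hfinQ' hadd hsmul hsymm hPQ hdefP hdefQ hadj
  exact UnitaryThirtyFourFiftyFive.eq_top_of_smul' hbr hirr hι hιι hP' hQ' (by rw [hfinP', h55]) (by rw [hfinQ', h34])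
    hadd hsmul hsymm hPQ hdefP hdefQ hadj

/-- **The Hodge conjecture for all powers `A^{N+1}` of an abelian variety of Ribet type `(34, 55)` — UNCONDITIONAL.**
[cite: Ribet1983, Thm. 3] [cite: Deligne2000, §1] -/
theorem hodgeConjectureFor_powSucc_of_ribetTypeThirtyFourFiftyFive (A : AbelianVariety ℂ) (φ : A ⟶ A)
    {d : ℕ} (hd : 0 < d) (hφ : φ ≫ φ = -(d • 𝟙 A)) (hE2 : Module.finrank ℚ A.endAlgebra = 2)
    (h34 : eigenMultiplicity A φ (Complex.I * (Real.sqrt d : ℂ)) = 34)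
    (h55 : eigenMultiplicity A φ (-(Complex.I * (Real.sqrt d : ℂ))) = 55) (N : ℕ) :
    HodgeConjectureFor (A.powSucc N).dim (A.powSucc N).X :=
  hodgeConjectureFor_of_isDivisorGenerated _
    (AbelianVariety.isDivisorGenerated_powSucc_of_ribetTypeThirtyFourFiftyFive A φ hd hφ hE2 h34 h55 N)

/-- **89-FOLDS of signature `{34, 55}`: `B• = D•` on all powers — UNCONDITIONAL** (either eigenvalue may carry the `34`).
[cite: Ribet1983, Thm. 0 and Thm. 3] [cite: MoonenZarhin1999LowDim, §2 (2.4)] -/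
theorem AbelianVariety.isDivisorGenerated_powSucc_of_eightyninefold_thirtyFourFiftyFive (A : AbelianVariety ℂ)
    (φ : A ⟶ A) {d : ℕ} (hd : 0 < d) (hφ : φ ≫ φ = -(d • 𝟙 A)) (hE2 : Module.finrank ℚ A.endAlgebra = 2)
    (hX : A.dim = 89)
    (h34 : eigenMultiplicity A φ (Complex.I * (Real.sqrt d : ℂ)) = 34 ∨
      eigenMultiplicity A φ (-(Complex.I * (Real.sqrt d : ℂ))) = 34)
    (N : ℕ) : IsDivisorGenerated (A.powSucc N) := by
  have hsum := eigenMultiplicity_add_eigenMultiplicity_neg_eq_dim A φ hd hφ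
  rw [hX] at hsum
  rcases h34 with h | h
  · exact AbelianVariety.isDivisorGenerated_powSucc_of_ribetTypeThirtyFourFiftyFive A φ hd hφ hE2 h (by omega) N
  · exact AbelianVariety.isDivisorGenerated_powSucc_of_ribetTypeThirtyFourFiftyFive' A φ hd hφ hE2 (by omega) h N

/-- **The Hodge conjecture for all powers of a 89-FOLD of signature `{34, 55}` — UNCONDITIONAL.**
[cite: Ribet1983, Thm. 3] [cite: Deligne2000, §1] -/
theorem hodgeConjectureFor_powSucc_of_eightyninefold_thirtyFourFiftyFive (A : AbelianVariety ℂ)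
    (φ : A ⟶ A) {d : ℕ} (hd : 0 < d) (hφ : φ ≫ φ = -(d • 𝟙 A)) (hE2 : Module.finrank ℚ A.endAlgebra = 2)
    (hX : A.dim = 89)
    (h34 : eigenMultiplicity A φ (Complex.I * (Real.sqrt d : ℂ)) = 34 ∨
      eigenMultiplicity A φ (-(Complex.I * (Real.sqrt d : ℂ))) = 34)
    (N : ℕ) : HodgeConjectureFor (A.powSucc N).dim (A.powSucc N).X :=
  hodgeConjectureFor_of_isDivisorGenerated _
    (AbelianVariety.isDivisorGenerated_powSucc_of_eightyninefold_thirtyFourFiftyFive A φ hd hφ hE2 hX h34 N)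

/-- **Ribet 1983 Thm. 3 at `(n′, n″) = (35, 54)` — UNCONDITIONAL** (core `UnitaryThirtyFiveFiftyFour.eq_top_of_smul`).
[cite: Ribet1983, Thm. 0 and Thm. 3] [cite: Gordon1997, Thm. 6.3 (3) and Corollary] -/
theorem AbelianVariety.isDivisorGenerated_powSucc_of_ribetTypeThirtyFiveFiftyFour (A : AbelianVariety ℂ) (φ : A ⟶ A)
    {d : ℕ} (hd : 0 < d) (hφ : φ ≫ φ = -(d • 𝟙 A)) (hE2 : Module.finrank ℚ A.endAlgebra = 2)
    (h35 : eigenMultiplicity A φ (Complex.I * (Real.sqrt d : ℂ)) = 35)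
    (h54 : eigenMultiplicity A φ (-(Complex.I * (Real.sqrt d : ℂ))) = 54) (N : ℕ) :
    IsDivisorGenerated (A.powSucc N) := by
  refine AbelianVariety.isDivisorGenerated_powSucc_of_ribetType_ofCoreSmul A φ hd hφ hE2 (by omega) (by omega) ?_ N
  intro W' _ _ _ 𝔊 ι P' Q' s hbr hirr hι hιι hP' hQ' hfinP' hfinQ' hadd hsmul hsymm hPQ hdefP hdefQ hadj
  exact UnitaryThirtyFiveFiftyFour.eq_top_of_smul hbr hirr hι hιι hP' hQ' (by rw [hfinP', h35]) (by rw [hfinQ', h54]) hadd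
    hsmul hsymm hPQ hdefP hdefQ hadj

/-- The mirror: `n_{i√d}(φ) = 54`, `n_{−i√d}(φ) = 35` (core `UnitaryThirtyFiveFiftyFour.eq_top_of_smul'`).
[cite: Ribet1983, Thm. 0 and Thm. 3] [cite: Gordon1997, Thm. 6.3 (3) and Corollary] -/
theorem AbelianVariety.isDivisorGenerated_powSucc_of_ribetTypeThirtyFiveFiftyFour' (A : AbelianVariety ℂ) (φ : A ⟶ A)
    {d : ℕ} (hd : 0 < d) (hφ : φ ≫ φ = -(d • 𝟙 A)) (hE2 : Module.finrank ℚ A.endAlgebra = 2)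
    (h54 : eigenMultiplicity A φ (Complex.I * (Real.sqrt d : ℂ)) = 54)
    (h35 : eigenMultiplicity A φ (-(Complex.I * (Real.sqrt d : ℂ))) = 35) (N : ℕ) :
    IsDivisorGenerated (A.powSucc N) := by
  refine AbelianVariety.isDivisorGenerated_powSucc_of_ribetType_ofCoreSmul A φ hd hφ hE2 (by omega) (by omega) ?_ N
  intro W' _ _ _ 𝔊 ι P' Q' s hbr hirr hι hιι hP' hQ' hfinP' hfinQ' hadd hsmul hsymm hPQ hdefP hdefQ hadj
  exact UnitaryThirtyFiveFiftyFour.eq_top_of_smul' hbr hirr hι hιι hP' hQ' (by rw [hfinP', h54]) (by rw [hfinQ', h35])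
    hadd hsmul hsymm hPQ hdefP hdefQ hadj

/-- **The Hodge conjecture for all powers `A^{N+1}` of an abelian variety of Ribet type `(35, 54)` — UNCONDITIONAL.**
[cite: Ribet1983, Thm. 3] [cite: Deligne2000, §1] -/
theorem hodgeConjectureFor_powSucc_of_ribetTypeThirtyFiveFiftyFour (A : AbelianVariety ℂ) (φ : A ⟶ A)
    {d : ℕ} (hd : 0 < d) (hφ : φ ≫ φ = -(d • 𝟙 A)) (hE2 : Module.finrank ℚ A.endAlgebra = 2)
    (h35 : eigenMultiplicity A φ (Complex.I * (Real.sqrt d : ℂ)) = 35)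
    (h54 : eigenMultiplicity A φ (-(Complex.I * (Real.sqrt d : ℂ))) = 54) (N : ℕ) :
    HodgeConjectureFor (A.powSucc N).dim (A.powSucc N).X :=
  hodgeConjectureFor_of_isDivisorGenerated _
    (AbelianVariety.isDivisorGenerated_powSucc_of_ribetTypeThirtyFiveFiftyFour A φ hd hφ hE2 h35 h54 N)

/-- **89-FOLDS of signature `{35, 54}`: `B• = D•` on all powers — UNCONDITIONAL** (either eigenvalue may carry the `35`).
[cite: Ribet1983, Thm. 0 and Thm. 3] [cite: MoonenZarhin1999LowDim, §2 (2.4)] -/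
theorem AbelianVariety.isDivisorGenerated_powSucc_of_eightyninefold_thirtyFiveFiftyFour (A : AbelianVariety ℂ)
    (φ : A ⟶ A) {d : ℕ} (hd : 0 < d) (hφ : φ ≫ φ = -(d • 𝟙 A)) (hE2 : Module.finrank ℚ A.endAlgebra = 2)
    (hX : A.dim = 89)
    (h35 : eigenMultiplicity A φ (Complex.I * (Real.sqrt d : ℂ)) = 35 ∨
      eigenMultiplicity A φ (-(Complex.I * (Real.sqrt d : ℂ))) = 35)
    (N : ℕ) : IsDivisorGenerated (A.powSucc N) := by
  have hsum := eigenMultiplicity_add_eigenMultiplicity_neg_eq_dim A φ hd hφ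
  rw [hX] at hsum
  rcases h35 with h | h
  · exact AbelianVariety.isDivisorGenerated_powSucc_of_ribetTypeThirtyFiveFiftyFour A φ hd hφ hE2 h (by omega) N
  · exact AbelianVariety.isDivisorGenerated_powSucc_of_ribetTypeThirtyFiveFiftyFour' A φ hd hφ hE2 (by omega) h N

/-- **The Hodge conjecture for all powers of a 89-FOLD of signature `{35, 54}` — UNCONDITIONAL.**
[cite: Ribet1983, Thm. 3] [cite: Deligne2000, §1] -/
theorem hodgeConjectureFor_powSucc_of_eightyninefold_thirtyFiveFiftyFour (A : AbelianVariety ℂ)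
    (φ : A ⟶ A) {d : ℕ} (hd : 0 < d) (hφ : φ ≫ φ = -(d • 𝟙 A)) (hE2 : Module.finrank ℚ A.endAlgebra = 2)
    (hX : A.dim = 89)
    (h35 : eigenMultiplicity A φ (Complex.I * (Real.sqrt d : ℂ)) = 35 ∨
      eigenMultiplicity A φ (-(Complex.I * (Real.sqrt d : ℂ))) = 35)
    (N : ℕ) : HodgeConjectureFor (A.powSucc N).dim (A.powSucc N).X :=
  hodgeConjectureFor_of_isDivisorGenerated _
    (AbelianVariety.isDivisorGenerated_powSucc_of_eightyninefold_thirtyFiveFiftyFour A φ hd hφ hE2 hX h35 N)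

/-- **Ribet 1983 Thm. 3 at `(n′, n″) = (37, 52)` — UNCONDITIONAL** (core `UnitaryThirtySevenFiftyTwo.eq_top_of_smul`).
[cite: Ribet1983, Thm. 0 and Thm. 3] [cite: Gordon1997, Thm. 6.3 (3) and Corollary] -/
theorem AbelianVariety.isDivisorGenerated_powSucc_of_ribetTypeThirtySevenFiftyTwo (A : AbelianVariety ℂ) (φ : A ⟶ A)
    {d : ℕ} (hd : 0 < d) (hφ : φ ≫ φ = -(d • 𝟙 A)) (hE2 : Module.finrank ℚ A.endAlgebra = 2)
    (h37 : eigenMultiplicity A φ (Complex.I * (Real.sqrt d : ℂ)) = 37)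
    (h52 : eigenMultiplicity A φ (-(Complex.I * (Real.sqrt d : ℂ))) = 52) (N : ℕ) :
    IsDivisorGenerated (A.powSucc N) := by
  refine AbelianVariety.isDivisorGenerated_powSucc_of_ribetType_ofCoreSmul A φ hd hφ hE2 (by omega) (by omega) ?_ N
  intro W' _ _ _ 𝔊 ι P' Q' s hbr hirr hι hιι hP' hQ' hfinP' hfinQ' hadd hsmul hsymm hPQ hdefP hdefQ hadj
  exact UnitaryThirtySevenFiftyTwo.eq_top_of_smul hbr hirr hι hιι hP' hQ' (by rw [hfinP', h37]) (by rw [hfinQ', h52]) hadd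
    hsmul hsymm hPQ hdefP hdefQ hadj

/-- The mirror: `n_{i√d}(φ) = 52`, `n_{−i√d}(φ) = 37` (core `UnitaryThirtySevenFiftyTwo.eq_top_of_smul'`).
[cite: Ribet1983, Thm. 0 and Thm. 3] [cite: Gordon1997, Thm. 6.3 (3) and Corollary] -/
theorem AbelianVariety.isDivisorGenerated_powSucc_of_ribetTypeThirtySevenFiftyTwo' (A : AbelianVariety ℂ) (φ : A ⟶ A)
    {d : ℕ} (hd : 0 < d) (hφ : φ ≫ φ = -(d • 𝟙 A)) (hE2 : Module.finrank ℚ A.endAlgebra = 2)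
    (h52 : eigenMultiplicity A φ (Complex.I * (Real.sqrt d : ℂ)) = 52)
    (h37 : eigenMultiplicity A φ (-(Complex.I * (Real.sqrt d : ℂ))) = 37) (N : ℕ) :
    IsDivisorGenerated (A.powSucc N) := by
  refine AbelianVariety.isDivisorGenerated_powSucc_of_ribetType_ofCoreSmul A φ hd hφ hE2 (by omega) (by omega) ?_ N
  intro W' _ _ _ 𝔊 ι P' Q' s hbr hirr hι hιι hP' hQ' hfinP' hfinQ' hadd hsmul hsymm hPQ hdefP hdefQ hadj
  exact UnitaryThirtySevenFiftyTwo.eq_top_of_smul' hbr hirr hι hιι hP' hQ' (by rw [hfinP', h52]) (by rw [hfinQ', h37])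
    hadd hsmul hsymm hPQ hdefP hdefQ hadj

/-- **The Hodge conjecture for all powers `A^{N+1}` of an abelian variety of Ribet type `(37, 52)` — UNCONDITIONAL.**
[cite: Ribet1983, Thm. 3] [cite: Deligne2000, §1] -/
theorem hodgeConjectureFor_powSucc_of_ribetTypeThirtySevenFiftyTwo (A : AbelianVariety ℂ) (φ : A ⟶ A)
    {d : ℕ} (hd : 0 < d) (hφ : φ ≫ φ = -(d • 𝟙 A)) (hE2 : Module.finrank ℚ A.endAlgebra = 2)
    (h37 : eigenMultiplicity A φ (Complex.I * (Real.sqrt d : ℂ)) = 37)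
    (h52 : eigenMultiplicity A φ (-(Complex.I * (Real.sqrt d : ℂ))) = 52) (N : ℕ) :
    HodgeConjectureFor (A.powSucc N).dim (A.powSucc N).X :=
  hodgeConjectureFor_of_isDivisorGenerated _
    (AbelianVariety.isDivisorGenerated_powSucc_of_ribetTypeThirtySevenFiftyTwo A φ hd hφ hE2 h37 h52 N)

/-- **89-FOLDS of signature `{37, 52}`: `B• = D•` on all powers — UNCONDITIONAL** (either eigenvalue may carry the `37`).
[cite: Ribet1983, Thm. 0 and Thm. 3] [cite: MoonenZarhin1999LowDim, §2 (2.4)] -/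
theorem AbelianVariety.isDivisorGenerated_powSucc_of_eightyninefold_thirtySevenFiftyTwo (A : AbelianVariety ℂ)
    (φ : A ⟶ A) {d : ℕ} (hd : 0 < d) (hφ : φ ≫ φ = -(d • 𝟙 A)) (hE2 : Module.finrank ℚ A.endAlgebra = 2)
    (hX : A.dim = 89)
    (h37 : eigenMultiplicity A φ (Complex.I * (Real.sqrt d : ℂ)) = 37 ∨
      eigenMultiplicity A φ (-(Complex.I * (Real.sqrt d : ℂ))) = 37)
    (N : ℕ) : IsDivisorGenerated (A.powSucc N) := by
  have hsum := eigenMultiplicity_add_eigenMultiplicity_neg_eq_dim A φ hd hφ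
  rw [hX] at hsum
  rcases h37 with h | h
  · exact AbelianVariety.isDivisorGenerated_powSucc_of_ribetTypeThirtySevenFiftyTwo A φ hd hφ hE2 h (by omega) N
  · exact AbelianVariety.isDivisorGenerated_powSucc_of_ribetTypeThirtySevenFiftyTwo' A φ hd hφ hE2 (by omega) h N

/-- **The Hodge conjecture for all powers of a 89-FOLD of signature `{37, 52}` — UNCONDITIONAL.**
[cite: Ribet1983, Thm. 3] [cite: Deligne2000, §1] -/
theorem hodgeConjectureFor_powSucc_of_eightyninefold_thirtySevenFiftyTwo (A : AbelianVariety ℂ)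
    (φ : A ⟶ A) {d : ℕ} (hd : 0 < d) (hφ : φ ≫ φ = -(d • 𝟙 A)) (hE2 : Module.finrank ℚ A.endAlgebra = 2)
    (hX : A.dim = 89)
    (h37 : eigenMultiplicity A φ (Complex.I * (Real.sqrt d : ℂ)) = 37 ∨
      eigenMultiplicity A φ (-(Complex.I * (Real.sqrt d : ℂ))) = 37)
    (N : ℕ) : HodgeConjectureFor (A.powSucc N).dim (A.powSucc N).X :=
  hodgeConjectureFor_of_isDivisorGenerated _
    (AbelianVariety.isDivisorGenerated_powSucc_of_eightyninefold_thirtySevenFiftyTwo A φ hd hφ hE2 hX h37 N)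

/-- **Ribet 1983 Thm. 3 at `(n′, n″) = (38, 51)` — UNCONDITIONAL** (core `UnitaryThirtyEightFiftyOne.eq_top_of_smul`).
[cite: Ribet1983, Thm. 0 and Thm. 3] [cite: Gordon1997, Thm. 6.3 (3) and Corollary] -/
theorem AbelianVariety.isDivisorGenerated_powSucc_of_ribetTypeThirtyEightFiftyOne (A : AbelianVariety ℂ) (φ : A ⟶ A)
    {d : ℕ} (hd : 0 < d) (hφ : φ ≫ φ = -(d • 𝟙 A)) (hE2 : Module.finrank ℚ A.endAlgebra = 2)
    (h38 : eigenMultiplicity A φ (Complex.I * (Real.sqrt d : ℂ)) = 38)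
    (h51 : eigenMultiplicity A φ (-(Complex.I * (Real.sqrt d : ℂ))) = 51) (N : ℕ) :
    IsDivisorGenerated (A.powSucc N) := by
  refine AbelianVariety.isDivisorGenerated_powSucc_of_ribetType_ofCoreSmul A φ hd hφ hE2 (by omega) (by omega) ?_ N
  intro W' _ _ _ 𝔊 ι P' Q' s hbr hirr hι hιι hP' hQ' hfinP' hfinQ' hadd hsmul hsymm hPQ hdefP hdefQ hadj
  exact UnitaryThirtyEightFiftyOne.eq_top_of_smul hbr hirr hι hιι hP' hQ' (by rw [hfinP', h38]) (by rw [hfinQ', h51]) hadd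
    hsmul hsymm hPQ hdefP hdefQ hadj

/-- The mirror: `n_{i√d}(φ) = 51`, `n_{−i√d}(φ) = 38` (core `UnitaryThirtyEightFiftyOne.eq_top_of_smul'`).
[cite: Ribet1983, Thm. 0 and Thm. 3] [cite: Gordon1997, Thm. 6.3 (3) and Corollary] -/
theorem AbelianVariety.isDivisorGenerated_powSucc_of_ribetTypeThirtyEightFiftyOne' (A : AbelianVariety ℂ) (φ : A ⟶ A)
    {d : ℕ} (hd : 0 < d) (hφ : φ ≫ φ = -(d • 𝟙 A)) (hE2 : Module.finrank ℚ A.endAlgebra = 2)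
    (h51 : eigenMultiplicity A φ (Complex.I * (Real.sqrt d : ℂ)) = 51)
    (h38 : eigenMultiplicity A φ (-(Complex.I * (Real.sqrt d : ℂ))) = 38) (N : ℕ) :
    IsDivisorGenerated (A.powSucc N) := by
  refine AbelianVariety.isDivisorGenerated_powSucc_of_ribetType_ofCoreSmul A φ hd hφ hE2 (by omega) (by omega) ?_ N
  intro W' _ _ _ 𝔊 ι P' Q' s hbr hirr hι hιι hP' hQ' hfinP' hfinQ' hadd hsmul hsymm hPQ hdefP hdefQ hadj
  exact UnitaryThirtyEightFiftyOne.eq_top_of_smul' hbr hirr hι hιι hP' hQ' (by rw [hfinP', h51]) (by rw [hfinQ', h38])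
    hadd hsmul hsymm hPQ hdefP hdefQ hadj

/-- **The Hodge conjecture for all powers `A^{N+1}` of an abelian variety of Ribet type `(38, 51)` — UNCONDITIONAL.**
[cite: Ribet1983, Thm. 3] [cite: Deligne2000, §1] -/
theorem hodgeConjectureFor_powSucc_of_ribetTypeThirtyEightFiftyOne (A : AbelianVariety ℂ) (φ : A ⟶ A)
    {d : ℕ} (hd : 0 < d) (hφ : φ ≫ φ = -(d • 𝟙 A)) (hE2 : Module.finrank ℚ A.endAlgebra = 2)
    (h38 : eigenMultiplicity A φ (Complex.I * (Real.sqrt d : ℂ)) = 38)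
    (h51 : eigenMultiplicity A φ (-(Complex.I * (Real.sqrt d : ℂ))) = 51) (N : ℕ) :
    HodgeConjectureFor (A.powSucc N).dim (A.powSucc N).X :=
  hodgeConjectureFor_of_isDivisorGenerated _
    (AbelianVariety.isDivisorGenerated_powSucc_of_ribetTypeThirtyEightFiftyOne A φ hd hφ hE2 h38 h51 N)

/-- **89-FOLDS of signature `{38, 51}`: `B• = D•` on all powers — UNCONDITIONAL** (either eigenvalue may carry the `38`).
[cite: Ribet1983, Thm. 0 and Thm. 3] [cite: MoonenZarhin1999LowDim, §2 (2.4)] -/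
theorem AbelianVariety.isDivisorGenerated_powSucc_of_eightyninefold_thirtyEightFiftyOne (A : AbelianVariety ℂ)
    (φ : A ⟶ A) {d : ℕ} (hd : 0 < d) (hφ : φ ≫ φ = -(d • 𝟙 A)) (hE2 : Module.finrank ℚ A.endAlgebra = 2)
    (hX : A.dim = 89)
    (h38 : eigenMultiplicity A φ (Complex.I * (Real.sqrt d : ℂ)) = 38 ∨
      eigenMultiplicity A φ (-(Complex.I * (Real.sqrt d : ℂ))) = 38)
    (N : ℕ) : IsDivisorGenerated (A.powSucc N) := by
  have hsum := eigenMultiplicity_add_eigenMultiplicity_neg_eq_dim A φ hd hφ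
  rw [hX] at hsum
  rcases h38 with h | h
  · exact AbelianVariety.isDivisorGenerated_powSucc_of_ribetTypeThirtyEightFiftyOne A φ hd hφ hE2 h (by omega) N
  · exact AbelianVariety.isDivisorGenerated_powSucc_of_ribetTypeThirtyEightFiftyOne' A φ hd hφ hE2 (by omega) h N

/-- **The Hodge conjecture for all powers of a 89-FOLD of signature `{38, 51}` — UNCONDITIONAL.**
[cite: Ribet1983, Thm. 3] [cite: Deligne2000, §1] -/
theorem hodgeConjectureFor_powSucc_of_eightyninefold_thirtyEightFiftyOne (A : AbelianVariety ℂ)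
    (φ : A ⟶ A) {d : ℕ} (hd : 0 < d) (hφ : φ ≫ φ = -(d • 𝟙 A)) (hE2 : Module.finrank ℚ A.endAlgebra = 2)
    (hX : A.dim = 89)
    (h38 : eigenMultiplicity A φ (Complex.I * (Real.sqrt d : ℂ)) = 38 ∨
      eigenMultiplicity A φ (-(Complex.I * (Real.sqrt d : ℂ))) = 38)
    (N : ℕ) : HodgeConjectureFor (A.powSucc N).dim (A.powSucc N).X :=
  hodgeConjectureFor_of_isDivisorGenerated _
    (AbelianVariety.isDivisorGenerated_powSucc_of_eightyninefold_thirtyEightFiftyOne A φ hd hφ hE2 hX h38 N)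

/-- **Ribet 1983 Thm. 3 at `(n′, n″) = (39, 50)` — UNCONDITIONAL** (core `UnitaryThirtyNineFifty.eq_top_of_smul`).
[cite: Ribet1983, Thm. 0 and Thm. 3] [cite: Gordon1997, Thm. 6.3 (3) and Corollary] -/
theorem AbelianVariety.isDivisorGenerated_powSucc_of_ribetTypeThirtyNineFifty (A : AbelianVariety ℂ) (φ : A ⟶ A)
    {d : ℕ} (hd : 0 < d) (hφ : φ ≫ φ = -(d • 𝟙 A)) (hE2 : Module.finrank ℚ A.endAlgebra = 2)
    (h39 : eigenMultiplicity A φ (Complex.I * (Real.sqrt d : ℂ)) = 39)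
    (h50 : eigenMultiplicity A φ (-(Complex.I * (Real.sqrt d : ℂ))) = 50) (N : ℕ) :
    IsDivisorGenerated (A.powSucc N) := by
  refine AbelianVariety.isDivisorGenerated_powSucc_of_ribetType_ofCoreSmul A φ hd hφ hE2 (by omega) (by omega) ?_ N
  intro W' _ _ _ 𝔊 ι P' Q' s hbr hirr hι hιι hP' hQ' hfinP' hfinQ' hadd hsmul hsymm hPQ hdefP hdefQ hadj
  exact UnitaryThirtyNineFifty.eq_top_of_smul hbr hirr hι hιι hP' hQ' (by rw [hfinP', h39]) (by rw [hfinQ', h50]) hadd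
    hsmul hsymm hPQ hdefP hdefQ hadj

/-- The mirror: `n_{i√d}(φ) = 50`, `n_{−i√d}(φ) = 39` (core `UnitaryThirtyNineFifty.eq_top_of_smul'`).
[cite: Ribet1983, Thm. 0 and Thm. 3] [cite: Gordon1997, Thm. 6.3 (3) and Corollary] -/
theorem AbelianVariety.isDivisorGenerated_powSucc_of_ribetTypeThirtyNineFifty' (A : AbelianVariety ℂ) (φ : A ⟶ A)
    {d : ℕ} (hd : 0 < d) (hφ : φ ≫ φ = -(d • 𝟙 A)) (hE2 : Module.finrank ℚ A.endAlgebra = 2)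
    (h50 : eigenMultiplicity A φ (Complex.I * (Real.sqrt d : ℂ)) = 50)
    (h39 : eigenMultiplicity A φ (-(Complex.I * (Real.sqrt d : ℂ))) = 39) (N : ℕ) :
    IsDivisorGenerated (A.powSucc N) := by
  refine AbelianVariety.isDivisorGenerated_powSucc_of_ribetType_ofCoreSmul A φ hd hφ hE2 (by omega) (by omega) ?_ N
  intro W' _ _ _ 𝔊 ι P' Q' s hbr hirr hι hιι hP' hQ' hfinP' hfinQ' hadd hsmul hsymm hPQ hdefP hdefQ hadj
  exact UnitaryThirtyNineFifty.eq_top_of_smul' hbr hirr hι hιι hP' hQ' (by rw [hfinP', h50]) (by rw [hfinQ', h39])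
    hadd hsmul hsymm hPQ hdefP hdefQ hadj

/-- **The Hodge conjecture for all powers `A^{N+1}` of an abelian variety of Ribet type `(39, 50)` — UNCONDITIONAL.**
[cite: Ribet1983, Thm. 3] [cite: Deligne2000, §1] -/
theorem hodgeConjectureFor_powSucc_of_ribetTypeThirtyNineFifty (A : AbelianVariety ℂ) (φ : A ⟶ A)
    {d : ℕ} (hd : 0 < d) (hφ : φ ≫ φ = -(d • 𝟙 A)) (hE2 : Module.finrank ℚ A.endAlgebra = 2)
    (h39 : eigenMultiplicity A φ (Complex.I * (Real.sqrt d : ℂ)) = 39)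
    (h50 : eigenMultiplicity A φ (-(Complex.I * (Real.sqrt d : ℂ))) = 50) (N : ℕ) :
    HodgeConjectureFor (A.powSucc N).dim (A.powSucc N).X :=
  hodgeConjectureFor_of_isDivisorGenerated _
    (AbelianVariety.isDivisorGenerated_powSucc_of_ribetTypeThirtyNineFifty A φ hd hφ hE2 h39 h50 N)

/-- **89-FOLDS of signature `{39, 50}`: `B• = D•` on all powers — UNCONDITIONAL** (either eigenvalue may carry the `39`).
[cite: Ribet1983, Thm. 0 and Thm. 3] [cite: MoonenZarhin1999LowDim, §2 (2.4)] -/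
theorem AbelianVariety.isDivisorGenerated_powSucc_of_eightyninefold_thirtyNineFifty (A : AbelianVariety ℂ)
    (φ : A ⟶ A) {d : ℕ} (hd : 0 < d) (hφ : φ ≫ φ = -(d • 𝟙 A)) (hE2 : Module.finrank ℚ A.endAlgebra = 2)
    (hX : A.dim = 89)
    (h39 : eigenMultiplicity A φ (Complex.I * (Real.sqrt d : ℂ)) = 39 ∨
      eigenMultiplicity A φ (-(Complex.I * (Real.sqrt d : ℂ))) = 39)
    (N : ℕ) : IsDivisorGenerated (A.powSucc N) := by
  have hsum := eigenMultiplicity_add_eigenMultiplicity_neg_eq_dim A φ hd hφ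
  rw [hX] at hsum
  rcases h39 with h | h
  · exact AbelianVariety.isDivisorGenerated_powSucc_of_ribetTypeThirtyNineFifty A φ hd hφ hE2 h (by omega) N
  · exact AbelianVariety.isDivisorGenerated_powSucc_of_ribetTypeThirtyNineFifty' A φ hd hφ hE2 (by omega) h N

/-- **The Hodge conjecture for all powers of a 89-FOLD of signature `{39, 50}` — UNCONDITIONAL.**
[cite: Ribet1983, Thm. 3] [cite: Deligne2000, §1] -/
theorem hodgeConjectureFor_powSucc_of_eightyninefold_thirtyNineFifty (A : AbelianVariety ℂ)
    (φ : A ⟶ A) {d : ℕ} (hd : 0 < d) (hφ : φ ≫ φ = -(d • 𝟙 A)) (hE2 : Module.finrank ℚ A.endAlgebra = 2)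
    (hX : A.dim = 89)
    (h39 : eigenMultiplicity A φ (Complex.I * (Real.sqrt d : ℂ)) = 39 ∨
      eigenMultiplicity A φ (-(Complex.I * (Real.sqrt d : ℂ))) = 39)
    (N : ℕ) : HodgeConjectureFor (A.powSucc N).dim (A.powSucc N).X :=
  hodgeConjectureFor_of_isDivisorGenerated _
    (AbelianVariety.isDivisorGenerated_powSucc_of_eightyninefold_thirtyNineFifty A φ hd hφ hE2 hX h39 N)

/-- **Ribet 1983 Thm. 3 at `(n′, n″) = (40, 49)` — UNCONDITIONAL** (core `UnitaryFortyFortyNine.eq_top_of_smul`).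
[cite: Ribet1983, Thm. 0 and Thm. 3] [cite: Gordon1997, Thm. 6.3 (3) and Corollary] -/
theorem AbelianVariety.isDivisorGenerated_powSucc_of_ribetTypeFortyFortyNine (A : AbelianVariety ℂ) (φ : A ⟶ A)
    {d : ℕ} (hd : 0 < d) (hφ : φ ≫ φ = -(d • 𝟙 A)) (hE2 : Module.finrank ℚ A.endAlgebra = 2)
    (h40 : eigenMultiplicity A φ (Complex.I * (Real.sqrt d : ℂ)) = 40)
    (h49 : eigenMultiplicity A φ (-(Complex.I * (Real.sqrt d : ℂ))) = 49) (N : ℕ) :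
    IsDivisorGenerated (A.powSucc N) := by
  refine AbelianVariety.isDivisorGenerated_powSucc_of_ribetType_ofCoreSmul A φ hd hφ hE2 (by omega) (by omega) ?_ N
  intro W' _ _ _ 𝔊 ι P' Q' s hbr hirr hι hιι hP' hQ' hfinP' hfinQ' hadd hsmul hsymm hPQ hdefP hdefQ hadj
  exact UnitaryFortyFortyNine.eq_top_of_smul hbr hirr hι hιι hP' hQ' (by rw [hfinP', h40]) (by rw [hfinQ', h49]) hadd
    hsmul hsymm hPQ hdefP hdefQ hadj

/-- The mirror: `n_{i√d}(φ) = 49`, `n_{−i√d}(φ) = 40` (core `UnitaryFortyFortyNine.eq_top_of_smul'`).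
[cite: Ribet1983, Thm. 0 and Thm. 3] [cite: Gordon1997, Thm. 6.3 (3) and Corollary] -/
theorem AbelianVariety.isDivisorGenerated_powSucc_of_ribetTypeFortyFortyNine' (A : AbelianVariety ℂ) (φ : A ⟶ A)
    {d : ℕ} (hd : 0 < d) (hφ : φ ≫ φ = -(d • 𝟙 A)) (hE2 : Module.finrank ℚ A.endAlgebra = 2)
    (h49 : eigenMultiplicity A φ (Complex.I * (Real.sqrt d : ℂ)) = 49)
    (h40 : eigenMultiplicity A φ (-(Complex.I * (Real.sqrt d : ℂ))) = 40) (N : ℕ) :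
    IsDivisorGenerated (A.powSucc N) := by
  refine AbelianVariety.isDivisorGenerated_powSucc_of_ribetType_ofCoreSmul A φ hd hφ hE2 (by omega) (by omega) ?_ N
  intro W' _ _ _ 𝔊 ι P' Q' s hbr hirr hι hιι hP' hQ' hfinP' hfinQ' hadd hsmul hsymm hPQ hdefP hdefQ hadj
  exact UnitaryFortyFortyNine.eq_top_of_smul' hbr hirr hι hιι hP' hQ' (by rw [hfinP', h49]) (by rw [hfinQ', h40])
    hadd hsmul hsymm hPQ hdefP hdefQ hadj

/-- **The Hodge conjecture for all powers `A^{N+1}` of an abelian variety of Ribet type `(40, 49)` — UNCONDITIONAL.**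
[cite: Ribet1983, Thm. 3] [cite: Deligne2000, §1] -/
theorem hodgeConjectureFor_powSucc_of_ribetTypeFortyFortyNine (A : AbelianVariety ℂ) (φ : A ⟶ A)
    {d : ℕ} (hd : 0 < d) (hφ : φ ≫ φ = -(d • 𝟙 A)) (hE2 : Module.finrank ℚ A.endAlgebra = 2)
    (h40 : eigenMultiplicity A φ (Complex.I * (Real.sqrt d : ℂ)) = 40)
    (h49 : eigenMultiplicity A φ (-(Complex.I * (Real.sqrt d : ℂ))) = 49) (N : ℕ) :
    HodgeConjectureFor (A.powSucc N).dim (A.powSucc N).X :=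
  hodgeConjectureFor_of_isDivisorGenerated _
    (AbelianVariety.isDivisorGenerated_powSucc_of_ribetTypeFortyFortyNine A φ hd hφ hE2 h40 h49 N)

/-- **89-FOLDS of signature `{40, 49}`: `B• = D•` on all powers — UNCONDITIONAL** (either eigenvalue may carry the `40`).
[cite: Ribet1983, Thm. 0 and Thm. 3] [cite: MoonenZarhin1999LowDim, §2 (2.4)] -/
theorem AbelianVariety.isDivisorGenerated_powSucc_of_eightyninefold_fortyFortyNine (A : AbelianVariety ℂ)
    (φ : A ⟶ A) {d : ℕ} (hd : 0 < d) (hφ : φ ≫ φ = -(d • 𝟙 A)) (hE2 : Module.finrank ℚ A.endAlgebra = 2)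
    (hX : A.dim = 89)
    (h40 : eigenMultiplicity A φ (Complex.I * (Real.sqrt d : ℂ)) = 40 ∨
      eigenMultiplicity A φ (-(Complex.I * (Real.sqrt d : ℂ))) = 40)
    (N : ℕ) : IsDivisorGenerated (A.powSucc N) := by
  have hsum := eigenMultiplicity_add_eigenMultiplicity_neg_eq_dim A φ hd hφ
  rw [hX] at hsum
  rcases h40 with h | h
  · exact AbelianVariety.isDivisorGenerated_powSucc_of_ribetTypeFortyFortyNine A φ hd hφ hE2 h (by omega) N
  · exact AbelianVariety.isDivisorGenerated_powSucc_of_ribetTypeFortyFortyNine' A φ hd hφ hE2 (by omega) h N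

/-- **The Hodge conjecture for all powers of a 89-FOLD of signature `{40, 49}` — UNCONDITIONAL.**
[cite: Ribet1983, Thm. 3] [cite: Deligne2000, §1] -/
theorem hodgeConjectureFor_powSucc_of_eightyninefold_fortyFortyNine (A : AbelianVariety ℂ)
    (φ : A ⟶ A) {d : ℕ} (hd : 0 < d) (hφ : φ ≫ φ = -(d • 𝟙 A)) (hE2 : Module.finrank ℚ A.endAlgebra = 2)
    (hX : A.dim = 89)
    (h40 : eigenMultiplicity A φ (Complex.I * (Real.sqrt d : ℂ)) = 40 ∨
      eigenMultiplicity A φ (-(Complex.I * (Real.sqrt d : ℂ))) = 40)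
    (N : ℕ) : HodgeConjectureFor (A.powSucc N).dim (A.powSucc N).X :=
  hodgeConjectureFor_of_isDivisorGenerated _
    (AbelianVariety.isDivisorGenerated_powSucc_of_eightyninefold_fortyFortyNine A φ hd hφ hE2 hX h40 N)

/-- **Ribet 1983 Thm. 3 at `(n′, n″) = (41, 48)` — UNCONDITIONAL** (core `UnitaryFortyOneFortyEight.eq_top_of_smul`).
[cite: Ribet1983, Thm. 0 and Thm. 3] [cite: Gordon1997, Thm. 6.3 (3) and Corollary] -/
theorem AbelianVariety.isDivisorGenerated_powSucc_of_ribetTypeFortyOneFortyEight (A : AbelianVariety ℂ) (φ : A ⟶ A)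
    {d : ℕ} (hd : 0 < d) (hφ : φ ≫ φ = -(d • 𝟙 A)) (hE2 : Module.finrank ℚ A.endAlgebra = 2)
    (h41 : eigenMultiplicity A φ (Complex.I * (Real.sqrt d : ℂ)) = 41)
    (h48 : eigenMultiplicity A φ (-(Complex.I * (Real.sqrt d : ℂ))) = 48) (N : ℕ) :
    IsDivisorGenerated (A.powSucc N) := by
  refine AbelianVariety.isDivisorGenerated_powSucc_of_ribetType_ofCoreSmul A φ hd hφ hE2 (by omega) (by omega) ?_ N
  intro W' _ _ _ 𝔊 ι P' Q' s hbr hirr hι hιι hP' hQ' hfinP' hfinQ' hadd hsmul hsymm hPQ hdefP hdefQ hadj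
  exact UnitaryFortyOneFortyEight.eq_top_of_smul hbr hirr hι hιι hP' hQ' (by rw [hfinP', h41]) (by rw [hfinQ', h48]) hadd
    hsmul hsymm hPQ hdefP hdefQ hadj

/-- The mirror: `n_{i√d}(φ) = 48`, `n_{−i√d}(φ) = 41` (core `UnitaryFortyOneFortyEight.eq_top_of_smul'`).
[cite: Ribet1983, Thm. 0 and Thm. 3] [cite: Gordon1997, Thm. 6.3 (3) and Corollary] -/
theorem AbelianVariety.isDivisorGenerated_powSucc_of_ribetTypeFortyOneFortyEight' (A : AbelianVariety ℂ) (φ : A ⟶ A)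
    {d : ℕ} (hd : 0 < d) (hφ : φ ≫ φ = -(d • 𝟙 A)) (hE2 : Module.finrank ℚ A.endAlgebra = 2)
    (h48 : eigenMultiplicity A φ (Complex.I * (Real.sqrt d : ℂ)) = 48)
    (h41 : eigenMultiplicity A φ (-(Complex.I * (Real.sqrt d : ℂ))) = 41) (N : ℕ) :
    IsDivisorGenerated (A.powSucc N) := by
  refine AbelianVariety.isDivisorGenerated_powSucc_of_ribetType_ofCoreSmul A φ hd hφ hE2 (by omega) (by omega) ?_ N
  intro W' _ _ _ 𝔊 ι P' Q' s hbr hirr hι hιι hP' hQ' hfinP' hfinQ' hadd hsmul hsymm hPQ hdefP hdefQ hadj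
  exact UnitaryFortyOneFortyEight.eq_top_of_smul' hbr hirr hι hιι hP' hQ' (by rw [hfinP', h48]) (by rw [hfinQ', h41])
    hadd hsmul hsymm hPQ hdefP hdefQ hadj

/-- **The Hodge conjecture for all powers `A^{N+1}` of an abelian variety of Ribet type `(41, 48)` — UNCONDITIONAL.**
[cite: Ribet1983, Thm. 3] [cite: Deligne2000, §1] -/
theorem hodgeConjectureFor_powSucc_of_ribetTypeFortyOneFortyEight (A : AbelianVariety ℂ) (φ : A ⟶ A)
    {d : ℕ} (hd : 0 < d) (hφ : φ ≫ φ = -(d • 𝟙 A)) (hE2 : Module.finrank ℚ A.endAlgebra = 2)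
    (h41 : eigenMultiplicity A φ (Complex.I * (Real.sqrt d : ℂ)) = 41)
    (h48 : eigenMultiplicity A φ (-(Complex.I * (Real.sqrt d : ℂ))) = 48) (N : ℕ) :
    HodgeConjectureFor (A.powSucc N).dim (A.powSucc N).X :=
  hodgeConjectureFor_of_isDivisorGenerated _
    (AbelianVariety.isDivisorGenerated_powSucc_of_ribetTypeFortyOneFortyEight A φ hd hφ hE2 h41 h48 N)

/-- **89-FOLDS of signature `{41, 48}`: `B• = D•` on all powers — UNCONDITIONAL** (either eigenvalue may carry the `41`).
[cite: Ribet1983, Thm. 0 and Thm. 3] [cite: MoonenZarhin1999LowDim, §2 (2.4)] -/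
theorem AbelianVariety.isDivisorGenerated_powSucc_of_eightyninefold_fortyOneFortyEight (A : AbelianVariety ℂ)
    (φ : A ⟶ A) {d : ℕ} (hd : 0 < d) (hφ : φ ≫ φ = -(d • 𝟙 A)) (hE2 : Module.finrank ℚ A.endAlgebra = 2)
    (hX : A.dim = 89)
    (h41 : eigenMultiplicity A φ (Complex.I * (Real.sqrt d : ℂ)) = 41 ∨
      eigenMultiplicity A φ (-(Complex.I * (Real.sqrt d : ℂ))) = 41)
    (N : ℕ) : IsDivisorGenerated (A.powSucc N) := by
  have hsum := eigenMultiplicity_add_eigenMultiplicity_neg_eq_dim A φ hd hφ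
  rw [hX] at hsum
  rcases h41 with h | h
  · exact AbelianVariety.isDivisorGenerated_powSucc_of_ribetTypeFortyOneFortyEight A φ hd hφ hE2 h (by omega) N
  · exact AbelianVariety.isDivisorGenerated_powSucc_of_ribetTypeFortyOneFortyEight' A φ hd hφ hE2 (by omega) h N

/-- **The Hodge conjecture for all powers of a 89-FOLD of signature `{41, 48}` — UNCONDITIONAL.**
[cite: Ribet1983, Thm. 3] [cite: Deligne2000, §1] -/
theorem hodgeConjectureFor_powSucc_of_eightyninefold_fortyOneFortyEight (A : AbelianVariety ℂ)
    (φ : A ⟶ A) {d : ℕ} (hd : 0 < d) (hφ : φ ≫ φ = -(d • 𝟙 A)) (hE2 : Module.finrank ℚ A.endAlgebra = 2)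
    (hX : A.dim = 89)
    (h41 : eigenMultiplicity A φ (Complex.I * (Real.sqrt d : ℂ)) = 41 ∨
      eigenMultiplicity A φ (-(Complex.I * (Real.sqrt d : ℂ))) = 41)
    (N : ℕ) : HodgeConjectureFor (A.powSucc N).dim (A.powSucc N).X :=
  hodgeConjectureFor_of_isDivisorGenerated _
    (AbelianVariety.isDivisorGenerated_powSucc_of_eightyninefold_fortyOneFortyEight A φ hd hφ hE2 hX h41 N)

/-- **Ribet 1983 Thm. 3 at `(n′, n″) = (43, 46)` — UNCONDITIONAL** (core `UnitaryFortyThreeFortySix.eq_top_of_smul`).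
[cite: Ribet1983, Thm. 0 and Thm. 3] [cite: Gordon1997, Thm. 6.3 (3) and Corollary] -/
theorem AbelianVariety.isDivisorGenerated_powSucc_of_ribetTypeFortyThreeFortySix (A : AbelianVariety ℂ) (φ : A ⟶ A)
    {d : ℕ} (hd : 0 < d) (hφ : φ ≫ φ = -(d • 𝟙 A)) (hE2 : Module.finrank ℚ A.endAlgebra = 2)
    (h43 : eigenMultiplicity A φ (Complex.I * (Real.sqrt d : ℂ)) = 43)
    (h46 : eigenMultiplicity A φ (-(Complex.I * (Real.sqrt d : ℂ))) = 46) (N : ℕ) :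
    IsDivisorGenerated (A.powSucc N) := by
  refine AbelianVariety.isDivisorGenerated_powSucc_of_ribetType_ofCoreSmul A φ hd hφ hE2 (by omega) (by omega) ?_ N
  intro W' _ _ _ 𝔊 ι P' Q' s hbr hirr hι hιι hP' hQ' hfinP' hfinQ' hadd hsmul hsymm hPQ hdefP hdefQ hadj
  exact UnitaryFortyThreeFortySix.eq_top_of_smul hbr hirr hι hιι hP' hQ' (by rw [hfinP', h43]) (by rw [hfinQ', h46]) hadd
    hsmul hsymm hPQ hdefP hdefQ hadj

/-- The mirror: `n_{i√d}(φ) = 46`, `n_{−i√d}(φ) = 43` (core `UnitaryFortyThreeFortySix.eq_top_of_smul'`).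
[cite: Ribet1983, Thm. 0 and Thm. 3] [cite: Gordon1997, Thm. 6.3 (3) and Corollary] -/
theorem AbelianVariety.isDivisorGenerated_powSucc_of_ribetTypeFortyThreeFortySix' (A : AbelianVariety ℂ) (φ : A ⟶ A)
    {d : ℕ} (hd : 0 < d) (hφ : φ ≫ φ = -(d • 𝟙 A)) (hE2 : Module.finrank ℚ A.endAlgebra = 2)
    (h46 : eigenMultiplicity A φ (Complex.I * (Real.sqrt d : ℂ)) = 46)
    (h43 : eigenMultiplicity A φ (-(Complex.I * (Real.sqrt d : ℂ))) = 43) (N : ℕ) :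
    IsDivisorGenerated (A.powSucc N) := by
  refine AbelianVariety.isDivisorGenerated_powSucc_of_ribetType_ofCoreSmul A φ hd hφ hE2 (by omega) (by omega) ?_ N
  intro W' _ _ _ 𝔊 ι P' Q' s hbr hirr hι hιι hP' hQ' hfinP' hfinQ' hadd hsmul hsymm hPQ hdefP hdefQ hadj
  exact UnitaryFortyThreeFortySix.eq_top_of_smul' hbr hirr hι hιι hP' hQ' (by rw [hfinP', h46]) (by rw [hfinQ', h43])
    hadd hsmul hsymm hPQ hdefP hdefQ hadj

/-- **The Hodge conjecture for all powers `A^{N+1}` of an abelian variety of Ribet type `(43, 46)` — UNCONDITIONAL.**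
[cite: Ribet1983, Thm. 3] [cite: Deligne2000, §1] -/
theorem hodgeConjectureFor_powSucc_of_ribetTypeFortyThreeFortySix (A : AbelianVariety ℂ) (φ : A ⟶ A)
    {d : ℕ} (hd : 0 < d) (hφ : φ ≫ φ = -(d • 𝟙 A)) (hE2 : Module.finrank ℚ A.endAlgebra = 2)
    (h43 : eigenMultiplicity A φ (Complex.I * (Real.sqrt d : ℂ)) = 43)
    (h46 : eigenMultiplicity A φ (-(Complex.I * (Real.sqrt d : ℂ))) = 46) (N : ℕ) :
    HodgeConjectureFor (A.powSucc N).dim (A.powSucc N).X :=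
  hodgeConjectureFor_of_isDivisorGenerated _
    (AbelianVariety.isDivisorGenerated_powSucc_of_ribetTypeFortyThreeFortySix A φ hd hφ hE2 h43 h46 N)

/-- **89-FOLDS of signature `{43, 46}`: `B• = D•` on all powers — UNCONDITIONAL** (either eigenvalue may carry the `43`).
[cite: Ribet1983, Thm. 0 and Thm. 3] [cite: MoonenZarhin1999LowDim, §2 (2.4)] -/
theorem AbelianVariety.isDivisorGenerated_powSucc_of_eightyninefold_fortyThreeFortySix (A : AbelianVariety ℂ)
    (φ : A ⟶ A) {d : ℕ} (hd : 0 < d) (hφ : φ ≫ φ = -(d • 𝟙 A)) (hE2 : Module.finrank ℚ A.endAlgebra = 2)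
    (hX : A.dim = 89)
    (h43 : eigenMultiplicity A φ (Complex.I * (Real.sqrt d : ℂ)) = 43 ∨
      eigenMultiplicity A φ (-(Complex.I * (Real.sqrt d : ℂ))) = 43)
    (N : ℕ) : IsDivisorGenerated (A.powSucc N) := by
  have hsum := eigenMultiplicity_add_eigenMultiplicity_neg_eq_dim A φ hd hφ
  rw [hX] at hsum
  rcases h43 with h | h
  · exact AbelianVariety.isDivisorGenerated_powSucc_of_ribetTypeFortyThreeFortySix A φ hd hφ hE2 h (by omega) N
  · exact AbelianVariety.isDivisorGenerated_powSucc_of_ribetTypeFortyThreeFortySix' A φ hd hφ hE2 (by omega) h N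

/-- **The Hodge conjecture for all powers of a 89-FOLD of signature `{43, 46}` — UNCONDITIONAL.**
[cite: Ribet1983, Thm. 3] [cite: Deligne2000, §1] -/
theorem hodgeConjectureFor_powSucc_of_eightyninefold_fortyThreeFortySix (A : AbelianVariety ℂ)
    (φ : A ⟶ A) {d : ℕ} (hd : 0 < d) (hφ : φ ≫ φ = -(d • 𝟙 A)) (hE2 : Module.finrank ℚ A.endAlgebra = 2)
    (hX : A.dim = 89)
    (h43 : eigenMultiplicity A φ (Complex.I * (Real.sqrt d : ℂ)) = 43 ∨
      eigenMultiplicity A φ (-(Complex.I * (Real.sqrt d : ℂ))) = 43)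
    (N : ℕ) : HodgeConjectureFor (A.powSucc N).dim (A.powSucc N).X :=
  hodgeConjectureFor_of_isDivisorGenerated _
    (AbelianVariety.isDivisorGenerated_powSucc_of_eightyninefold_fortyThreeFortySix A φ hd hφ hE2 hX h43 N)

/-- **Ribet 1983 Thm. 3 at `(n′, n″) = (44, 45)` — UNCONDITIONAL** (core `UnitaryFortyFourFortyFive.eq_top_of_smul`).
[cite: Ribet1983, Thm. 0 and Thm. 3] [cite: Gordon1997, Thm. 6.3 (3) and Corollary] -/
theorem AbelianVariety.isDivisorGenerated_powSucc_of_ribetTypeFortyFourFortyFive (A : AbelianVariety ℂ) (φ : A ⟶ A)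
    {d : ℕ} (hd : 0 < d) (hφ : φ ≫ φ = -(d • 𝟙 A)) (hE2 : Module.finrank ℚ A.endAlgebra = 2)
    (h44 : eigenMultiplicity A φ (Complex.I * (Real.sqrt d : ℂ)) = 44)
    (h45 : eigenMultiplicity A φ (-(Complex.I * (Real.sqrt d : ℂ))) = 45) (N : ℕ) :
    IsDivisorGenerated (A.powSucc N) := by
  refine AbelianVariety.isDivisorGenerated_powSucc_of_ribetType_ofCoreSmul A φ hd hφ hE2 (by omega) (by omega) ?_ N
  intro W' _ _ _ 𝔊 ι P' Q' s hbr hirr hι hιι hP' hQ' hfinP' hfinQ' hadd hsmul hsymm hPQ hdefP hdefQ hadj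
  exact UnitaryFortyFourFortyFive.eq_top_of_smul hbr hirr hι hιι hP' hQ' (by rw [hfinP', h44]) (by rw [hfinQ', h45]) hadd
    hsmul hsymm hPQ hdefP hdefQ hadj

/-- The mirror: `n_{i√d}(φ) = 45`, `n_{−i√d}(φ) = 44` (core `UnitaryFortyFourFortyFive.eq_top_of_smul'`).
[cite: Ribet1983, Thm. 0 and Thm. 3] [cite: Gordon1997, Thm. 6.3 (3) and Corollary] -/
theorem AbelianVariety.isDivisorGenerated_powSucc_of_ribetTypeFortyFourFortyFive' (A : AbelianVariety ℂ) (φ : A ⟶ A)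
    {d : ℕ} (hd : 0 < d) (hφ : φ ≫ φ = -(d • 𝟙 A)) (hE2 : Module.finrank ℚ A.endAlgebra = 2)
    (h45 : eigenMultiplicity A φ (Complex.I * (Real.sqrt d : ℂ)) = 45)
    (h44 : eigenMultiplicity A φ (-(Complex.I * (Real.sqrt d : ℂ))) = 44) (N : ℕ) :
    IsDivisorGenerated (A.powSucc N) := by
  refine AbelianVariety.isDivisorGenerated_powSucc_of_ribetType_ofCoreSmul A φ hd hφ hE2 (by omega) (by omega) ?_ N
  intro W' _ _ _ 𝔊 ι P' Q' s hbr hirr hι hιι hP' hQ' hfinP' hfinQ' hadd hsmul hsymm hPQ hdefP hdefQ hadj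
  exact UnitaryFortyFourFortyFive.eq_top_of_smul' hbr hirr hι hιι hP' hQ' (by rw [hfinP', h45]) (by rw [hfinQ', h44])
    hadd hsmul hsymm hPQ hdefP hdefQ hadj

/-- **The Hodge conjecture for all powers `A^{N+1}` of an abelian variety of Ribet type `(44, 45)` — UNCONDITIONAL.**
[cite: Ribet1983, Thm. 3] [cite: Deligne2000, §1] -/
theorem hodgeConjectureFor_powSucc_of_ribetTypeFortyFourFortyFive (A : AbelianVariety ℂ) (φ : A ⟶ A)
    {d : ℕ} (hd : 0 < d) (hφ : φ ≫ φ = -(d • 𝟙 A)) (hE2 : Module.finrank ℚ A.endAlgebra = 2)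
    (h44 : eigenMultiplicity A φ (Complex.I * (Real.sqrt d : ℂ)) = 44)
    (h45 : eigenMultiplicity A φ (-(Complex.I * (Real.sqrt d : ℂ))) = 45) (N : ℕ) :
    HodgeConjectureFor (A.powSucc N).dim (A.powSucc N).X :=
  hodgeConjectureFor_of_isDivisorGenerated _
    (AbelianVariety.isDivisorGenerated_powSucc_of_ribetTypeFortyFourFortyFive A φ hd hφ hE2 h44 h45 N)

/-- **89-FOLDS of signature `{44, 45}`: `B• = D•` on all powers — UNCONDITIONAL** (either eigenvalue may carry the `44`).
[cite: Ribet1983, Thm. 0 and Thm. 3] [cite: MoonenZarhin1999LowDim, §2 (2.4)] -/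
theorem AbelianVariety.isDivisorGenerated_powSucc_of_eightyninefold_fortyFourFortyFive (A : AbelianVariety ℂ)
    (φ : A ⟶ A) {d : ℕ} (hd : 0 < d) (hφ : φ ≫ φ = -(d • 𝟙 A)) (hE2 : Module.finrank ℚ A.endAlgebra = 2)
    (hX : A.dim = 89)
    (h44 : eigenMultiplicity A φ (Complex.I * (Real.sqrt d : ℂ)) = 44 ∨
      eigenMultiplicity A φ (-(Complex.I * (Real.sqrt d : ℂ))) = 44)
    (N : ℕ) : IsDivisorGenerated (A.powSucc N) := by
  have hsum := eigenMultiplicity_add_eigenMultiplicity_neg_eq_dim A φ hd hφ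
  rw [hX] at hsum
  rcases h44 with h | h
  · exact AbelianVariety.isDivisorGenerated_powSucc_of_ribetTypeFortyFourFortyFive A φ hd hφ hE2 h (by omega) N
  · exact AbelianVariety.isDivisorGenerated_powSucc_of_ribetTypeFortyFourFortyFive' A φ hd hφ hE2 (by omega) h N

/-- **The Hodge conjecture for all powers of a 89-FOLD of signature `{44, 45}` — UNCONDITIONAL.**
[cite: Ribet1983, Thm. 3] [cite: Deligne2000, §1] -/
theorem hodgeConjectureFor_powSucc_of_eightyninefold_fortyFourFortyFive (A : AbelianVariety ℂ)
    (φ : A ⟶ A) {d : ℕ} (hd : 0 < d) (hφ : φ ≫ φ = -(d • 𝟙 A)) (hE2 : Module.finrank ℚ A.endAlgebra = 2)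
    (hX : A.dim = 89)
    (h44 : eigenMultiplicity A φ (Complex.I * (Real.sqrt d : ℂ)) = 44 ∨
      eigenMultiplicity A φ (-(Complex.I * (Real.sqrt d : ℂ))) = 44)
    (N : ℕ) : HodgeConjectureFor (A.powSucc N).dim (A.powSucc N).X :=
  hodgeConjectureFor_of_isDivisorGenerated _
    (AbelianVariety.isDivisorGenerated_powSucc_of_eightyninefold_fortyFourFortyFive A φ hd hφ hE2 hX h44 N)

end Cells

/-! ### §2 Every simple complex abelian 89-fold with `End⁰ ≠ ℚ` -/

section Final

variable {X : AbelianVariety ℂ}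

/-- **`B• = D•` on all powers of a SIMPLE complex abelian `89`-FOLD, granted ONLY the shape `End⁰ = ℚ`.** (The census
`isDivisorGenerated_powSucc_of_isSimple_eightyninefold` with all its imaginary-quadratic inputs, the `k`-signatures
`{8, 81}`, `{9, 80}`, `{12, 77}`, `{14, 75}`, `{15, 74}`, `{17, 72}`, `{19, 70}`, `{20, 69}`, `{21, 68}`, `{23, 66}`, `{24, 65}`, `{25, 64}`, `{26, 63}`, `{27, 62}`, `{29, 60}`, `{31, 58}`, `{32, 57}`, `{33, 56}`, `{34, 55}`, `{35, 54}`, `{37, 52}`, `{38, 51}`, `{39, 50}`, `{40, 49}`, `{41, 48}`, `{43, 46}`, `{44, 45}`, supplied by §1.)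
[cite: MoonenZarhin1999LowDim, §2 (2.4) and Thm. (2.7)] [cite: Ribet1983, Thms. 0–3] [cite: Gordon1997, Thm. 6.3 and Corollary] -/
theorem isDivisorGenerated_powSucc_of_isSimple_eightyninefold' (hs : X.IsSimple) (hX : X.dim = 89)
    (h1 : Module.finrank ℚ X.endAlgebra = 1 → ∀ N : ℕ, IsDivisorGenerated (X.powSucc N)) (N : ℕ) :
    IsDivisorGenerated (X.powSucc N) := by
  refine isDivisorGenerated_powSucc_of_isSimple_eightyninefold hs hX h1 (fun φ d hd hφ he2 h N => ?_) N
  have hsum := eigenMultiplicity_add_eigenMultiplicity_neg_eq_dim X φ hd hφ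
  rw [hX] at hsum
  by_cases h8 : eigenMultiplicity X φ (Complex.I * (Real.sqrt d : ℂ)) = 8 ∨ eigenMultiplicity X φ (-(Complex.I * (Real.sqrt d : ℂ))) = 8
  · exact AbelianVariety.isDivisorGenerated_powSucc_of_eightyninefold_eightEightyOne X φ hd hφ he2 hX h8 N
  by_cases h9 : eigenMultiplicity X φ (Complex.I * (Real.sqrt d : ℂ)) = 9 ∨ eigenMultiplicity X φ (-(Complex.I * (Real.sqrt d : ℂ))) = 9
  · exact AbelianVariety.isDivisorGenerated_powSucc_of_eightyninefold_nineEighty X φ hd hφ he2 hX h9 N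
  by_cases h12 : eigenMultiplicity X φ (Complex.I * (Real.sqrt d : ℂ)) = 12 ∨ eigenMultiplicity X φ (-(Complex.I * (Real.sqrt d : ℂ))) = 12
  · exact AbelianVariety.isDivisorGenerated_powSucc_of_eightyninefold_twelveSeventySeven X φ hd hφ he2 hX h12 N
  by_cases h14 : eigenMultiplicity X φ (Complex.I * (Real.sqrt d : ℂ)) = 14 ∨ eigenMultiplicity X φ (-(Complex.I * (Real.sqrt d : ℂ))) = 14
  · exact AbelianVariety.isDivisorGenerated_powSucc_of_eightyninefold_fourteenSeventyFive X φ hd hφ he2 hX h14 N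
  by_cases h15 : eigenMultiplicity X φ (Complex.I * (Real.sqrt d : ℂ)) = 15 ∨ eigenMultiplicity X φ (-(Complex.I * (Real.sqrt d : ℂ))) = 15
  · exact AbelianVariety.isDivisorGenerated_powSucc_of_eightyninefold_fifteenSeventyFour X φ hd hφ he2 hX h15 N
  by_cases h17 : eigenMultiplicity X φ (Complex.I * (Real.sqrt d : ℂ)) = 17 ∨ eigenMultiplicity X φ (-(Complex.I * (Real.sqrt d : ℂ))) = 17
  · exact AbelianVariety.isDivisorGenerated_powSucc_of_eightyninefold_seventeenSeventyTwo X φ hd hφ he2 hX h17 N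
  by_cases h19 : eigenMultiplicity X φ (Complex.I * (Real.sqrt d : ℂ)) = 19 ∨ eigenMultiplicity X φ (-(Complex.I * (Real.sqrt d : ℂ))) = 19
  · exact AbelianVariety.isDivisorGenerated_powSucc_of_eightyninefold_nineteenSeventy X φ hd hφ he2 hX h19 N
  by_cases h20 : eigenMultiplicity X φ (Complex.I * (Real.sqrt d : ℂ)) = 20 ∨ eigenMultiplicity X φ (-(Complex.I * (Real.sqrt d : ℂ))) = 20
  · exact AbelianVariety.isDivisorGenerated_powSucc_of_eightyninefold_twentySixtyNine X φ hd hφ he2 hX h20 N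
  by_cases h21 : eigenMultiplicity X φ (Complex.I * (Real.sqrt d : ℂ)) = 21 ∨ eigenMultiplicity X φ (-(Complex.I * (Real.sqrt d : ℂ))) = 21
  · exact AbelianVariety.isDivisorGenerated_powSucc_of_eightyninefold_twentyOneSixtyEight X φ hd hφ he2 hX h21 N
  by_cases h23 : eigenMultiplicity X φ (Complex.I * (Real.sqrt d : ℂ)) = 23 ∨ eigenMultiplicity X φ (-(Complex.I * (Real.sqrt d : ℂ))) = 23
  · exact AbelianVariety.isDivisorGenerated_powSucc_of_eightyninefold_twentyThreeSixtySix X φ hd hφ he2 hX h23 N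
  by_cases h24 : eigenMultiplicity X φ (Complex.I * (Real.sqrt d : ℂ)) = 24 ∨ eigenMultiplicity X φ (-(Complex.I * (Real.sqrt d : ℂ))) = 24
  · exact AbelianVariety.isDivisorGenerated_powSucc_of_eightyninefold_twentyFourSixtyFive X φ hd hφ he2 hX h24 N
  by_cases h25 : eigenMultiplicity X φ (Complex.I * (Real.sqrt d : ℂ)) = 25 ∨ eigenMultiplicity X φ (-(Complex.I * (Real.sqrt d : ℂ))) = 25
  · exact AbelianVariety.isDivisorGenerated_powSucc_of_eightyninefold_twentyFiveSixtyFour X φ hd hφ he2 hX h25 N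
  by_cases h26 : eigenMultiplicity X φ (Complex.I * (Real.sqrt d : ℂ)) = 26 ∨ eigenMultiplicity X φ (-(Complex.I * (Real.sqrt d : ℂ))) = 26
  · exact AbelianVariety.isDivisorGenerated_powSucc_of_eightyninefold_twentySixSixtyThree X φ hd hφ he2 hX h26 N
  by_cases h27 : eigenMultiplicity X φ (Complex.I * (Real.sqrt d : ℂ)) = 27 ∨ eigenMultiplicity X φ (-(Complex.I * (Real.sqrt d : ℂ))) = 27
  · exact AbelianVariety.isDivisorGenerated_powSucc_of_eightyninefold_twentySevenSixtyTwo X φ hd hφ he2 hX h27 N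
  by_cases h29 : eigenMultiplicity X φ (Complex.I * (Real.sqrt d : ℂ)) = 29 ∨ eigenMultiplicity X φ (-(Complex.I * (Real.sqrt d : ℂ))) = 29
  · exact AbelianVariety.isDivisorGenerated_powSucc_of_eightyninefold_twentyNineSixty X φ hd hφ he2 hX h29 N
  by_cases h31 : eigenMultiplicity X φ (Complex.I * (Real.sqrt d : ℂ)) = 31 ∨ eigenMultiplicity X φ (-(Complex.I * (Real.sqrt d : ℂ))) = 31
  · exact AbelianVariety.isDivisorGenerated_powSucc_of_eightyninefold_thirtyOneFiftyEight X φ hd hφ he2 hX h31 N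
  by_cases h32 : eigenMultiplicity X φ (Complex.I * (Real.sqrt d : ℂ)) = 32 ∨ eigenMultiplicity X φ (-(Complex.I * (Real.sqrt d : ℂ))) = 32
  · exact AbelianVariety.isDivisorGenerated_powSucc_of_eightyninefold_thirtyTwoFiftySeven X φ hd hφ he2 hX h32 N
  by_cases h33 : eigenMultiplicity X φ (Complex.I * (Real.sqrt d : ℂ)) = 33 ∨ eigenMultiplicity X φ (-(Complex.I * (Real.sqrt d : ℂ))) = 33
  · exact AbelianVariety.isDivisorGenerated_powSucc_of_eightyninefold_thirtyThreeFiftySix X φ hd hφ he2 hX h33 N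
  by_cases h34 : eigenMultiplicity X φ (Complex.I * (Real.sqrt d : ℂ)) = 34 ∨ eigenMultiplicity X φ (-(Complex.I * (Real.sqrt d : ℂ))) = 34
  · exact AbelianVariety.isDivisorGenerated_powSucc_of_eightyninefold_thirtyFourFiftyFive X φ hd hφ he2 hX h34 N
  by_cases h35 : eigenMultiplicity X φ (Complex.I * (Real.sqrt d : ℂ)) = 35 ∨ eigenMultiplicity X φ (-(Complex.I * (Real.sqrt d : ℂ))) = 35
  · exact AbelianVariety.isDivisorGenerated_powSucc_of_eightyninefold_thirtyFiveFiftyFour X φ hd hφ he2 hX h35 N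
  by_cases h37 : eigenMultiplicity X φ (Complex.I * (Real.sqrt d : ℂ)) = 37 ∨ eigenMultiplicity X φ (-(Complex.I * (Real.sqrt d : ℂ))) = 37
  · exact AbelianVariety.isDivisorGenerated_powSucc_of_eightyninefold_thirtySevenFiftyTwo X φ hd hφ he2 hX h37 N
  by_cases h38 : eigenMultiplicity X φ (Complex.I * (Real.sqrt d : ℂ)) = 38 ∨ eigenMultiplicity X φ (-(Complex.I * (Real.sqrt d : ℂ))) = 38
  · exact AbelianVariety.isDivisorGenerated_powSucc_of_eightyninefold_thirtyEightFiftyOne X φ hd hφ he2 hX h38 N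
  by_cases h39 : eigenMultiplicity X φ (Complex.I * (Real.sqrt d : ℂ)) = 39 ∨ eigenMultiplicity X φ (-(Complex.I * (Real.sqrt d : ℂ))) = 39
  · exact AbelianVariety.isDivisorGenerated_powSucc_of_eightyninefold_thirtyNineFifty X φ hd hφ he2 hX h39 N
  by_cases h40 : eigenMultiplicity X φ (Complex.I * (Real.sqrt d : ℂ)) = 40 ∨ eigenMultiplicity X φ (-(Complex.I * (Real.sqrt d : ℂ))) = 40
  · exact AbelianVariety.isDivisorGenerated_powSucc_of_eightyninefold_fortyFortyNine X φ hd hφ he2 hX h40 N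
  by_cases h41 : eigenMultiplicity X φ (Complex.I * (Real.sqrt d : ℂ)) = 41 ∨ eigenMultiplicity X φ (-(Complex.I * (Real.sqrt d : ℂ))) = 41
  · exact AbelianVariety.isDivisorGenerated_powSucc_of_eightyninefold_fortyOneFortyEight X φ hd hφ he2 hX h41 N
  by_cases h43 : eigenMultiplicity X φ (Complex.I * (Real.sqrt d : ℂ)) = 43 ∨ eigenMultiplicity X φ (-(Complex.I * (Real.sqrt d : ℂ))) = 43
  · exact AbelianVariety.isDivisorGenerated_powSucc_of_eightyninefold_fortyThreeFortySix X φ hd hφ he2 hX h43 N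
  by_cases h44 : eigenMultiplicity X φ (Complex.I * (Real.sqrt d : ℂ)) = 44 ∨ eigenMultiplicity X φ (-(Complex.I * (Real.sqrt d : ℂ))) = 44
  · exact AbelianVariety.isDivisorGenerated_powSucc_of_eightyninefold_fortyFourFortyFive X φ hd hφ he2 hX h44 N
  omega

/-- **`B• = D•` on all powers of EVERY SIMPLE complex abelian `89`-FOLD with `End⁰ ≠ ℚ` — UNCONDITIONAL.**
[cite: MoonenZarhin1999LowDim, §2 (2.4) and Thm. (2.7)] [cite: Ribet1983, Thms. 0–3] -/
theorem isDivisorGenerated_powSucc_of_isSimple_eightyninefold_of_finrank_endAlgebra_ne_one (hs : X.IsSimple)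
    (hX : X.dim = 89) (hne : Module.finrank ℚ X.endAlgebra ≠ 1) (N : ℕ) : IsDivisorGenerated (X.powSucc N) :=
  isDivisorGenerated_powSucc_of_isSimple_eightyninefold' hs hX (fun h => absurd h hne) N

/-- **The Hodge conjecture for all powers of EVERY SIMPLE complex abelian `89`-FOLD with `End⁰ ≠ ℚ` —
UNCONDITIONAL.** [cite: MoonenZarhin1999LowDim, §2 Thm. (2.7)] [cite: Ribet1983, Thm. 3] [cite: Deligne2000, §1] -/
theorem hodgeConjectureFor_powSucc_of_isSimple_eightyninefold_of_finrank_endAlgebra_ne_one (hs : X.IsSimple)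
    (hX : X.dim = 89) (hne : Module.finrank ℚ X.endAlgebra ≠ 1) (N : ℕ) :
    HodgeConjectureFor (X.powSucc N).dim (X.powSucc N).X :=
  hodgeConjectureFor_of_isDivisorGenerated _
    (isDivisorGenerated_powSucc_of_isSimple_eightyninefold_of_finrank_endAlgebra_ne_one hs hX hne N)

end Final

end Literature.AlgebraicGeometry.HodgeTheory

end

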